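import Literature.MathematicalPhysics.KineticTheory.TaggedSphereHydrodynamicModeProfile
import Literature.MathematicalPhysics.KineticTheory.TaggedSphereModeEnergy
import HarnessLib

/-!
# BGSR (6.3) for a single Fourier mode, II: `L²(M_β dv)` estimates for the velocity profile
(Bodineau–Gallagher–Saint-Raymond, Invent. Math. 203 (2016) = arXiv:1305.3397v2, §6.1.2–6.1.3;
a layer of the proof of the named fact
`Literature.MathematicalPhysics.KineticTheory.bgsr_hydrodynamicLimit_mode` of
`TaggedSphereHydrodynamicReduction`)

`TaggedSphereHydrodynamicModeProfile` reduces (6.3) for the single-mode data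
`1 + a₁ cos(2π n·x) + a₂ sin(2π n·x)` to the relaxation of the velocity profile `ĝ_n(t, v)`
(`modeProfile`), the bounded solution of `∂ₜ ĝ = -i ω_n(v) ĝ - α L ĝ`, `ĝ(0) = 1`, towards
`e^{-λ' t}`, `λ' = 4π² κ_β |n|² / α`. This file proves the `L²(M_β dv)` half of that relaxation:

* `modeProfile_sq_relaxation` — for `T ≥ 0` there is `C` with
  `∫ |ĝ_n(t, v) - e^{-λ' t}|² M_β(v) dv ≤ C / α²` for all `α ≥ 1`, `0 ≤ t ≤ αT`.

BGSR prove (6.3) by the Hilbert expansion `ρ + α⁻¹ ρ₁ + α⁻² ρ₂` (§6.1.2) and an `M_β`-weighted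
maximum principle (§6.1.3). The correctors `b` (6.5) and `D` (6.7) are only known in
`L²(a_β M_β)` (Lemma 6.1), so here the expansion is replaced by the equivalent energy/corrector
argument in `L²(M_β)`, which uses the first corrector only:

1. **Energy** (`hasDerivAt_profileEnergy`, `integral_energyDeriv_eq`, `integral_dissipation_eq`):
   `d/dt ∫ |ĝ|² M_β = -2α (B(g₁, g₁) + B(g₂, g₂))`, `B` the Dirichlet form of `L`
   (`dirichletForm`, `TaggedSphereSpectralGap`), `g₁ + i g₂ = ĝ`; hence
   `∫₀ᵗ (B₁ + B₂) = (1 - E(t))/(2α) ≤ 1/(2α)`.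
2. **Mean** (`hasDerivAt_meanRe/Im`): `m = ∫ ĝ M_β` has `m' = -i ∫ ω_n ĝ M_β` (mass conservation
   `∫ K⁺h M_β = ∫ a_β h M_β`), and `∫ ω_n M_β = 0`.
3. **Corrector** (`hasDerivAt_testRe/Im`, `IsDiffusionCorrector.dirichletForm_inner_eq`): for
   `χ = ℓ·b`, `ℓ = latticeVec n` (`L χ = ℓ·v = ω_n/2π` a.e., `∫ χ M_β = 0`), the moments
   `J = ∫ ĝ χ M_β` satisfy `J' = (phase terms) - (α/2π) ∫ ω_n ĝ M_β`, so that
   `∫ ω_n ĝ M_β = -(2π/α)(J' + phase terms)` is `O(1/α)` in time-integrated form; with the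
   isotropy `∫ ω_n χ M_β = 2π κ_β |ℓ|²` (`integral_modePhase_mul_inner`) this gives
   `(e^{λ' s}(m₁ + (2π/α) J₂))' = (2π/α) e^{λ' s}(λ' J₂ - I₁)` with the cross term
   `I₁ = ∫ ω_n (g₁ - m₁) χ M_β`, `2|I₁| ≤ α(B₁ + B₂) + K_χ/(αc)` (Cauchy–Schwarz with the weight
   `a_β`, AM–GM, spectral gap), whence `|m₁(t) - e^{-λ' t}|, |m₂(t)| ≤ C_m/α` on `[0, αT]`
   (`abs_meanRe_sub_exp_le`, `abs_meanIm_le`, through the Duhamel bound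
   `abs_sub_le_of_deriv_bound`).
4. **Variance** (`exists_variance_bound`): `y = E - |m|² = ∫ |ĝ - m|² M_β` has `y(0) = 0` and
   `y' ≤ -α c a₀ y + 2 K_ω/(αc)` (`variance_dissipation_ineq`: spectral gap in `M_β`-centred form,
   `exists_spectralGap_centred`; Cauchy–Schwarz `(∫ ω_n w M_β)² ≤ (∫ ω_n²/a_β M_β)(∫ w² a_β M_β)`),
   so `y ≤ 2K_ω/(α² c² a₀)` for all `t ≥ 0` by the barrier lemma `le_of_deriv_nonpos_above`.
5. **Bias–variance** (`integral_normSq_sub_const_eq`) assembles `modeProfile_sq_relaxation`.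

All time derivatives are obtained by differentiating under the integral sign
(`hasDerivAt_profileMoment`, dominated by `|Γ_n(t, v)| ≤ C(1 + |v| + a_β(v))`), and the functionals
are continuous in time by dominated convergence, so the fundamental theorem of calculus and the
mean value theorem apply on `[0, t]` (the profile is differentiable for `t > 0` only).

## Design choices

* Everything is expressed with real and imaginary parts (`Complex.reCLM`, `Complex.imCLM`) and
  the real quadratic forms of `TaggedSphereCarleman` / `TaggedSphereSpectralGap`; the generic
  moment `profileMoment n β α p ψ t = ∫ p(ĝ_n(t, v)) ψ(v) M_β(v) dv` covers the mean (`ψ = 1`) and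
  the corrector moments (`ψ = ℓ·b`).
* Constants are explicit but not optimised; only their independence of `α ≥ 1` matters.
* The bounded-function toolkit (`finiteEnergy_of_bounded`, `integrable_carlemanKernel_mul_of_bounded`,
  `FiniteEnergy.integrable_mul_mul`) is imported from `TaggedSphereModeEnergy`, whose energy
  estimate for abstract mode pairs (`IsModePair.modeEnergy_le`, with the second corrector (6.7))
  is a parallel treatment of the same step; the present file works with the concrete profile
  `modeProfile` of `TaggedSphereHydrodynamicModeProfile` and the first corrector only.
* `d ≥ 2` enters through the Carleman representation and the gap; `n ≠ 0` is never needed.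

## References

* T. Bodineau, I. Gallagher, L. Saint-Raymond, *The Brownian motion as the limit of a
  deterministic system of hard-spheres*, Invent. Math. 203 (2016) 493–553 = arXiv:1305.3397v2,
  §6.1.2 (Lemma 6.1, (6.5), (6.8)), §6.1.3.
* A. Bensoussan, J.-L. Lions, G. Papanicolaou, *Boundary layers and homogenization of transport
  processes*, Publ. RIMS 15 (1979) 53–157 (BGSR's [6]).
-/

open MeasureTheory Metric Set Filter Topology ProbabilityTheory
open scoped InnerProductSpace ENNReal ComplexConjugate

namespace Literature.MathematicalPhysics.KineticTheory

noncomputable section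

open Literature.Analysis.FunctionSpaces (maxwellianBeta maxwellianBeta_pos)

variable {d : Type*} [Fintype d]

local notation "𝔼" => EuclideanSpace ℝ d

/-! # Part II. `L²(M_β dv)` estimates for the velocity profile -/

section EnergyToolkit

open TaggedSphereDiffusion (collisionFrequency)

variable (hd : 2 ≤ Fintype.card d) {β : ℝ} (hβ : 0 < β)

/-! ## Bounded velocity functions: finite energy, Carleman form of `K⁺`, quadratic forms -/

include hd hβ in
/-- **Carleman form of the gain operator on bounded functions**, at every `v`. [folklore] -/
theorem linearBoltzmannGain_eq_carlemanGain_of_abs_le {h : 𝔼 → ℝ} (hm : Measurable h) {C : ℝ}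
    (hC : ∀ v, |h v| ≤ C) (v : 𝔼) : linearBoltzmannGain β h v = carlemanGain β h v :=
  linearBoltzmannGain_eq_carlemanGain hd hβ hm v (integrable_carlemanKernel_mul_of_bounded hd hβ hm hC v)

include hd hβ in
/-- **`⟨K⁺ h, f⟩_{L²(M_β)} = Q_β(h, f)`** for `h` bounded measurable and `f` of finite energy.
[folklore] -/
theorem integral_gain_mul_mul_maxwellianBeta {h f : 𝔼 → ℝ} (hm : Measurable h) {C : ℝ}
    (hC : ∀ v, |h v| ≤ C) (hf : FiniteEnergy β f) :
    ∫ v, linearBoltzmannGain β h v * f v * maxwellianBeta β v = carlemanForm β h f := by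
  have hfe := finiteEnergy_of_bounded hβ hm hC
  rw [carlemanForm_eq_integral_carlemanGain hd hβ hfe.measurable hfe.integrable hf.measurable
    hf.integrable]
  refine integral_congr_ae (Eventually.of_forall fun v => ?_)
  simp only
  rw [linearBoltzmannGain_eq_carlemanGain_of_abs_le hd hβ hm hC v]

include hd hβ in
/-- **Mass conservation of the gain operator**: `∫ (K⁺ h) M_β = ∫ a_β h M_β` for bounded `h`.
[folklore] -/
theorem integral_gain_mul_maxwellianBeta {h : 𝔼 → ℝ} (hm : Measurable h) {C : ℝ}
    (hC : ∀ v, |h v| ≤ C) :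
    ∫ v, linearBoltzmannGain β h v * maxwellianBeta β v =
      ∫ v, collisionFrequency β v * h v * maxwellianBeta β v := by
  have h1 := integral_gain_mul_mul_maxwellianBeta hd hβ hm hC (finiteEnergy_const (d := d) hβ 1)
  simp only [mul_one] at h1
  rw [h1, carlemanForm_one_right hd hβ (finiteEnergy_of_bounded hβ hm hC)]
  refine integral_congr_ae (Eventually.of_forall fun v => ?_)
  ring

include hd hβ in
/-- The Dirichlet form on a bounded function: `B(h, h) = ∫ h² a_β M_β - ∫ (K⁺ h) h M_β`. [folklore] -/
theorem dirichletForm_self_eq_of_abs_le {h : 𝔼 → ℝ} (hm : Measurable h) {C : ℝ}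
    (hC : ∀ v, |h v| ≤ C) :
    dirichletForm β h h = (∫ v, h v ^ 2 * (collisionFrequency β v * maxwellianBeta β v)) -
      ∫ v, linearBoltzmannGain β h v * h v * maxwellianBeta β v := by
  rw [dirichletForm, integral_gain_mul_mul_maxwellianBeta hd hβ hm hC (finiteEnergy_of_bounded hβ hm hC)]
  congr 1
  refine integral_congr_ae (Eventually.of_forall fun v => ?_)
  ring

/-! ## Products of square-integrable functions against `M_β` -/

include hβ in
/-- `|f g| M_β` is integrable when `f² M_β` and `g² M_β` are (`2|fg| ≤ f² + g²`). [folklore] -/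
theorem integrable_mul_mul_maxwellianBeta_of_sq {f g : 𝔼 → ℝ} (hfm : Measurable f) (hgm : Measurable g)
    (hf : Integrable fun v => f v ^ 2 * maxwellianBeta β v)
    (hg : Integrable fun v => g v ^ 2 * maxwellianBeta β v) :
    Integrable fun v => f v * g v * maxwellianBeta β v := by
  refine ((hf.add hg).div_const 2).mono'
    ((hfm.mul hgm).mul (KineticTheory.measurable_maxwellianBeta β)).aestronglyMeasurable
    (Eventually.of_forall fun v => ?_)
  have hM := (maxwellianBeta_pos hβ v).le
  rw [Real.norm_eq_abs, abs_mul, abs_of_nonneg hM, abs_mul]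
  simp only [Pi.add_apply]
  rw [le_div_iff₀ two_pos]
  nlinarith [mul_nonneg (mul_self_nonneg (|f v| - |g v|)) hM, sq_abs (f v), sq_abs (g v)]

include hβ in
/-- **`L²(M_β) ⊂ L¹(M_β)`-type bound**: `(∫ f M_β)² ≤ ∫ f² M_β` (`∫ M_β = 1`). [folklore] -/
theorem sq_integral_mul_maxwellianBeta_le {f : 𝔼 → ℝ} (hfm : Measurable f)
    (hf : Integrable fun v => f v ^ 2 * maxwellianBeta β v) :
    (∫ v, f v * maxwellianBeta β v) ^ 2 ≤ ∫ v, f v ^ 2 * maxwellianBeta β v := by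
  have h1sq : Integrable fun v : 𝔼 => (1 : ℝ) ^ 2 * maxwellianBeta β v :=
    (KineticTheory.integrable_maxwellianBeta hβ).congr (Eventually.of_forall fun v => by ring)
  have h1 : Integrable fun v => f v * maxwellianBeta β v := by
    have := integrable_mul_mul_maxwellianBeta_of_sq hβ hfm measurable_const hf h1sq
    simpa using this
  have hA : Integrable (fun v => maxwellianBeta β v * f v ^ 2) :=
    hf.congr (Eventually.of_forall fun v => by ring)
  have hC : Integrable (fun v : 𝔼 => maxwellianBeta β v * (1 : ℝ) ^ 2) :=
    (KineticTheory.integrable_maxwellianBeta hβ).congr (Eventually.of_forall fun v => by ring)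
  have hB : Integrable (fun v => maxwellianBeta β v * (f v * 1)) :=
    h1.congr (Eventually.of_forall fun v => by ring)
  have hcs := sq_integral_weight_mul_le (μ := (volume : Measure 𝔼)) (W := maxwellianBeta β) (u := f)
    (w := fun _ => (1 : ℝ)) (fun v => (maxwellianBeta_pos hβ v).le) hA hC hB
  simp only [mul_one, one_pow] at hcs
  rw [KineticTheory.integral_maxwellianBeta hβ, mul_one] at hcs
  calc (∫ v, f v * maxwellianBeta β v) ^ 2 = (∫ v, maxwellianBeta β v * f v) ^ 2 := by
        congr 1; exact integral_congr_ae (Eventually.of_forall fun v => by ring)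
    _ ≤ ∫ v, maxwellianBeta β v * f v ^ 2 := hcs
    _ = ∫ v, f v ^ 2 * maxwellianBeta β v := integral_congr_ae (Eventually.of_forall fun v => by ring)

/-! ## The spectral gap in `M_β`-centred form -/

include hd hβ in
/-- **Spectral gap, `M_β`-centred form**: there is `c > 0` with
`c ∫ (h - ∫ h M_β)² a_β M_β ≤ B(h, h)` for every `h` of finite energy (from `exists_spectralGap`,
whose centring is the `a_β M_β`-mean: the two centrings differ by a constant controlled by the
variance). [cite: BodineauGallagherSaintRaymondInvent2016, Lemma 6.1] -/
theorem exists_spectralGap_centred :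
    ∃ c : ℝ, 0 < c ∧ ∀ h : 𝔼 → ℝ, FiniteEnergy β h →
      c * ∫ v, (h v - ∫ w, h w * maxwellianBeta β w) ^ 2 *
          (collisionFrequency β v * maxwellianBeta β v) ≤ dirichletForm β h h := by
  obtain ⟨c₀, hc₀, hgap⟩ := exists_spectralGap hd hβ
  obtain ⟨a₀, ha₀, c, _hc, hlow⟩ := exists_collisionFrequency_lowerBound (d := d) hd hβ
  have hW := integrable_collisionFrequency_mul_maxwellianBeta (d := d) hβ
  set A : ℝ := ∫ v : 𝔼, collisionFrequency β v * maxwellianBeta β v with hA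
  have hA0 : 0 ≤ A := integral_nonneg fun v =>
    mul_nonneg (TaggedLinearBoltzmannSeries.collisionFrequency_nonneg hβ v) (maxwellianBeta_pos hβ v).le
  set L : ℝ := 2 + 2 * A / a₀ with hL
  have hL0 : 0 < L := by positivity
  refine ⟨c₀ / L, div_pos hc₀ hL0, fun h hh => ?_⟩
  set μ : ℝ := ∫ w, h w * maxwellianBeta β w with hμ
  set e : ℝ := energyMean β h with he
  have hhe : FiniteEnergy β (fun w => h w - e) := hh.sub_const hβ e
  have hhμ : FiniteEnergy β (fun w => h w - μ) := hh.sub_const hβ μ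
  have hi1 : Integrable fun v => (h v - e) ^ 2 * (collisionFrequency β v * maxwellianBeta β v) :=
    hhe.integrable.congr (Eventually.of_forall fun v => by ring)
  set X : ℝ := ∫ v, (h v - e) ^ 2 * (collisionFrequency β v * maxwellianBeta β v) with hX
  have hI0 : 0 ≤ X := integral_nonneg fun v => mul_nonneg (sq_nonneg _)
    (mul_nonneg (TaggedLinearBoltzmannSeries.collisionFrequency_nonneg hβ v) (maxwellianBeta_pos hβ v).le)
  -- (1) pointwise `(h - μ)² ≤ 2 (h - e)² + 2 (e - μ)²`, integrated against `a M`
  have h1 : ∫ v, (h v - μ) ^ 2 * (collisionFrequency β v * maxwellianBeta β v) ≤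
      2 * X + 2 * (e - μ) ^ 2 * A := by
    have hsum : ∫ v, (2 * ((h v - e) ^ 2 * (collisionFrequency β v * maxwellianBeta β v)) +
        2 * (e - μ) ^ 2 * (collisionFrequency β v * maxwellianBeta β v)) = 2 * X + 2 * (e - μ) ^ 2 * A := by
      rw [integral_add (hi1.const_mul 2) (hW.const_mul (2 * (e - μ) ^ 2)), integral_const_mul,
        integral_const_mul]
    rw [← hsum]
    refine integral_mono (hhμ.integrable.congr (Eventually.of_forall fun v => by ring))
      ((hi1.const_mul 2).add (hW.const_mul (2 * (e - μ) ^ 2))) fun v => ?_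
    have hWv : 0 ≤ collisionFrequency β v * maxwellianBeta β v :=
      mul_nonneg (TaggedLinearBoltzmannSeries.collisionFrequency_nonneg hβ v) (maxwellianBeta_pos hβ v).le
    have : (h v - μ) ^ 2 ≤ 2 * (h v - e) ^ 2 + 2 * (e - μ) ^ 2 := by
      nlinarith [sq_nonneg (h v - e - (e - μ))]
    calc (h v - μ) ^ 2 * (collisionFrequency β v * maxwellianBeta β v)
        ≤ (2 * (h v - e) ^ 2 + 2 * (e - μ) ^ 2) * (collisionFrequency β v * maxwellianBeta β v) :=
          mul_le_mul_of_nonneg_right this hWv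
      _ = 2 * ((h v - e) ^ 2 * (collisionFrequency β v * maxwellianBeta β v)) +
          2 * (e - μ) ^ 2 * (collisionFrequency β v * maxwellianBeta β v) := by ring
  -- (2) `(e - μ)² ≤ ∫ (h - e)² M ≤ a₀⁻¹ ∫ (h - e)² a M`
  have hM1 := KineticTheory.integral_maxwellianBeta (d := d) hβ
  have hhM : Integrable fun v => h v * maxwellianBeta β v := integrable_mul_maxwellianBeta_of_finiteEnergy hd hβ hh
  have hsqM : Integrable fun v => (h v - e) ^ 2 * maxwellianBeta β v :=
    integrable_sq_mul_maxwellianBeta_of_finiteEnergy hd hβ hhe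
  have h2 : (e - μ) ^ 2 ≤ ∫ v, (h v - e) ^ 2 * maxwellianBeta β v := by
    have hint : ∫ v, (h v - e) * maxwellianBeta β v = μ - e := by
      have : (fun v => (h v - e) * maxwellianBeta β v) = fun v => h v * maxwellianBeta β v - e * maxwellianBeta β v := by
        funext v; ring
      rw [this, integral_sub hhM ((KineticTheory.integrable_maxwellianBeta hβ).const_mul e), integral_const_mul, hM1,
        mul_one]
    have hcs := sq_integral_mul_maxwellianBeta_le hβ (f := fun v => h v - e)
      (hh.measurable.sub measurable_const) hsqM
    rw [hint] at hcs
    calc (e - μ) ^ 2 = (μ - e) ^ 2 := by ring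
      _ ≤ _ := hcs
  have h3 : ∫ v, (h v - e) ^ 2 * maxwellianBeta β v ≤ a₀⁻¹ * X := by
    rw [hX, ← integral_const_mul]
    refine integral_mono hsqM (hi1.const_mul _) fun v => ?_
    have hM := (maxwellianBeta_pos hβ v).le
    have ha := (hlow v).1
    rw [← div_eq_inv_mul, le_div_iff₀' ha₀]
    calc a₀ * ((h v - e) ^ 2 * maxwellianBeta β v) ≤ collisionFrequency β v * ((h v - e) ^ 2 * maxwellianBeta β v) :=
          mul_le_mul_of_nonneg_right ha (mul_nonneg (sq_nonneg _) hM)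
      _ = (h v - e) ^ 2 * (collisionFrequency β v * maxwellianBeta β v) := by ring
  -- (3) assemble with the gap
  have hg : c₀ * X ≤ dirichletForm β h h := hgap h hh
  have key : ∫ v, (h v - μ) ^ 2 * (collisionFrequency β v * maxwellianBeta β v) ≤ L * X := by
    have h23 : (e - μ) ^ 2 * A ≤ a₀⁻¹ * X * A := mul_le_mul_of_nonneg_right (h2.trans h3) hA0
    have hLX : L * X = 2 * X + 2 * (a₀⁻¹ * X * A) := by rw [hL]; ring
    rw [hLX]
    linarith [h1, h23]
  rw [div_mul_eq_mul_div, div_le_iff₀ hL0]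
  calc c₀ * ∫ v, (h v - μ) ^ 2 * (collisionFrequency β v * maxwellianBeta β v)
      ≤ c₀ * (L * X) := mul_le_mul_of_nonneg_left key hc₀.le
    _ = (c₀ * X) * L := by ring
    _ ≤ dirichletForm β h h * L := mul_le_mul_of_nonneg_right hg hL0.le

end EnergyToolkit

/-! ## The corrector test functions `χ_k = k·b` -/

section Corrector

open TaggedSphereDiffusion (collisionFrequency)

variable (hd : 2 ≤ Fintype.card d) {β : ℝ} (hβ : 0 < β)
  {b : EuclideanSpace ℝ d → EuclideanSpace ℝ d} (hb : IsDiffusionCorrector β b) (k : EuclideanSpace ℝ d)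

include hβ hb in
/-- `χ_k = k·b` has finite energy (`(k·b)² ≤ |k|² |b|²`, `b ∈ L²(a_β M_β)`). [folklore] -/
theorem IsDiffusionCorrector.finiteEnergy_inner : FiniteEnergy β (fun v => ⟪k, b v⟫_ℝ) := by
  refine ⟨measurable_const.inner hb.1, ?_⟩
  refine (hb.2.1.const_mul (‖k‖ ^ 2)).mono'
    ((((measurable_const.inner hb.1).pow_const 2).mul (continuous_collisionFrequency hβ).measurable).mul
      (KineticTheory.measurable_maxwellianBeta β)).aestronglyMeasurable
    (Eventually.of_forall fun v => ?_)
  have ha := TaggedLinearBoltzmannSeries.collisionFrequency_nonneg hβ v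
  have hM := (maxwellianBeta_pos hβ v).le
  have hcs : ⟪k, b v⟫_ℝ ^ 2 ≤ ‖k‖ ^ 2 * ‖b v‖ ^ 2 := by
    have h1 := abs_real_inner_le_norm k (b v)
    have h2 : 0 ≤ ‖k‖ * ‖b v‖ := by positivity
    nlinarith [abs_nonneg ⟪k, b v⟫_ℝ, sq_abs ⟪k, b v⟫_ℝ]
  rw [Real.norm_of_nonneg (mul_nonneg (mul_nonneg (sq_nonneg _) ha) hM)]
  calc ⟪k, b v⟫_ℝ ^ 2 * collisionFrequency β v * maxwellianBeta β v
      = ⟪k, b v⟫_ℝ ^ 2 * (collisionFrequency β v * maxwellianBeta β v) := by ring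
    _ ≤ ‖k‖ ^ 2 * ‖b v‖ ^ 2 * (collisionFrequency β v * maxwellianBeta β v) :=
        mul_le_mul_of_nonneg_right hcs (mul_nonneg ha hM)
    _ = ‖k‖ ^ 2 * (‖b v‖ ^ 2 * collisionFrequency β v * maxwellianBeta β v) := by ring

include hd hβ hb in
/-- `χ_k` is centred: `∫ k·b M_β = k·∫ b M_β = 0`. [cite: BodineauGallagherSaintRaymondInvent2016, (6.5)] -/
theorem IsDiffusionCorrector.integral_inner_mul_maxwellianBeta :
    ∫ v, ⟪k, b v⟫_ℝ * maxwellianBeta β v = 0 := by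
  have hfi : ∀ i, FiniteEnergy β (fun v => b v i) := fun i => hb.finiteEnergy_apply hβ i
  have h := integral_inner (𝕜 := ℝ) (integrable_maxwellianBeta_smul_of_finiteEnergy hd hβ hb.1 hfi) k
  rw [hb.2.2.1, inner_zero_right] at h
  rw [← h]
  refine integral_congr_ae (Eventually.of_forall fun v => ?_)
  simp only
  rw [inner_smul_right, mul_comm]

include hd hβ hb in
/-- **The corrector equation tested against `k`**, in Carleman form:
`a_β χ_k - K χ_k = k·v` a.e. (linearity of `L` where the Carleman integrals converge).
[cite: BodineauGallagherSaintRaymondInvent2016, (6.5)] -/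
theorem IsDiffusionCorrector.ae_inner_sub_carlemanGain_eq :
    ∀ᵐ v : 𝔼, collisionFrequency β v * ⟪k, b v⟫_ℝ - carlemanGain β (fun w => ⟪k, b w⟫_ℝ) v = ⟪k, v⟫_ℝ := by
  have hfe := fun i => hb.finiteEnergy_apply hβ i
  have hall : ∀ᵐ v : 𝔼, ∀ i, (collisionFrequency β v * b v i - carlemanGain β (fun w => b w i) v = v i) ∧
      Integrable fun u => carlemanKernel β v u * b (v + u) i := by
    refine ae_all_iff.2 fun i => ?_
    filter_upwards [hb.ae_sub_carlemanGain_eq hd hβ i,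
      ae_integrable_carlemanKernel_mul hd hβ (hfe i).measurable (hfe i).integrable] with v h1 h2
    exact ⟨h1, h2⟩
  filter_upwards [hall] with v hv
  have hK : carlemanGain β (fun w => ⟪k, b w⟫_ℝ) v = ∑ i, k i * carlemanGain β (fun w => b w i) v := by
    rw [carlemanGain]
    have e1 : (fun u => carlemanKernel β v u * ⟪k, b (v + u)⟫_ℝ) =
        fun u => ∑ i, k i * (carlemanKernel β v u * b (v + u) i) := by
      funext u
      rw [inner_eq_sum_apply, Finset.mul_sum]
      exact Finset.sum_congr rfl fun i _ => by ring
    rw [e1, integral_finsetSum _ (fun i _ => (hv i).2.const_mul (k i))]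
    refine Finset.sum_congr rfl fun i _ => ?_
    rw [integral_const_mul]
    rfl
  rw [hK, inner_eq_sum_apply k (b v), inner_eq_sum_apply k v, Finset.mul_sum, ← Finset.sum_sub_distrib]
  refine Finset.sum_congr rfl fun i _ => ?_
  linear_combination (k i) * (hv i).1

include hd hβ hb in
/-- `(K χ_k) f M_β` is integrable for `f` of finite energy (Fubini). [folklore] -/
theorem IsDiffusionCorrector.integrable_carlemanGain_inner_mul {f : 𝔼 → ℝ} (hf : FiniteEnergy β f) :
    Integrable fun v => carlemanGain β (fun w => ⟪k, b w⟫_ℝ) v * f v * maxwellianBeta β v := by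
  have hχ := hb.finiteEnergy_inner hβ k
  have hprod := integrable_weight_mul_mul hd hβ hχ.measurable hχ.integrable hf.measurable hf.integrable
  refine hprod.integral_prod_left.congr (Eventually.of_forall fun v => ?_)
  simp only
  rw [carlemanGain, ← integral_mul_const, ← integral_mul_const]
  exact integral_congr_ae (Eventually.of_forall fun u => by ring)

include hd hβ hb in
/-- **The corrector identity for the Dirichlet form**: `B(f, χ_k) = ∫ (k·v) f M_β` for `f` of
finite energy (`B` is symmetric and `L χ_k = k·v`). [cite: BodineauGallagherSaintRaymondInvent2016, (6.5)] -/
theorem IsDiffusionCorrector.dirichletForm_inner_eq {f : 𝔼 → ℝ} (hf : FiniteEnergy β f) :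
    dirichletForm β f (fun v => ⟪k, b v⟫_ℝ) = ∫ v, ⟪k, v⟫_ℝ * f v * maxwellianBeta β v := by
  have hχ := hb.finiteEnergy_inner hβ k
  rw [dirichletForm, carlemanForm_comm hβ, carlemanForm_eq_integral_carlemanGain hd hβ hχ.measurable
    hχ.integrable hf.measurable hf.integrable,
    ← integral_sub (FiniteEnergy.integrable_mul_mul hβ hf hχ) (hb.integrable_carlemanGain_inner_mul hd hβ k hf)]
  refine integral_congr_ae ?_
  filter_upwards [hb.ae_inner_sub_carlemanGain_eq hd hβ k] with v hv
  rw [← hv]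
  ring

include hβ in
/-- `(k·v)² M_β` is integrable (Gaussian second moment). [folklore] -/
theorem integrable_inner_sq_mul_maxwellianBeta : Integrable fun v : 𝔼 => ⟪k, v⟫_ℝ ^ 2 * maxwellianBeta β v := by
  have h2 := KineticTheory.integrable_pow_norm_mul_maxwellianBeta (d := d) hβ 2
  refine (h2.const_mul (‖k‖ ^ 2)).mono'
    (((measurable_const.inner measurable_id).pow_const 2).mul
      (KineticTheory.measurable_maxwellianBeta β)).aestronglyMeasurable
    (Eventually.of_forall fun v => ?_)
  have hM := (maxwellianBeta_pos hβ v).le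
  have hcs : ⟪k, v⟫_ℝ ^ 2 ≤ ‖k‖ ^ 2 * ‖v‖ ^ 2 := by
    have h1 := abs_real_inner_le_norm k v
    have h2 : 0 ≤ ‖k‖ * ‖v‖ := by positivity
    nlinarith [abs_nonneg ⟪k, v⟫_ℝ, sq_abs ⟪k, v⟫_ℝ]
  rw [Real.norm_of_nonneg (mul_nonneg (sq_nonneg _) hM)]
  calc ⟪k, v⟫_ℝ ^ 2 * maxwellianBeta β v ≤ ‖k‖ ^ 2 * ‖v‖ ^ 2 * maxwellianBeta β v :=
        mul_le_mul_of_nonneg_right hcs hM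
    _ = ‖k‖ ^ 2 * (‖v‖ ^ 2 * maxwellianBeta β v) := by ring

include hd hβ hb in
/-- `(k·v) χ_k M_β` is integrable, with integral `κ_β |k|²` (isotropy,
`IsDiffusionCorrector.integral_inner_mul_inner`). [folklore] -/
theorem IsDiffusionCorrector.integrable_inner_mul_inner_mul :
    Integrable fun v => ⟪k, v⟫_ℝ * ⟪k, b v⟫_ℝ * maxwellianBeta β v :=
  integrable_mul_mul_maxwellianBeta_of_sq hβ (measurable_const.inner measurable_id)
    (measurable_const.inner hb.1) (integrable_inner_sq_mul_maxwellianBeta hβ k)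
    (integrable_sq_mul_maxwellianBeta_of_finiteEnergy hd hβ (hb.finiteEnergy_inner hβ k))

end Corrector

/-! ## Time derivatives of the `M_β`-moments of the profile -/

section Moments

open TaggedSphereDiffusion (collisionFrequency)

variable {β : ℝ} (hβ : 0 < β) {α : ℝ} (hα : 0 ≤ α) (n : d → ℤ)

/-- The `M_β`-moment `∫ p(ĝ_n(t, v)) ψ(v) M_β(v) dv` of the profile against a real-linear
functional `p` of `ℂ` (real or imaginary part) and a weight `ψ`. [folklore] -/
def profileMoment (n : d → ℤ) (β α : ℝ) (p : ℂ →L[ℝ] ℝ) (ψ : EuclideanSpace ℝ d → ℝ) (t : ℝ) : ℝ :=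
  ∫ v, p (modeProfile n β α t v) * ψ v * maxwellianBeta β v

/-- The `L²(M_β)`-energy `∫ |ĝ_n(t, v)|² M_β(v) dv` of the profile. [folklore] -/
def profileEnergy (n : d → ℤ) (β α : ℝ) (t : ℝ) : ℝ :=
  ∫ v, ((modeProfile n β α t v).re ^ 2 + (modeProfile n β α t v).im ^ 2) * maxwellianBeta β v

include hβ in
/-- The weight `(1 + |v| + a_β) M_β` is integrable. [folklore] -/
theorem integrable_one_add_norm_add_collisionFrequency_mul :
    Integrable fun v : 𝔼 => (1 + ‖v‖ + collisionFrequency β v) * maxwellianBeta β v := by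
  have h0 := KineticTheory.integrable_maxwellianBeta (d := d) hβ
  have h1 := KineticTheory.integrable_pow_norm_mul_maxwellianBeta (d := d) hβ 1
  have h2 := integrable_collisionFrequency_mul_maxwellianBeta (d := d) hβ
  simp only [pow_one] at h1
  exact ((h0.add h1).add h2).congr (Eventually.of_forall fun v => by simp only [Pi.add_apply]; ring)

include hβ hα in
/-- The dominating function of the time derivatives: `|Γ_n(t, v)| ≤ C (1 + |v| + a_β(v))` with
`C = max (4π |n|) (6α)`. [folklore] -/
theorem norm_modeDeriv_le_weight [DecidableEq d] (t : ℝ) (v : 𝔼) :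
    ‖modeDeriv n β α t v‖ ≤ max (4 * Real.pi * ‖Literature.Analysis.FunctionSpaces.Torus.latticeVec n‖) (6 * α) *
      (1 + ‖v‖ + collisionFrequency β v) := by
  set C := max (4 * Real.pi * ‖Literature.Analysis.FunctionSpaces.Torus.latticeVec n‖) (6 * α) with hC
  have h1 := norm_modeDeriv_le hβ hα n t v
  have hω := abs_modePhase_le n v
  have hC1 : 4 * Real.pi * ‖Literature.Analysis.FunctionSpaces.Torus.latticeVec n‖ ≤ C := le_max_left _ _
  have hC2 : 6 * α ≤ C := le_max_right _ _
  have hC0 : 0 ≤ C := le_trans (by positivity) hC2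
  have ha := TaggedLinearBoltzmannSeries.collisionFrequency_nonneg hβ v
  have hv := norm_nonneg v
  calc ‖modeDeriv n β α t v‖ ≤ 2 * |modePhase n v| + 6 * α * collisionFrequency β v := h1
    _ ≤ C * ‖v‖ + C * collisionFrequency β v := by nlinarith
    _ ≤ C * (1 + ‖v‖ + collisionFrequency β v) := by nlinarith

include hβ hα in
/-- **Differentiation of the moments under the integral sign.** For `t > 0`, a real-linear
`p : ℂ → ℝ` with `|p z| ≤ |z|` and a measurable weight `ψ` with `(1 + |v| + a_β)|ψ| M_β`
integrable, `d/dt ∫ p(ĝ_n(t, v)) ψ M_β = ∫ p(Γ_n(t, v)) ψ M_β` (dominated differentiation: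
`|Γ_n| ≤ C (1 + |v| + a_β)`). [folklore] -/
theorem hasDerivAt_profileMoment [DecidableEq d] (p : ℂ →L[ℝ] ℝ) (hp : ∀ z, |p z| ≤ ‖z‖) {ψ : 𝔼 → ℝ}
    (hψm : Measurable ψ)
    (hψi : Integrable fun v => (1 + ‖v‖ + collisionFrequency β v) * |ψ v| * maxwellianBeta β v)
    {t : ℝ} (ht : 0 < t) :
    HasDerivAt (profileMoment n β α p ψ) (∫ v, p (modeDeriv n β α t v) * ψ v * maxwellianBeta β v) t := by
  set C := max (4 * Real.pi * ‖Literature.Analysis.FunctionSpaces.Torus.latticeVec n‖) (6 * α) with hC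
  have hC0 : 0 ≤ C := le_trans (by positivity) (le_max_right _ _)
  set F : ℝ → 𝔼 → ℝ := fun x v => p (modeProfile n β α x v) * ψ v * maxwellianBeta β v with hF
  set F' : ℝ → 𝔼 → ℝ := fun x v => p (modeDeriv n β α x v) * ψ v * maxwellianBeta β v with hF'
  have hs : Ioi (t / 2) ∈ 𝓝 t := Ioi_mem_nhds (by linarith)
  have hF_meas : ∀ x, AEStronglyMeasurable (F x) volume := fun x =>
    (((p.continuous.measurable.comp (measurable_modeProfile_right hβ hα n x)).mul hψm).mul
      (KineticTheory.measurable_maxwellianBeta β)).aestronglyMeasurable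
  have hF'_meas : AEStronglyMeasurable (F' t) volume :=
    (((p.continuous.measurable.comp ((continuous_modeDeriv hβ hα n).comp
      (Continuous.prodMk_right t)).measurable).mul hψm).mul
      (KineticTheory.measurable_maxwellianBeta β)).aestronglyMeasurable
  have hψ0 : Integrable fun v => |ψ v| * maxwellianBeta β v := by
    refine hψi.mono' ((hψm.abs.mul (KineticTheory.measurable_maxwellianBeta β)).aestronglyMeasurable)
      (Eventually.of_forall fun v => ?_)
    have hM := (maxwellianBeta_pos hβ v).le
    have ha := TaggedLinearBoltzmannSeries.collisionFrequency_nonneg hβ v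
    rw [Real.norm_of_nonneg (mul_nonneg (abs_nonneg _) hM)]
    have : (1 : ℝ) ≤ 1 + ‖v‖ + collisionFrequency β v := by linarith [norm_nonneg v]
    nlinarith [mul_nonneg (abs_nonneg (ψ v)) hM]
  have hF_int : Integrable (F t) volume := by
    refine (hψ0.const_mul 2).mono' (hF_meas t) (Eventually.of_forall fun v => ?_)
    have hM := (maxwellianBeta_pos hβ v).le
    simp only [hF]
    rw [Real.norm_eq_abs, abs_mul, abs_mul, abs_of_nonneg hM]
    have h1 : |p (modeProfile n β α t v)| ≤ 2 := (hp _).trans (norm_modeProfile_le hβ hα n t v)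
    nlinarith [mul_nonneg (abs_nonneg (ψ v)) hM, abs_nonneg (p (modeProfile n β α t v))]
  have h_bound : ∀ᵐ v : 𝔼, ∀ x ∈ Ioi (t / 2), ‖F' x v‖ ≤
      C * ((1 + ‖v‖ + collisionFrequency β v) * |ψ v| * maxwellianBeta β v) :=
    Eventually.of_forall fun v x _ => by
      have hM := (maxwellianBeta_pos hβ v).le
      simp only [hF']
      rw [Real.norm_eq_abs, abs_mul, abs_mul, abs_of_nonneg hM]
      have h1 : |p (modeDeriv n β α x v)| ≤ C * (1 + ‖v‖ + collisionFrequency β v) :=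
        (hp _).trans (norm_modeDeriv_le_weight hβ hα n x v)
      calc |p (modeDeriv n β α x v)| * |ψ v| * maxwellianBeta β v
          ≤ C * (1 + ‖v‖ + collisionFrequency β v) * |ψ v| * maxwellianBeta β v := by
            gcongr
        _ = C * ((1 + ‖v‖ + collisionFrequency β v) * |ψ v| * maxwellianBeta β v) := by ring
  have h_diff : ∀ᵐ v : 𝔼, ∀ x ∈ Ioi (t / 2), HasDerivAt (F · v) (F' x v) x :=
    Eventually.of_forall fun v x hx => by
      have hx0 : 0 < x := by have : t / 2 < x := hx; linarith
      have h1 : HasDerivAt (fun x => p (modeProfile n β α x v)) (p (modeDeriv n β α x v)) x :=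
        p.hasFDerivAt.comp_hasDerivAt x (hasDerivAt_modeProfile' hβ hα n hx0 v)
      exact (h1.mul_const (ψ v)).mul_const _
  exact (hasDerivAt_integral_of_dominated_loc_of_deriv_le hs (Eventually.of_forall hF_meas) hF_int hF'_meas
    h_bound (hψi.const_mul C) h_diff).2

include hβ hα in
/-- **Continuity of the moments in time** (dominated convergence, `|p(ĝ)| ≤ 2`). [folklore] -/
theorem continuous_profileMoment (p : ℂ →L[ℝ] ℝ) (hp : ∀ z, |p z| ≤ ‖z‖) {ψ : 𝔼 → ℝ}
    (hψm : Measurable ψ) (hψi : Integrable fun v => |ψ v| * maxwellianBeta β v) :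
    Continuous (profileMoment n β α p ψ) := by
  refine continuous_of_dominated (bound := fun v => 2 * (|ψ v| * maxwellianBeta β v)) (fun x =>
    (((p.continuous.measurable.comp (measurable_modeProfile_right hβ hα n x)).mul hψm).mul
      (KineticTheory.measurable_maxwellianBeta β)).aestronglyMeasurable) (fun x => Eventually.of_forall fun v => ?_)
    (hψi.const_mul 2) (Eventually.of_forall fun v => ?_)
  · have hM := (maxwellianBeta_pos hβ v).le
    rw [Real.norm_eq_abs, abs_mul, abs_mul, abs_of_nonneg hM]
    have h1 : |p (modeProfile n β α x v)| ≤ 2 := (hp _).trans (norm_modeProfile_le hβ hα n x v)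
    nlinarith [mul_nonneg (abs_nonneg (ψ v)) hM, abs_nonneg (p (modeProfile n β α x v))]
  · exact ((p.continuous.comp (continuous_modeProfile_left hβ hα n v)).mul continuous_const).mul
      continuous_const

/-- `|Re z| ≤ |z|` for the real-part functional. [folklore] -/
theorem abs_reCLM_le (z : ℂ) : |Complex.reCLM z| ≤ ‖z‖ := by
  rw [Complex.reCLM_apply]; exact Complex.abs_re_le_norm z

/-- `|Im z| ≤ |z|` for the imaginary-part functional. [folklore] -/
theorem abs_imCLM_le (z : ℂ) : |Complex.imCLM z| ≤ ‖z‖ := by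
  rw [Complex.imCLM_apply]; exact Complex.abs_im_le_norm z

end Moments

/-! ## The profile's real and imaginary parts as bounded velocity functions -/

section ProfileParts

open TaggedSphereDiffusion (collisionFrequency)

variable {β : ℝ} (hβ : 0 < β) {α : ℝ} (hα : 0 ≤ α) (n : d → ℤ) (t : ℝ)

include hβ hα in
/-- `v ↦ Re ĝ_n(t, v)` is measurable. [folklore] -/
theorem measurable_re_modeProfile : Measurable fun v : 𝔼 => (modeProfile n β α t v).re :=
  Complex.measurable_re.comp (measurable_modeProfile_right hβ hα n t)

include hβ hα in
/-- `v ↦ Im ĝ_n(t, v)` is measurable. [folklore] -/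
theorem measurable_im_modeProfile : Measurable fun v : 𝔼 => (modeProfile n β α t v).im :=
  Complex.measurable_im.comp (measurable_modeProfile_right hβ hα n t)

include hβ hα in
/-- `v ↦ K⁺(Re ĝ_n(t, ·))(v)` is continuous. [folklore] -/
theorem continuous_gain_re_modeProfile :
    Continuous fun v : 𝔼 => linearBoltzmannGain β (fun w => (modeProfile n β α t w).re) v := by
  have h := (continuous_cgain_modeProfile hβ hα n).comp (Continuous.prodMk_right t)
  have : (fun v : 𝔼 => linearBoltzmannGain β (fun w => (modeProfile n β α t w).re) v) =
      fun v => (cgain β (fun w => modeProfile n β α t w) v).re := by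
    funext v; rw [cgain_re]
  rw [this]
  exact Complex.continuous_re.comp h

include hβ hα in
/-- `v ↦ K⁺(Im ĝ_n(t, ·))(v)` is continuous. [folklore] -/
theorem continuous_gain_im_modeProfile :
    Continuous fun v : 𝔼 => linearBoltzmannGain β (fun w => (modeProfile n β α t w).im) v := by
  have h := (continuous_cgain_modeProfile hβ hα n).comp (Continuous.prodMk_right t)
  have : (fun v : 𝔼 => linearBoltzmannGain β (fun w => (modeProfile n β α t w).im) v) =
      fun v => (cgain β (fun w => modeProfile n β α t w) v).im := by
    funext v; rw [cgain_im]
  rw [this]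
  exact Complex.continuous_im.comp h

include hβ in
/-- **Integrability against `M_β` of products with one bounded and one controlled factor**:
`f h M_β` is integrable if `f M_β`-type weight `W ≥ 0` with `|f| ≤ W`, `W M_β` integrable, and
`|h| ≤ C` measurable. [folklore] -/
theorem integrable_bdd_mul_mul_maxwellianBeta {f h W : 𝔼 → ℝ} (hfm : Measurable f) (hhm : Measurable h)
    (hW : Integrable fun v => W v * maxwellianBeta β v) (hfW : ∀ v, |f v| ≤ W v) {C : ℝ}
    (hC : ∀ v, |h v| ≤ C) : Integrable fun v => f v * h v * maxwellianBeta β v := by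
  have hC0 : 0 ≤ C := (abs_nonneg _).trans (hC 0)
  refine (hW.const_mul C).mono' ((hfm.mul hhm).mul (KineticTheory.measurable_maxwellianBeta β)).aestronglyMeasurable
    (Eventually.of_forall fun v => ?_)
  have hM := (maxwellianBeta_pos hβ v).le
  rw [Real.norm_eq_abs, abs_mul, abs_mul, abs_of_nonneg hM]
  have hW0 : 0 ≤ W v := (abs_nonneg _).trans (hfW v)
  calc |f v| * |h v| * maxwellianBeta β v ≤ W v * C * maxwellianBeta β v :=
        mul_le_mul_of_nonneg_right (mul_le_mul (hfW v) (hC v) (abs_nonneg _) hW0) hM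
    _ = C * (W v * maxwellianBeta β v) := by ring

include hβ in
/-- `|ω_n(v)| M_β`-weights are integrable: `ω_n h M_β` is integrable for bounded `h`. [folklore] -/
theorem integrable_modePhase_mul [DecidableEq d] {h : 𝔼 → ℝ} (hhm : Measurable h) {C : ℝ}
    (hC : ∀ v, |h v| ≤ C) : Integrable fun v => modePhase n v * h v * maxwellianBeta β v := by
  have h1 := KineticTheory.integrable_pow_norm_mul_maxwellianBeta (d := d) hβ 1
  simp only [pow_one] at h1
  exact integrable_bdd_mul_mul_maxwellianBeta hβ (continuous_modePhase n).measurable hhm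
    (W := fun v => 2 * Real.pi * ‖Literature.Analysis.FunctionSpaces.Torus.latticeVec n‖ * ‖v‖)
    ((h1.const_mul (2 * Real.pi * ‖Literature.Analysis.FunctionSpaces.Torus.latticeVec n‖)).congr
      (Eventually.of_forall fun v => by simp only; ring))
    (fun v => abs_modePhase_le n v) hC

include hβ in
/-- `a_β h M_β` is integrable for bounded measurable `h`. [folklore] -/
theorem integrable_collisionFrequency_mul_bdd {h : 𝔼 → ℝ} (hhm : Measurable h) {C : ℝ}
    (hC : ∀ v, |h v| ≤ C) : Integrable fun v => collisionFrequency β v * h v * maxwellianBeta β v :=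
  integrable_bdd_mul_mul_maxwellianBeta hβ (continuous_collisionFrequency hβ).measurable hhm
    (integrable_collisionFrequency_mul_maxwellianBeta hβ)
    (fun v => le_of_eq (abs_of_nonneg (TaggedLinearBoltzmannSeries.collisionFrequency_nonneg hβ v))) hC

include hβ in
/-- `(K⁺ f) h M_β` is integrable for `f, h` bounded measurable with `K⁺ f` measurable
(`|K⁺ f| ≤ a_β sup|f|`). [folklore] -/
theorem integrable_gain_mul_bdd {f h : 𝔼 → ℝ} (hKm : Measurable fun v => linearBoltzmannGain β f v)
    {Cf : ℝ} (hCf : ∀ v, |f v| ≤ Cf) (hhm : Measurable h) {C : ℝ} (hC : ∀ v, |h v| ≤ C) :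
    Integrable fun v => linearBoltzmannGain β f v * h v * maxwellianBeta β v :=
  integrable_bdd_mul_mul_maxwellianBeta hβ hKm hhm (W := fun v => collisionFrequency β v * Cf)
    (((integrable_collisionFrequency_mul_maxwellianBeta hβ).const_mul Cf).congr
      (Eventually.of_forall fun v => by simp only; ring))
    (fun v => abs_linearBoltzmannGain_le hβ hCf v) hC

include hβ in
/-- `(K⁺ f) M_β` is integrable for `f` bounded measurable with `K⁺ f` measurable. [folklore] -/
theorem integrable_gain_mul_maxwellianBeta' {f : 𝔼 → ℝ} (hKm : Measurable fun v => linearBoltzmannGain β f v)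
    {Cf : ℝ} (hCf : ∀ v, |f v| ≤ Cf) :
    Integrable fun v => linearBoltzmannGain β f v * maxwellianBeta β v := by
  have h := integrable_gain_mul_bdd hβ hKm hCf (h := fun _ => (1 : ℝ)) measurable_const (C := 1)
    (fun _ => by rw [abs_one])
  simpa only [mul_one] using h

end ProfileParts

/-! ## The mean, the corrector moments and the energy: values of the time derivatives -/

section Values

open TaggedSphereDiffusion (collisionFrequency)

variable (hd : 2 ≤ Fintype.card d) {β : ℝ} (hβ : 0 < β) {α : ℝ} (hα : 0 ≤ α) (n : d → ℤ)

include hd hβ hα in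
/-- **The mean moves only through the phase**: `∫ Re Γ_n M_β = ∫ ω_n Im ĝ_n M_β`
(mass conservation `∫ K⁺h M_β = ∫ a_β h M_β` kills the collision part). [folklore] -/
theorem integral_re_modeDeriv_mul [DecidableEq d] (t : ℝ) :
    ∫ v, (modeDeriv n β α t v).re * maxwellianBeta β v =
      ∫ v, modePhase n v * (modeProfile n β α t v).im * maxwellianBeta β v := by
  have hm1 := measurable_re_modeProfile hβ hα n t
  have hm2 := measurable_im_modeProfile hβ hα n t
  have hb1 := abs_re_modeProfile_le hβ hα n t
  have hb2 := abs_im_modeProfile_le hβ hα n t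
  have i1 := integrable_modePhase_mul hβ n hm2 hb2
  have i2 := integrable_gain_mul_maxwellianBeta' hβ (continuous_gain_re_modeProfile hβ hα n t).measurable hb1
  have i3 := integrable_collisionFrequency_mul_bdd hβ hm1 hb1
  have e : ∀ v, (modeDeriv n β α t v).re * maxwellianBeta β v =
      modePhase n v * (modeProfile n β α t v).im * maxwellianBeta β v +
        (α * (linearBoltzmannGain β (fun w => (modeProfile n β α t w).re) v * maxwellianBeta β v) -
          α * (collisionFrequency β v * (modeProfile n β α t v).re * maxwellianBeta β v)) := by
    intro v; rw [modeDeriv_re]; ring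
  have h2 := i2.const_mul α
  have h3 := i3.const_mul α
  have h23 : Integrable (fun v => α * (linearBoltzmannGain β (fun w => (modeProfile n β α t w).re) v *
      maxwellianBeta β v) - α * (collisionFrequency β v * (modeProfile n β α t v).re * maxwellianBeta β v)) :=
    h2.sub h3
  simp_rw [e]
  rw [integral_add i1 h23, integral_sub h2 h3, integral_const_mul, integral_const_mul,
    integral_gain_mul_maxwellianBeta hd hβ hm1 hb1]
  ring

include hd hβ hα in
/-- `∫ Im Γ_n M_β = -∫ ω_n Re ĝ_n M_β`. [folklore] -/
theorem integral_im_modeDeriv_mul [DecidableEq d] (t : ℝ) :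
    ∫ v, (modeDeriv n β α t v).im * maxwellianBeta β v =
      -∫ v, modePhase n v * (modeProfile n β α t v).re * maxwellianBeta β v := by
  have hm1 := measurable_re_modeProfile hβ hα n t
  have hm2 := measurable_im_modeProfile hβ hα n t
  have hb1 := abs_re_modeProfile_le hβ hα n t
  have hb2 := abs_im_modeProfile_le hβ hα n t
  have i1 := integrable_modePhase_mul hβ n hm1 hb1
  have i2 := integrable_gain_mul_maxwellianBeta' hβ (continuous_gain_im_modeProfile hβ hα n t).measurable hb2
  have i3 := integrable_collisionFrequency_mul_bdd hβ hm2 hb2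
  have e : ∀ v, (modeDeriv n β α t v).im * maxwellianBeta β v =
      -(modePhase n v * (modeProfile n β α t v).re * maxwellianBeta β v) +
        (α * (linearBoltzmannGain β (fun w => (modeProfile n β α t w).im) v * maxwellianBeta β v) -
          α * (collisionFrequency β v * (modeProfile n β α t v).im * maxwellianBeta β v)) := by
    intro v; rw [modeDeriv_im]; ring
  have h2 := i2.const_mul α
  have h3 := i3.const_mul α
  have h23 : Integrable (fun v => α * (linearBoltzmannGain β (fun w => (modeProfile n β α t w).im) v *
      maxwellianBeta β v) - α * (collisionFrequency β v * (modeProfile n β α t v).im * maxwellianBeta β v)) :=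
    h2.sub h3
  have h1 : Integrable (fun v => -(modePhase n v * (modeProfile n β α t v).re * maxwellianBeta β v)) := i1.neg
  simp_rw [e]
  rw [integral_add h1 h23, integral_sub h2 h3, integral_const_mul, integral_const_mul, integral_neg,
    integral_gain_mul_maxwellianBeta hd hβ hm2 hb2]
  ring

/-- **The energy identity, pointwise form**: `Re ĝ Re Γ + Im ĝ Im Γ = α (g₁ K⁺g₁ + g₂ K⁺g₂) - α a_β |ĝ|²`
(the phase rotation `-iω ĝ` does no work). [folklore] -/
theorem re_mul_re_modeDeriv_add [DecidableEq d] (t : ℝ) (v : 𝔼) :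
    (modeProfile n β α t v).re * (modeDeriv n β α t v).re + (modeProfile n β α t v).im * (modeDeriv n β α t v).im =
      α * ((modeProfile n β α t v).re * linearBoltzmannGain β (fun w => (modeProfile n β α t w).re) v +
        (modeProfile n β α t v).im * linearBoltzmannGain β (fun w => (modeProfile n β α t w).im) v) -
      α * collisionFrequency β v * ((modeProfile n β α t v).re ^ 2 + (modeProfile n β α t v).im ^ 2) := by
  rw [modeDeriv_re, modeDeriv_im]
  ring

include hd hβ hα in
/-- **The energy dissipation identity, integrated form**:
`∫ 2 (Re ĝ Re Γ + Im ĝ Im Γ) M_β = -2α (B(g₁, g₁) + B(g₂, g₂))`, `B` the Dirichlet form of `L`.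
[cite: BodineauGallagherSaintRaymondInvent2016, §6.1.2] -/
theorem integral_energyDeriv_eq [DecidableEq d] (t : ℝ) :
    ∫ v, 2 * ((modeProfile n β α t v).re * (modeDeriv n β α t v).re +
        (modeProfile n β α t v).im * (modeDeriv n β α t v).im) * maxwellianBeta β v =
      -(2 * α) * (dirichletForm β (fun v => (modeProfile n β α t v).re) (fun v => (modeProfile n β α t v).re) +
        dirichletForm β (fun v => (modeProfile n β α t v).im) (fun v => (modeProfile n β α t v).im)) := by
  have hm1 := measurable_re_modeProfile hβ hα n t
  have hm2 := measurable_im_modeProfile hβ hα n t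
  have hb1 := abs_re_modeProfile_le hβ hα n t
  have hb2 := abs_im_modeProfile_le hβ hα n t
  -- integrability of the four pieces
  have i1 := integrable_gain_mul_bdd hβ (continuous_gain_re_modeProfile hβ hα n t).measurable hb1 hm1 hb1
  have i2 := integrable_gain_mul_bdd hβ (continuous_gain_im_modeProfile hβ hα n t).measurable hb2 hm2 hb2
  have hsq1 : ∀ v, |(modeProfile n β α t v).re ^ 2| ≤ 1 := fun v => by
    rw [abs_pow, pow_two]; nlinarith [hb1 v, abs_nonneg (modeProfile n β α t v).re]
  have hsq2 : ∀ v, |(modeProfile n β α t v).im ^ 2| ≤ 1 := fun v => by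
    rw [abs_pow, pow_two]; nlinarith [hb2 v, abs_nonneg (modeProfile n β α t v).im]
  have i3 := integrable_collisionFrequency_mul_bdd hβ (hm1.pow_const 2) hsq1
  have i4 := integrable_collisionFrequency_mul_bdd hβ (hm2.pow_const 2) hsq2
  have e : ∀ v, 2 * ((modeProfile n β α t v).re * (modeDeriv n β α t v).re +
      (modeProfile n β α t v).im * (modeDeriv n β α t v).im) * maxwellianBeta β v =
      (2 * α) * ((linearBoltzmannGain β (fun w => (modeProfile n β α t w).re) v * (modeProfile n β α t v).re *
          maxwellianBeta β v +
        linearBoltzmannGain β (fun w => (modeProfile n β α t w).im) v * (modeProfile n β α t v).im *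
          maxwellianBeta β v) -
        (collisionFrequency β v * (modeProfile n β α t v).re ^ 2 * maxwellianBeta β v +
          collisionFrequency β v * (modeProfile n β α t v).im ^ 2 * maxwellianBeta β v)) := by
    intro v
    rw [re_mul_re_modeDeriv_add n t v]
    ring
  have i12 : Integrable (fun v => linearBoltzmannGain β (fun w => (modeProfile n β α t w).re) v *
      (modeProfile n β α t v).re * maxwellianBeta β v +
        linearBoltzmannGain β (fun w => (modeProfile n β α t w).im) v * (modeProfile n β α t v).im *
          maxwellianBeta β v) := i1.add i2
  have i34 : Integrable (fun v => collisionFrequency β v * (modeProfile n β α t v).re ^ 2 * maxwellianBeta β v +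
      collisionFrequency β v * (modeProfile n β α t v).im ^ 2 * maxwellianBeta β v) := i3.add i4
  simp_rw [e]
  rw [integral_const_mul, integral_sub i12 i34, integral_add i1 i2, integral_add i3 i4,
    dirichletForm_self_eq_of_abs_le hd hβ hm1 hb1, dirichletForm_self_eq_of_abs_le hd hβ hm2 hb2]
  have e3 : ∫ v, (modeProfile n β α t v).re ^ 2 * (collisionFrequency β v * maxwellianBeta β v) =
      ∫ v, collisionFrequency β v * (modeProfile n β α t v).re ^ 2 * maxwellianBeta β v :=
    integral_congr_ae (Eventually.of_forall fun v => by ring)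
  have e4 : ∫ v, (modeProfile n β α t v).im ^ 2 * (collisionFrequency β v * maxwellianBeta β v) =
      ∫ v, collisionFrequency β v * (modeProfile n β α t v).im ^ 2 * maxwellianBeta β v :=
    integral_congr_ae (Eventually.of_forall fun v => by ring)
  rw [e3, e4]
  ring

include hβ hα in
/-- **Differentiation of the energy under the integral sign** (`t > 0`). [folklore] -/
theorem hasDerivAt_profileEnergy [DecidableEq d] {t : ℝ} (ht : 0 < t) :
    HasDerivAt (profileEnergy n β α)
      (∫ v, 2 * ((modeProfile n β α t v).re * (modeDeriv n β α t v).re +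
        (modeProfile n β α t v).im * (modeDeriv n β α t v).im) * maxwellianBeta β v) t := by
  set C := max (4 * Real.pi * ‖Literature.Analysis.FunctionSpaces.Torus.latticeVec n‖) (6 * α) with hC
  have hC0 : 0 ≤ C := le_trans (by positivity) (le_max_right _ _)
  set F : ℝ → 𝔼 → ℝ := fun x v => ((modeProfile n β α x v).re * (modeProfile n β α x v).re +
    (modeProfile n β α x v).im * (modeProfile n β α x v).im) * maxwellianBeta β v with hF
  set F' : ℝ → 𝔼 → ℝ := fun x v => 2 * ((modeProfile n β α x v).re * (modeDeriv n β α x v).re +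
    (modeProfile n β α x v).im * (modeDeriv n β α x v).im) * maxwellianBeta β v with hF'
  have eF : profileEnergy n β α = fun x => ∫ v, F x v := by
    funext x
    simp only [profileEnergy, hF, pow_two]
  rw [eF]
  have hs : Ioi (t / 2) ∈ 𝓝 t := Ioi_mem_nhds (by linarith)
  have hgm : ∀ x, Measurable fun v => modeProfile n β α x v := fun x => measurable_modeProfile_right hβ hα n x
  have hΓm : ∀ x, Measurable fun v => modeDeriv n β α x v := fun x =>
    ((continuous_modeDeriv hβ hα n).comp (Continuous.prodMk_right x)).measurable
  have hF_meas : ∀ x, AEStronglyMeasurable (F x) volume := fun x =>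
    ((((Complex.measurable_re.comp (hgm x)).mul (Complex.measurable_re.comp (hgm x))).add
      ((Complex.measurable_im.comp (hgm x)).mul (Complex.measurable_im.comp (hgm x)))).mul
      (KineticTheory.measurable_maxwellianBeta β)).aestronglyMeasurable
  have hF'_meas : AEStronglyMeasurable (F' t) volume :=
    ((measurable_const.mul (((Complex.measurable_re.comp (hgm t)).mul (Complex.measurable_re.comp (hΓm t))).add
      ((Complex.measurable_im.comp (hgm t)).mul (Complex.measurable_im.comp (hΓm t))))).mul
      (KineticTheory.measurable_maxwellianBeta β)).aestronglyMeasurable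
  have hM := KineticTheory.integrable_maxwellianBeta (d := d) hβ
  have hW := integrable_one_add_norm_add_collisionFrequency_mul (d := d) hβ
  have hF_int : Integrable (F t) volume := by
    refine (hM.const_mul 2).mono' (hF_meas t) (Eventually.of_forall fun v => ?_)
    have hMv := (maxwellianBeta_pos hβ v).le
    have h1 := abs_re_modeProfile_le hβ hα n t v
    have h2 := abs_im_modeProfile_le hβ hα n t v
    simp only [hF]
    rw [Real.norm_eq_abs, abs_mul, abs_of_nonneg hMv]
    have : |(modeProfile n β α t v).re * (modeProfile n β α t v).re +
        (modeProfile n β α t v).im * (modeProfile n β α t v).im| ≤ 2 := by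
      rw [abs_le] at h1 h2 ⊢
      constructor <;> nlinarith
    nlinarith
  have h_bound : ∀ᵐ v : 𝔼, ∀ x ∈ Ioi (t / 2), ‖F' x v‖ ≤ 4 * C * ((1 + ‖v‖ + collisionFrequency β v) * maxwellianBeta β v) :=
    Eventually.of_forall fun v x _ => by
      have hMv := (maxwellianBeta_pos hβ v).le
      have h1 := abs_re_modeProfile_le hβ hα n x v
      have h2 := abs_im_modeProfile_le hβ hα n x v
      have hΓ := norm_modeDeriv_le_weight hβ hα n x v
      have h3 : |(modeDeriv n β α x v).re| ≤ C * (1 + ‖v‖ + collisionFrequency β v) :=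
        (Complex.abs_re_le_norm _).trans hΓ
      have h4 : |(modeDeriv n β α x v).im| ≤ C * (1 + ‖v‖ + collisionFrequency β v) :=
        (Complex.abs_im_le_norm _).trans hΓ
      simp only [hF']
      rw [Real.norm_eq_abs, abs_mul, abs_mul, abs_of_nonneg hMv, abs_two]
      have h5 : |(modeProfile n β α x v).re * (modeDeriv n β α x v).re +
          (modeProfile n β α x v).im * (modeDeriv n β α x v).im| ≤ 2 * (C * (1 + ‖v‖ + collisionFrequency β v)) := by
        refine (abs_add_le _ _).trans ?_
        rw [abs_mul, abs_mul]
        have hCw : 0 ≤ C * (1 + ‖v‖ + collisionFrequency β v) := mul_nonneg hC0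
          (by linarith [norm_nonneg v, TaggedLinearBoltzmannSeries.collisionFrequency_nonneg hβ v])
        nlinarith [abs_nonneg (modeProfile n β α x v).re, abs_nonneg (modeProfile n β α x v).im,
          abs_nonneg (modeDeriv n β α x v).re, abs_nonneg (modeDeriv n β α x v).im]
      calc 2 * |(modeProfile n β α x v).re * (modeDeriv n β α x v).re +
            (modeProfile n β α x v).im * (modeDeriv n β α x v).im| * maxwellianBeta β v
          ≤ 2 * (2 * (C * (1 + ‖v‖ + collisionFrequency β v))) * maxwellianBeta β v := by
            exact mul_le_mul_of_nonneg_right (mul_le_mul_of_nonneg_left h5 zero_le_two) hMv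
        _ = 4 * C * ((1 + ‖v‖ + collisionFrequency β v) * maxwellianBeta β v) := by ring
  have h_diff : ∀ᵐ v : 𝔼, ∀ x ∈ Ioi (t / 2), HasDerivAt (F · v) (F' x v) x :=
    Eventually.of_forall fun v x hx => by
      have hx0 : 0 < x := by have : t / 2 < x := hx; linarith
      have hg := hasDerivAt_modeProfile' hβ hα n hx0 v
      have hre : HasDerivAt (fun x => (modeProfile n β α x v).re) ((modeDeriv n β α x v).re) x :=
        Complex.reCLM.hasFDerivAt.comp_hasDerivAt x hg
      have him : HasDerivAt (fun x => (modeProfile n β α x v).im) ((modeDeriv n β α x v).im) x :=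
        Complex.imCLM.hasFDerivAt.comp_hasDerivAt x hg
      have h := ((hre.mul hre).add (him.mul him)).mul_const (maxwellianBeta β v)
      refine h.congr_deriv ?_
      simp only [hF']
      ring
  exact (hasDerivAt_integral_of_dominated_loc_of_deriv_le hs (Eventually.of_forall hF_meas) hF_int hF'_meas
    h_bound (hW.const_mul (4 * C)) h_diff).2

include hβ hα in
/-- **Continuity of the energy in time.** [folklore] -/
theorem continuous_profileEnergy : Continuous (profileEnergy n β α) := by
  have hM := KineticTheory.integrable_maxwellianBeta (d := d) hβ
  refine continuous_of_dominated (bound := fun v => 2 * maxwellianBeta β v) (fun x => ?_)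
    (fun x => Eventually.of_forall fun v => ?_) (hM.const_mul 2) (Eventually.of_forall fun v => ?_)
  · have hgm := measurable_modeProfile_right hβ hα n x
    exact ((((Complex.measurable_re.comp hgm).pow_const 2).add ((Complex.measurable_im.comp hgm).pow_const 2)).mul
      (KineticTheory.measurable_maxwellianBeta β)).aestronglyMeasurable
  · have hMv := (maxwellianBeta_pos hβ v).le
    have h1 := abs_re_modeProfile_le hβ hα n x v
    have h2 := abs_im_modeProfile_le hβ hα n x v
    rw [Real.norm_eq_abs, abs_mul, abs_of_nonneg hMv]
    have : |(modeProfile n β α x v).re ^ 2 + (modeProfile n β α x v).im ^ 2| ≤ 2 := by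
      rw [abs_le] at h1 h2 ⊢
      constructor <;> nlinarith
    nlinarith
  · have hc := continuous_modeProfile_left hβ hα n v
    exact (((Complex.continuous_re.comp hc).pow 2).add ((Complex.continuous_im.comp hc).pow 2)).mul
      continuous_const

include hβ in
/-- The energy starts at `1`: `∫ |ĝ_n(0)|² M_β = ∫ M_β = 1`. [folklore] -/
theorem profileEnergy_zero : profileEnergy n β α 0 = 1 := by
  simp only [profileEnergy, modeProfile_zero, Complex.one_re, Complex.one_im]
  norm_num
  exact KineticTheory.integral_maxwellianBeta hβ

end Values

/-! ## The mean and the corrector moments: derivatives -/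

section MeanDerivs

open TaggedSphereDiffusion (collisionFrequency)

variable (hd : 2 ≤ Fintype.card d) {β : ℝ} (hβ : 0 < β) {α : ℝ} (hα : 0 ≤ α) (n : d → ℤ)

include hβ in
/-- The weight hypothesis of `hasDerivAt_profileMoment` for `ψ = 1`. [folklore] -/
theorem integrable_weight_one :
    Integrable fun v : 𝔼 => (1 + ‖v‖ + collisionFrequency β v) * |(1 : ℝ)| * maxwellianBeta β v :=
  (integrable_one_add_norm_add_collisionFrequency_mul hβ).congr
    (Eventually.of_forall fun v => by simp only [abs_one, mul_one])

include hd hβ hα in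
/-- **`d/dt ∫ Re ĝ_n M_β = ∫ ω_n Im ĝ_n M_β`** (`t > 0`). [folklore] -/
theorem hasDerivAt_meanRe [DecidableEq d] {t : ℝ} (ht : 0 < t) :
    HasDerivAt (profileMoment n β α Complex.reCLM fun _ => 1)
      (∫ v, modePhase n v * (modeProfile n β α t v).im * maxwellianBeta β v) t := by
  have h := hasDerivAt_profileMoment hβ hα n Complex.reCLM abs_reCLM_le measurable_const
    (integrable_weight_one hβ) ht
  refine h.congr_deriv ?_
  simp only [Complex.reCLM_apply, mul_one]
  exact integral_re_modeDeriv_mul hd hβ hα n t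

include hd hβ hα in
/-- **`d/dt ∫ Im ĝ_n M_β = -∫ ω_n Re ĝ_n M_β`** (`t > 0`). [folklore] -/
theorem hasDerivAt_meanIm [DecidableEq d] {t : ℝ} (ht : 0 < t) :
    HasDerivAt (profileMoment n β α Complex.imCLM fun _ => 1)
      (-∫ v, modePhase n v * (modeProfile n β α t v).re * maxwellianBeta β v) t := by
  have h := hasDerivAt_profileMoment hβ hα n Complex.imCLM abs_imCLM_le measurable_const
    (integrable_weight_one hβ) ht
  refine h.congr_deriv ?_
  simp only [Complex.imCLM_apply, mul_one]
  exact integral_im_modeDeriv_mul hd hβ hα n t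

/-- The mean of the real part, unfolded. [folklore] -/
theorem profileMoment_reCLM_one (t : ℝ) :
    profileMoment n β α Complex.reCLM (fun _ => 1) t = ∫ v, (modeProfile n β α t v).re * maxwellianBeta β v := by
  simp [profileMoment]

/-- The mean of the imaginary part, unfolded. [folklore] -/
theorem profileMoment_imCLM_one (t : ℝ) :
    profileMoment n β α Complex.imCLM (fun _ => 1) t = ∫ v, (modeProfile n β α t v).im * maxwellianBeta β v := by
  simp [profileMoment]

include hβ in
/-- The means start at `(1, 0)`: real part. [folklore] -/
theorem profileMoment_reCLM_one_zero : profileMoment n β α Complex.reCLM (fun _ => 1) 0 = 1 := by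
  rw [profileMoment_reCLM_one]
  simp only [modeProfile_zero, Complex.one_re, one_mul]
  exact KineticTheory.integral_maxwellianBeta hβ

/-- The means start at `(1, 0)`: imaginary part. [folklore] -/
theorem profileMoment_imCLM_one_zero : profileMoment n β α Complex.imCLM (fun _ => 1) 0 = 0 := by
  rw [profileMoment_imCLM_one]
  simp only [modeProfile_zero, Complex.one_im, zero_mul, integral_zero]

end MeanDerivs

section CorrectorDerivs

open TaggedSphereDiffusion (collisionFrequency)

variable (hd : 2 ≤ Fintype.card d) {β : ℝ} (hβ : 0 < β) {α : ℝ} (hα : 0 ≤ α) (n : d → ℤ)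
  {b : EuclideanSpace ℝ d → EuclideanSpace ℝ d} (hb : IsDiffusionCorrector β b) (k : EuclideanSpace ℝ d)

include hβ hb in
/-- `a_β |χ_k| M_β` is integrable. [folklore] -/
theorem IsDiffusionCorrector.integrable_collisionFrequency_mul_abs_inner :
    Integrable fun v => collisionFrequency β v * |⟪k, b v⟫_ℝ| * maxwellianBeta β v := by
  refine (integrable_collisionFrequency_mul_mul_maxwellianBeta hβ (hb.finiteEnergy_inner hβ k)).abs.congr
    (Eventually.of_forall fun v => ?_)
  have ha := TaggedLinearBoltzmannSeries.collisionFrequency_nonneg hβ v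
  have hM := (maxwellianBeta_pos hβ v).le
  show |collisionFrequency β v * ⟪k, b v⟫_ℝ * maxwellianBeta β v| = _
  rw [abs_mul, abs_mul, abs_of_nonneg ha, abs_of_nonneg hM]

include hd hβ hb in
/-- `|χ_k| M_β` is integrable. [folklore] -/
theorem IsDiffusionCorrector.integrable_abs_inner :
    Integrable fun v => |⟪k, b v⟫_ℝ| * maxwellianBeta β v := by
  refine (integrable_mul_maxwellianBeta_of_finiteEnergy hd hβ (hb.finiteEnergy_inner hβ k)).abs.congr
    (Eventually.of_forall fun v => ?_)
  have hM := (maxwellianBeta_pos hβ v).le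
  show |⟪k, b v⟫_ℝ * maxwellianBeta β v| = _
  rw [abs_mul, abs_of_nonneg hM]

include hd hβ hb in
/-- **The weight hypothesis for `χ_k`**: `(1 + |v| + a_β)|χ_k| M_β` is integrable (`|v| ≤ a_β / c`).
[folklore] -/
theorem IsDiffusionCorrector.integrable_weight_abs_inner :
    Integrable fun v => (1 + ‖v‖ + collisionFrequency β v) * |⟪k, b v⟫_ℝ| * maxwellianBeta β v := by
  obtain ⟨a₀, _ha₀, c, hc, hlow⟩ := exists_collisionFrequency_lowerBound (d := d) hd hβ
  have h1 := hb.integrable_abs_inner hd hβ k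
  have h2 := hb.integrable_collisionFrequency_mul_abs_inner hβ k
  have h3 : Integrable fun v => ‖v‖ * |⟪k, b v⟫_ℝ| * maxwellianBeta β v := by
    refine (h2.const_mul c⁻¹).mono' ((continuous_norm.measurable.mul (measurable_const.inner hb.1).abs).mul
      (KineticTheory.measurable_maxwellianBeta β)).aestronglyMeasurable (Eventually.of_forall fun v => ?_)
    have hM := (maxwellianBeta_pos hβ v).le
    have hv : ‖v‖ ≤ c⁻¹ * collisionFrequency β v := by
      rw [← div_eq_inv_mul, le_div_iff₀' hc]; exact (hlow v).2
    rw [Real.norm_of_nonneg (mul_nonneg (mul_nonneg (norm_nonneg _) (abs_nonneg _)) hM)]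
    calc ‖v‖ * |⟪k, b v⟫_ℝ| * maxwellianBeta β v ≤ c⁻¹ * collisionFrequency β v * |⟪k, b v⟫_ℝ| * maxwellianBeta β v := by
          gcongr
      _ = c⁻¹ * (collisionFrequency β v * |⟪k, b v⟫_ℝ| * maxwellianBeta β v) := by ring
  exact ((h1.add h3).add h2).congr (Eventually.of_forall fun v => by simp only [Pi.add_apply]; ring)

include hd hβ hα hb in
/-- **The real corrector moment**: `∫ Re Γ_n χ_k M_β = ∫ ω_n Im ĝ χ_k M_β - α ∫ (k·v) Re ĝ M_β`
(`⟨K⁺ g₁, χ⟩ - ⟨a_β g₁, χ⟩ = -B(g₁, χ_k) = -∫ (k·v) g₁ M_β`, the corrector identity).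
[cite: BodineauGallagherSaintRaymondInvent2016, (6.5)] -/
theorem integral_re_modeDeriv_mul_inner [DecidableEq d] (t : ℝ) :
    ∫ v, (modeDeriv n β α t v).re * ⟪k, b v⟫_ℝ * maxwellianBeta β v =
      (∫ v, modePhase n v * (modeProfile n β α t v).im * ⟪k, b v⟫_ℝ * maxwellianBeta β v) -
        α * ∫ v, ⟪k, v⟫_ℝ * (modeProfile n β α t v).re * maxwellianBeta β v := by
  have hχ := hb.finiteEnergy_inner hβ k
  have hm1 := measurable_re_modeProfile hβ hα n t
  have hm2 := measurable_im_modeProfile hβ hα n t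
  have hb1 := abs_re_modeProfile_le hβ hα n t
  have hb2 := abs_im_modeProfile_le hβ hα n t
  have hfe1 : FiniteEnergy β (fun v => (modeProfile n β α t v).re) := finiteEnergy_of_bounded hβ hm1 hb1
  have haχ := hb.integrable_collisionFrequency_mul_abs_inner hβ k
  -- integrability of the three pieces
  have i1 : Integrable fun v => modePhase n v * (modeProfile n β α t v).im * ⟪k, b v⟫_ℝ * maxwellianBeta β v := by
    obtain ⟨a₀, _ha₀, c, hc, hlow⟩ := exists_collisionFrequency_lowerBound (d := d) hd hβ
    set L : ℝ := 2 * Real.pi * ‖Literature.Analysis.FunctionSpaces.Torus.latticeVec n‖ with hL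
    have h := integrable_bdd_mul_mul_maxwellianBeta hβ (f := fun v => modePhase n v * ⟪k, b v⟫_ℝ)
      (h := fun v => (modeProfile n β α t v).im) (W := fun v => L * c⁻¹ * (collisionFrequency β v * |⟪k, b v⟫_ℝ|))
      ((continuous_modePhase n).measurable.mul (measurable_const.inner hb.1)) hm2
      ((haχ.const_mul (L * c⁻¹)).congr (Eventually.of_forall fun v => by simp only; ring))
      (fun v => by
        have hω := abs_modePhase_le n v
        have hv : ‖v‖ ≤ c⁻¹ * collisionFrequency β v := by
          rw [← div_eq_inv_mul, le_div_iff₀' hc]; exact (hlow v).2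
        rw [abs_mul]
        calc |modePhase n v| * |⟪k, b v⟫_ℝ| ≤ L * ‖v‖ * |⟪k, b v⟫_ℝ| := by rw [hL]; gcongr
          _ ≤ L * (c⁻¹ * collisionFrequency β v) * |⟪k, b v⟫_ℝ| := by gcongr
          _ = L * c⁻¹ * (collisionFrequency β v * |⟪k, b v⟫_ℝ|) := by ring) hb2
    exact h.congr (Eventually.of_forall fun v => by ring)
  have i2 : Integrable fun v => linearBoltzmannGain β (fun w => (modeProfile n β α t w).re) v * ⟪k, b v⟫_ℝ *
      maxwellianBeta β v := by
    have h := integrable_bdd_mul_mul_maxwellianBeta hβ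
      (f := fun v => linearBoltzmannGain β (fun w => (modeProfile n β α t w).re) v * ⟪k, b v⟫_ℝ)
      (h := fun _ => (1 : ℝ)) (W := fun v => collisionFrequency β v * |⟪k, b v⟫_ℝ|)
      ((continuous_gain_re_modeProfile hβ hα n t).measurable.mul (measurable_const.inner hb.1)) measurable_const
      haχ (fun v => by
        rw [abs_mul]
        have := abs_linearBoltzmannGain_le hβ hb1 v
        rw [mul_one] at this
        exact mul_le_mul_of_nonneg_right this (abs_nonneg _)) (C := 1) (fun _ => by rw [abs_one])
    exact h.congr (Eventually.of_forall fun v => by simp only [mul_one])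
  have i3 : Integrable fun v => collisionFrequency β v * (modeProfile n β α t v).re * ⟪k, b v⟫_ℝ * maxwellianBeta β v := by
    have h := integrable_bdd_mul_mul_maxwellianBeta hβ (f := fun v => collisionFrequency β v * ⟪k, b v⟫_ℝ)
      (h := fun v => (modeProfile n β α t v).re) (W := fun v => collisionFrequency β v * |⟪k, b v⟫_ℝ|)
      ((continuous_collisionFrequency hβ).measurable.mul (measurable_const.inner hb.1)) hm1 haχ
      (fun v => by rw [abs_mul, abs_of_nonneg (TaggedLinearBoltzmannSeries.collisionFrequency_nonneg hβ v)]) hb1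
    exact h.congr (Eventually.of_forall fun v => by ring)
  -- pointwise decomposition
  have e : ∀ v, (modeDeriv n β α t v).re * ⟪k, b v⟫_ℝ * maxwellianBeta β v =
      modePhase n v * (modeProfile n β α t v).im * ⟪k, b v⟫_ℝ * maxwellianBeta β v +
        (α * (linearBoltzmannGain β (fun w => (modeProfile n β α t w).re) v * ⟪k, b v⟫_ℝ * maxwellianBeta β v) -
          α * (collisionFrequency β v * (modeProfile n β α t v).re * ⟪k, b v⟫_ℝ * maxwellianBeta β v)) := by
    intro v; rw [modeDeriv_re]; ring
  have h2 := i2.const_mul α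
  have h3 := i3.const_mul α
  have h23 : Integrable (fun v => α * (linearBoltzmannGain β (fun w => (modeProfile n β α t w).re) v * ⟪k, b v⟫_ℝ *
      maxwellianBeta β v) - α * (collisionFrequency β v * (modeProfile n β α t v).re * ⟪k, b v⟫_ℝ * maxwellianBeta β v)) :=
    h2.sub h3
  simp_rw [e]
  rw [integral_add i1 h23, integral_sub h2 h3, integral_const_mul, integral_const_mul,
    integral_gain_mul_mul_maxwellianBeta hd hβ hm1 hb1 hχ, ← hb.dirichletForm_inner_eq hd hβ k hfe1, dirichletForm]
  have e3 : ∫ v, collisionFrequency β v * (modeProfile n β α t v).re * ⟪k, b v⟫_ℝ * maxwellianBeta β v =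
      ∫ v, (modeProfile n β α t v).re * ⟪k, b v⟫_ℝ * (collisionFrequency β v * maxwellianBeta β v) :=
    integral_congr_ae (Eventually.of_forall fun v => by ring)
  rw [e3]
  ring

include hd hβ hα hb in
/-- **The imaginary corrector moment**: `∫ Im Γ_n χ_k M_β = -∫ ω_n Re ĝ χ_k M_β - α ∫ (k·v) Im ĝ M_β`.
[cite: BodineauGallagherSaintRaymondInvent2016, (6.5)] -/
theorem integral_im_modeDeriv_mul_inner [DecidableEq d] (t : ℝ) :
    ∫ v, (modeDeriv n β α t v).im * ⟪k, b v⟫_ℝ * maxwellianBeta β v =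
      -(∫ v, modePhase n v * (modeProfile n β α t v).re * ⟪k, b v⟫_ℝ * maxwellianBeta β v) -
        α * ∫ v, ⟪k, v⟫_ℝ * (modeProfile n β α t v).im * maxwellianBeta β v := by
  have hχ := hb.finiteEnergy_inner hβ k
  have hm1 := measurable_re_modeProfile hβ hα n t
  have hm2 := measurable_im_modeProfile hβ hα n t
  have hb1 := abs_re_modeProfile_le hβ hα n t
  have hb2 := abs_im_modeProfile_le hβ hα n t
  have hfe2 : FiniteEnergy β (fun v => (modeProfile n β α t v).im) := finiteEnergy_of_bounded hβ hm2 hb2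
  have haχ := hb.integrable_collisionFrequency_mul_abs_inner hβ k
  have i1 : Integrable fun v => modePhase n v * (modeProfile n β α t v).re * ⟪k, b v⟫_ℝ * maxwellianBeta β v := by
    obtain ⟨a₀, _ha₀, c, hc, hlow⟩ := exists_collisionFrequency_lowerBound (d := d) hd hβ
    set L : ℝ := 2 * Real.pi * ‖Literature.Analysis.FunctionSpaces.Torus.latticeVec n‖ with hL
    have h := integrable_bdd_mul_mul_maxwellianBeta hβ (f := fun v => modePhase n v * ⟪k, b v⟫_ℝ)
      (h := fun v => (modeProfile n β α t v).re) (W := fun v => L * c⁻¹ * (collisionFrequency β v * |⟪k, b v⟫_ℝ|))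
      ((continuous_modePhase n).measurable.mul (measurable_const.inner hb.1)) hm1
      ((haχ.const_mul (L * c⁻¹)).congr (Eventually.of_forall fun v => by simp only; ring))
      (fun v => by
        have hω := abs_modePhase_le n v
        have hv : ‖v‖ ≤ c⁻¹ * collisionFrequency β v := by
          rw [← div_eq_inv_mul, le_div_iff₀' hc]; exact (hlow v).2
        rw [abs_mul]
        calc |modePhase n v| * |⟪k, b v⟫_ℝ| ≤ L * ‖v‖ * |⟪k, b v⟫_ℝ| := by rw [hL]; gcongr
          _ ≤ L * (c⁻¹ * collisionFrequency β v) * |⟪k, b v⟫_ℝ| := by gcongr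
          _ = L * c⁻¹ * (collisionFrequency β v * |⟪k, b v⟫_ℝ|) := by ring) hb1
    exact h.congr (Eventually.of_forall fun v => by ring)
  have i2 : Integrable fun v => linearBoltzmannGain β (fun w => (modeProfile n β α t w).im) v * ⟪k, b v⟫_ℝ *
      maxwellianBeta β v := by
    have h := integrable_bdd_mul_mul_maxwellianBeta hβ
      (f := fun v => linearBoltzmannGain β (fun w => (modeProfile n β α t w).im) v * ⟪k, b v⟫_ℝ)
      (h := fun _ => (1 : ℝ)) (W := fun v => collisionFrequency β v * |⟪k, b v⟫_ℝ|)
      ((continuous_gain_im_modeProfile hβ hα n t).measurable.mul (measurable_const.inner hb.1)) measurable_const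
      haχ (fun v => by
        rw [abs_mul]
        have := abs_linearBoltzmannGain_le hβ hb2 v
        rw [mul_one] at this
        exact mul_le_mul_of_nonneg_right this (abs_nonneg _)) (C := 1) (fun _ => by rw [abs_one])
    exact h.congr (Eventually.of_forall fun v => by simp only [mul_one])
  have i3 : Integrable fun v => collisionFrequency β v * (modeProfile n β α t v).im * ⟪k, b v⟫_ℝ * maxwellianBeta β v := by
    have h := integrable_bdd_mul_mul_maxwellianBeta hβ (f := fun v => collisionFrequency β v * ⟪k, b v⟫_ℝ)
      (h := fun v => (modeProfile n β α t v).im) (W := fun v => collisionFrequency β v * |⟪k, b v⟫_ℝ|)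
      ((continuous_collisionFrequency hβ).measurable.mul (measurable_const.inner hb.1)) hm2 haχ
      (fun v => by rw [abs_mul, abs_of_nonneg (TaggedLinearBoltzmannSeries.collisionFrequency_nonneg hβ v)]) hb2
    exact h.congr (Eventually.of_forall fun v => by ring)
  have e : ∀ v, (modeDeriv n β α t v).im * ⟪k, b v⟫_ℝ * maxwellianBeta β v =
      -(modePhase n v * (modeProfile n β α t v).re * ⟪k, b v⟫_ℝ * maxwellianBeta β v) +
        (α * (linearBoltzmannGain β (fun w => (modeProfile n β α t w).im) v * ⟪k, b v⟫_ℝ * maxwellianBeta β v) -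
          α * (collisionFrequency β v * (modeProfile n β α t v).im * ⟪k, b v⟫_ℝ * maxwellianBeta β v)) := by
    intro v; rw [modeDeriv_im]; ring
  have h1 : Integrable (fun v => -(modePhase n v * (modeProfile n β α t v).re * ⟪k, b v⟫_ℝ * maxwellianBeta β v)) :=
    i1.neg
  have h2 := i2.const_mul α
  have h3 := i3.const_mul α
  have h23 : Integrable (fun v => α * (linearBoltzmannGain β (fun w => (modeProfile n β α t w).im) v * ⟪k, b v⟫_ℝ *
      maxwellianBeta β v) - α * (collisionFrequency β v * (modeProfile n β α t v).im * ⟪k, b v⟫_ℝ * maxwellianBeta β v)) :=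
    h2.sub h3
  simp_rw [e]
  rw [integral_add h1 h23, integral_sub h2 h3, integral_const_mul, integral_const_mul, integral_neg,
    integral_gain_mul_mul_maxwellianBeta hd hβ hm2 hb2 hχ, ← hb.dirichletForm_inner_eq hd hβ k hfe2, dirichletForm]
  have e3 : ∫ v, collisionFrequency β v * (modeProfile n β α t v).im * ⟪k, b v⟫_ℝ * maxwellianBeta β v =
      ∫ v, (modeProfile n β α t v).im * ⟪k, b v⟫_ℝ * (collisionFrequency β v * maxwellianBeta β v) :=
    integral_congr_ae (Eventually.of_forall fun v => by ring)
  rw [e3]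
  ring

end CorrectorDerivs

/-! ## Odd moments, isotropy, the variance identity and the Cauchy–Schwarz bounds -/

section Variance

open TaggedSphereDiffusion (collisionFrequency)

variable (hd : 2 ≤ Fintype.card d) {β : ℝ} (hβ : 0 < β) {α : ℝ} (hα : 0 ≤ α) (n : d → ℤ)

include hβ in
/-- **The phase has zero mean**: `∫ ω_n M_β = 0` (`M_β` is even). [folklore] -/
theorem integral_modePhase_mul_maxwellianBeta [DecidableEq d] :
    ∫ v, modePhase n v * maxwellianBeta β v = 0 := by
  have e : (fun v : 𝔼 => modePhase n v * maxwellianBeta β v) =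
      fun v => ∑ i, (2 * Real.pi * (n i : ℝ)) * (v i * maxwellianBeta β v) := by
    funext v
    rw [modePhase_eq_sum, Finset.mul_sum, Finset.sum_mul]
    exact Finset.sum_congr rfl fun i _ => by ring
  rw [e, integral_finsetSum _ fun i _ => (integrable_coord_mul_maxwellianBeta hβ i).const_mul _]
  simp only [integral_const_mul, integral_coord_mul_maxwellianBeta, mul_zero, Finset.sum_const_zero]

include hβ in
/-- `∫ ω_n c M_β = 0` for a constant `c`. [folklore] -/
theorem integral_modePhase_mul_const_mul [DecidableEq d] (c : ℝ) :
    ∫ v, modePhase n v * c * maxwellianBeta β v = 0 := by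
  have e : (fun v : 𝔼 => modePhase n v * c * maxwellianBeta β v) = fun v => c * (modePhase n v * maxwellianBeta β v) := by
    funext v; ring
  rw [e, integral_const_mul, integral_modePhase_mul_maxwellianBeta hβ n, mul_zero]

include hd hβ in
/-- **Isotropy along the mode**: `∫ ω_n χ_ℓ M_β = 2π κ_β |ℓ|²`, `ℓ = latticeVec n`, `χ_ℓ = ℓ·b`.
[cite: BodineauGallagherSaintRaymondInvent2016, (6.8)] -/
theorem integral_modePhase_mul_inner [DecidableEq d] {b : EuclideanSpace ℝ d → EuclideanSpace ℝ d}
    (hb : IsDiffusionCorrector β b) :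
    ∫ v, modePhase n v * ⟪Literature.Analysis.FunctionSpaces.Torus.latticeVec n, b v⟫_ℝ * maxwellianBeta β v =
      2 * Real.pi * (bgsrDiffusionCoeff β b * ‖Literature.Analysis.FunctionSpaces.Torus.latticeVec n‖ ^ 2) := by
  rw [← hb.integral_inner_mul_inner hd hβ, ← integral_const_mul]
  refine integral_congr_ae (Eventually.of_forall fun v => ?_)
  simp only [modePhase]
  ring

include hβ hα in
/-- **Variance identity**: `∫ (Re ĝ - m₁)² M_β = ∫ (Re ĝ)² M_β - m₁²`, `m₁ = ∫ Re ĝ M_β`. [folklore] -/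
theorem integral_re_sub_mean_sq (t : ℝ) :
    ∫ v, ((modeProfile n β α t v).re - ∫ w, (modeProfile n β α t w).re * maxwellianBeta β w) ^ 2 * maxwellianBeta β v =
      (∫ v, (modeProfile n β α t v).re ^ 2 * maxwellianBeta β v) -
        (∫ w, (modeProfile n β α t w).re * maxwellianBeta β w) ^ 2 := by
  set m := ∫ w, (modeProfile n β α t w).re * maxwellianBeta β w
  have hm1 := measurable_re_modeProfile hβ hα n t
  have hb1 := abs_re_modeProfile_le hβ hα n t
  have hM := KineticTheory.integrable_maxwellianBeta (d := d) hβ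
  have i0 : Integrable fun v => (modeProfile n β α t v).re * maxwellianBeta β v := by
    have := integrable_bdd_mul_mul_maxwellianBeta hβ (f := fun _ : 𝔼 => (1 : ℝ)) measurable_const hm1
      (W := fun _ : 𝔼 => (1 : ℝ)) (hM.congr (Eventually.of_forall fun v => by simp)) (fun _ => by simp) hb1
    simpa using this
  have i2 : Integrable fun v => (modeProfile n β α t v).re ^ 2 * maxwellianBeta β v := by
    have := integrable_bdd_mul_mul_maxwellianBeta hβ hm1 hm1 (W := fun _ : 𝔼 => (1 : ℝ))
      (hM.congr (Eventually.of_forall fun v => by simp)) hb1 hb1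
    exact this.congr (Eventually.of_forall fun v => by simp only; ring)
  have e : (fun v => ((modeProfile n β α t v).re - m) ^ 2 * maxwellianBeta β v) = fun v =>
      (modeProfile n β α t v).re ^ 2 * maxwellianBeta β v - 2 * m * ((modeProfile n β α t v).re * maxwellianBeta β v) +
        m ^ 2 * maxwellianBeta β v := by
    funext v; ring
  have i1 : Integrable fun v => 2 * m * ((modeProfile n β α t v).re * maxwellianBeta β v) := i0.const_mul _
  have i3 : Integrable fun v : 𝔼 => m ^ 2 * maxwellianBeta β v := hM.const_mul _
  have i12 : Integrable fun v => (modeProfile n β α t v).re ^ 2 * maxwellianBeta β v -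
      2 * m * ((modeProfile n β α t v).re * maxwellianBeta β v) := i2.sub i1
  rw [e, integral_add i12 i3, integral_sub i2 i1, integral_const_mul, integral_const_mul,
    KineticTheory.integral_maxwellianBeta hβ]
  ring

include hβ hα in
/-- **Variance identity**, imaginary part. [folklore] -/
theorem integral_im_sub_mean_sq (t : ℝ) :
    ∫ v, ((modeProfile n β α t v).im - ∫ w, (modeProfile n β α t w).im * maxwellianBeta β w) ^ 2 * maxwellianBeta β v =
      (∫ v, (modeProfile n β α t v).im ^ 2 * maxwellianBeta β v) -
        (∫ w, (modeProfile n β α t w).im * maxwellianBeta β w) ^ 2 := by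
  set m := ∫ w, (modeProfile n β α t w).im * maxwellianBeta β w
  have hm1 := measurable_im_modeProfile hβ hα n t
  have hb1 := abs_im_modeProfile_le hβ hα n t
  have hM := KineticTheory.integrable_maxwellianBeta (d := d) hβ
  have i0 : Integrable fun v => (modeProfile n β α t v).im * maxwellianBeta β v := by
    have := integrable_bdd_mul_mul_maxwellianBeta hβ (f := fun _ : 𝔼 => (1 : ℝ)) measurable_const hm1
      (W := fun _ : 𝔼 => (1 : ℝ)) (hM.congr (Eventually.of_forall fun v => by simp)) (fun _ => by simp) hb1
    simpa using this
  have i2 : Integrable fun v => (modeProfile n β α t v).im ^ 2 * maxwellianBeta β v := by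
    have := integrable_bdd_mul_mul_maxwellianBeta hβ hm1 hm1 (W := fun _ : 𝔼 => (1 : ℝ))
      (hM.congr (Eventually.of_forall fun v => by simp)) hb1 hb1
    exact this.congr (Eventually.of_forall fun v => by simp only; ring)
  have e : (fun v => ((modeProfile n β α t v).im - m) ^ 2 * maxwellianBeta β v) = fun v =>
      (modeProfile n β α t v).im ^ 2 * maxwellianBeta β v - 2 * m * ((modeProfile n β α t v).im * maxwellianBeta β v) +
        m ^ 2 * maxwellianBeta β v := by
    funext v; ring
  have i1 : Integrable fun v => 2 * m * ((modeProfile n β α t v).im * maxwellianBeta β v) := i0.const_mul _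
  have i3 : Integrable fun v : 𝔼 => m ^ 2 * maxwellianBeta β v := hM.const_mul _
  have i12 : Integrable fun v => (modeProfile n β α t v).im ^ 2 * maxwellianBeta β v -
      2 * m * ((modeProfile n β α t v).im * maxwellianBeta β v) := i2.sub i1
  rw [e, integral_add i12 i3, integral_sub i2 i1, integral_const_mul, integral_const_mul,
    KineticTheory.integral_maxwellianBeta hβ]
  ring

include hβ hα in
/-- **The variance of the profile**: `E - m₁² - m₂² = ∫ [(Re ĝ - m₁)² + (Im ĝ - m₂)²] M_β`.
[folklore] -/
theorem profileEnergy_sub_sq_eq (t : ℝ) :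
    profileEnergy n β α t - profileMoment n β α Complex.reCLM (fun _ => 1) t ^ 2 -
        profileMoment n β α Complex.imCLM (fun _ => 1) t ^ 2 =
      ∫ v, (((modeProfile n β α t v).re - profileMoment n β α Complex.reCLM (fun _ => 1) t) ^ 2 +
        ((modeProfile n β α t v).im - profileMoment n β α Complex.imCLM (fun _ => 1) t) ^ 2) * maxwellianBeta β v := by
  rw [profileMoment_reCLM_one, profileMoment_imCLM_one]
  have hm1 := measurable_re_modeProfile hβ hα n t
  have hm2 := measurable_im_modeProfile hβ hα n t
  have hb1 := abs_re_modeProfile_le hβ hα n t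
  have hb2 := abs_im_modeProfile_le hβ hα n t
  have hM := KineticTheory.integrable_maxwellianBeta (d := d) hβ
  set m₁ := ∫ w, (modeProfile n β α t w).re * maxwellianBeta β w
  set m₂ := ∫ w, (modeProfile n β α t w).im * maxwellianBeta β w
  have hsq1 : ∀ v, |(modeProfile n β α t v).re - m₁| ≤ 1 + |m₁| := fun v => by
    have := abs_sub ((modeProfile n β α t v).re) m₁
    linarith [hb1 v]
  have hsq2 : ∀ v, |(modeProfile n β α t v).im - m₂| ≤ 1 + |m₂| := fun v => by
    have := abs_sub ((modeProfile n β α t v).im) m₂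
    linarith [hb2 v]
  have j1 : Integrable fun v => ((modeProfile n β α t v).re - m₁) ^ 2 * maxwellianBeta β v := by
    have := integrable_bdd_mul_mul_maxwellianBeta hβ (f := fun v => (modeProfile n β α t v).re - m₁)
      (h := fun v => (modeProfile n β α t v).re - m₁) (hm1.sub measurable_const) (hm1.sub measurable_const)
      (W := fun _ : 𝔼 => 1 + |m₁|) (hM.const_mul _) hsq1 hsq1
    exact this.congr (Eventually.of_forall fun v => by simp only; ring)
  have j2 : Integrable fun v => ((modeProfile n β α t v).im - m₂) ^ 2 * maxwellianBeta β v := by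
    have := integrable_bdd_mul_mul_maxwellianBeta hβ (f := fun v => (modeProfile n β α t v).im - m₂)
      (h := fun v => (modeProfile n β α t v).im - m₂) (hm2.sub measurable_const) (hm2.sub measurable_const)
      (W := fun _ : 𝔼 => 1 + |m₂|) (hM.const_mul _) hsq2 hsq2
    exact this.congr (Eventually.of_forall fun v => by simp only; ring)
  have k1 : Integrable fun v => (modeProfile n β α t v).re ^ 2 * maxwellianBeta β v := by
    have := integrable_bdd_mul_mul_maxwellianBeta hβ hm1 hm1 (W := fun _ : 𝔼 => (1 : ℝ))
      (hM.congr (Eventually.of_forall fun v => by simp)) hb1 hb1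
    exact this.congr (Eventually.of_forall fun v => by simp only; ring)
  have k2 : Integrable fun v => (modeProfile n β α t v).im ^ 2 * maxwellianBeta β v := by
    have := integrable_bdd_mul_mul_maxwellianBeta hβ hm2 hm2 (W := fun _ : 𝔼 => (1 : ℝ))
      (hM.congr (Eventually.of_forall fun v => by simp)) hb2 hb2
    exact this.congr (Eventually.of_forall fun v => by simp only; ring)
  have eE : profileEnergy n β α t = (∫ v, (modeProfile n β α t v).re ^ 2 * maxwellianBeta β v) +
      ∫ v, (modeProfile n β α t v).im ^ 2 * maxwellianBeta β v := by
    rw [profileEnergy, ← integral_add k1 k2]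
    exact integral_congr_ae (Eventually.of_forall fun v => by ring)
  have eV : ∫ v, (((modeProfile n β α t v).re - m₁) ^ 2 + ((modeProfile n β α t v).im - m₂) ^ 2) * maxwellianBeta β v =
      (∫ v, ((modeProfile n β α t v).re - m₁) ^ 2 * maxwellianBeta β v) +
        ∫ v, ((modeProfile n β α t v).im - m₂) ^ 2 * maxwellianBeta β v := by
    rw [← integral_add j1 j2]
    exact integral_congr_ae (Eventually.of_forall fun v => by ring)
  rw [eE, eV, integral_re_sub_mean_sq hβ hα n t, integral_im_sub_mean_sq hβ hα n t]
  ring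

include hd hβ in
/-- **Cauchy–Schwarz with the weight `a_β`**: `(∫ φ h M_β)² ≤ (∫ φ²/a_β M_β) (∫ h² a_β M_β)` for
`φ² / a_β M_β` integrable and `h` bounded measurable. [folklore] -/
theorem sq_integral_mul_le_energy {φ h : 𝔼 → ℝ} (hφm : Measurable φ)
    (hφ : Integrable fun v => φ v ^ 2 / collisionFrequency β v * maxwellianBeta β v) (hhm : Measurable h) {C : ℝ}
    (hC : ∀ v, |h v| ≤ C) :
    (∫ v, φ v * h v * maxwellianBeta β v) ^ 2 ≤
      (∫ v, φ v ^ 2 / collisionFrequency β v * maxwellianBeta β v) *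
        ∫ v, h v ^ 2 * (collisionFrequency β v * maxwellianBeta β v) := by
  obtain ⟨a₀, ha₀, c, _hc, hlow⟩ := exists_collisionFrequency_lowerBound (d := d) hd hβ
  have ha : ∀ v : 𝔼, 0 < collisionFrequency β v := fun v => ha₀.trans_le (hlow v).1
  have hsa : ∀ v : 𝔼, 0 < Real.sqrt (collisionFrequency β v) := fun v => Real.sqrt_pos.2 (ha v)
  set u : 𝔼 → ℝ := fun v => φ v / Real.sqrt (collisionFrequency β v) with hu
  set w : 𝔼 → ℝ := fun v => Real.sqrt (collisionFrequency β v) * h v with hw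
  have huw : ∀ v, u v * w v = φ v * h v := fun v => by
    have hne : Real.sqrt (collisionFrequency β v) ≠ 0 := (hsa v).ne'
    simp only [hu, hw]
    field_simp
  have hu2 : ∀ v, u v ^ 2 = φ v ^ 2 / collisionFrequency β v := fun v => by
    simp only [hu]; rw [div_pow, Real.sq_sqrt (ha v).le]
  have hw2 : ∀ v, w v ^ 2 = h v ^ 2 * collisionFrequency β v := fun v => by
    simp only [hw]; rw [mul_pow, Real.sq_sqrt (ha v).le]; ring
  have hfe := finiteEnergy_of_bounded hβ hhm hC
  have hA : Integrable (fun v => maxwellianBeta β v * u v ^ 2) :=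
    hφ.congr (Eventually.of_forall fun v => by
      show φ v ^ 2 / collisionFrequency β v * maxwellianBeta β v = maxwellianBeta β v * u v ^ 2
      rw [hu2]; ring)
  have hCi : Integrable (fun v => maxwellianBeta β v * w v ^ 2) :=
    hfe.integrable.congr (Eventually.of_forall fun v => by
      show h v ^ 2 * collisionFrequency β v * maxwellianBeta β v = maxwellianBeta β v * w v ^ 2
      rw [hw2]; ring)
  have hB : Integrable (fun v => maxwellianBeta β v * (u v * w v)) := by
    have := integrable_mul_mul_maxwellianBeta_of_sq hβ (f := u) (g := w)
      (hφm.div ((continuous_collisionFrequency hβ).measurable.sqrt))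
      ((continuous_collisionFrequency hβ).measurable.sqrt.mul hhm)
      (hA.congr (Eventually.of_forall fun v => by ring)) (hCi.congr (Eventually.of_forall fun v => by ring))
    exact this.congr (Eventually.of_forall fun v => by ring)
  have hcs := sq_integral_weight_mul_le (μ := (volume : Measure 𝔼)) (W := maxwellianBeta β) (u := u) (w := w)
    (fun v => (maxwellianBeta_pos hβ v).le) hA hCi hB
  have e1 : ∫ v, maxwellianBeta β v * (u v * w v) = ∫ v, φ v * h v * maxwellianBeta β v :=
    integral_congr_ae (Eventually.of_forall fun v => by
      show maxwellianBeta β v * (u v * w v) = φ v * h v * maxwellianBeta β v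
      rw [huw]; ring)
  have e2 : ∫ v, maxwellianBeta β v * u v ^ 2 = ∫ v, φ v ^ 2 / collisionFrequency β v * maxwellianBeta β v :=
    integral_congr_ae (Eventually.of_forall fun v => by
      show maxwellianBeta β v * u v ^ 2 = φ v ^ 2 / collisionFrequency β v * maxwellianBeta β v
      rw [hu2]; ring)
  have e3 : ∫ v, maxwellianBeta β v * w v ^ 2 = ∫ v, h v ^ 2 * (collisionFrequency β v * maxwellianBeta β v) :=
    integral_congr_ae (Eventually.of_forall fun v => by
      show maxwellianBeta β v * w v ^ 2 = h v ^ 2 * (collisionFrequency β v * maxwellianBeta β v)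
      rw [hw2]; ring)
  rw [e1, e2, e3] at hcs
  exact hcs

include hd hβ in
/-- `ω_n² / a_β M_β` is integrable (`ω_n² ≤ 4π²|n|²|v|²`, `|v| ≤ a_β / c`). [folklore] -/
theorem integrable_modePhase_sq_div [DecidableEq d] :
    Integrable fun v : 𝔼 => modePhase n v ^ 2 / collisionFrequency β v * maxwellianBeta β v := by
  obtain ⟨a₀, ha₀, c, hc, hlow⟩ := exists_collisionFrequency_lowerBound (d := d) hd hβ
  have ha : ∀ v : 𝔼, 0 < collisionFrequency β v := fun v => ha₀.trans_le (hlow v).1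
  have h1 := KineticTheory.integrable_pow_norm_mul_maxwellianBeta (d := d) hβ 1
  simp only [pow_one] at h1
  set L : ℝ := 2 * Real.pi * ‖Literature.Analysis.FunctionSpaces.Torus.latticeVec n‖ with hL
  refine ((h1.const_mul (L ^ 2 * c⁻¹))).mono' ((((continuous_modePhase n).measurable.pow_const 2).div
    (continuous_collisionFrequency hβ).measurable).mul (KineticTheory.measurable_maxwellianBeta β)).aestronglyMeasurable
    (Eventually.of_forall fun v => ?_)
  have hM := (maxwellianBeta_pos hβ v).le
  have hω := abs_modePhase_le n v
  have hω2 : modePhase n v ^ 2 ≤ L ^ 2 * ‖v‖ ^ 2 := by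
    have h := pow_le_pow_left₀ (abs_nonneg _) hω 2
    rw [mul_pow, sq_abs] at h
    rw [hL]; exact h
  rw [Real.norm_of_nonneg (mul_nonneg (div_nonneg (sq_nonneg _) (ha v).le) hM)]
  have hv : ‖v‖ ≤ c⁻¹ * collisionFrequency β v := by
    rw [← div_eq_inv_mul, le_div_iff₀' hc]; exact (hlow v).2
  have hav := ha v
  rw [div_mul_eq_mul_div, div_le_iff₀ hav]
  have h3 : modePhase n v ^ 2 ≤ L ^ 2 * (c⁻¹ * collisionFrequency β v) * ‖v‖ := by
    calc modePhase n v ^ 2 ≤ L ^ 2 * ‖v‖ ^ 2 := hω2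
      _ = L ^ 2 * ‖v‖ * ‖v‖ := by ring
      _ ≤ L ^ 2 * (c⁻¹ * collisionFrequency β v) * ‖v‖ := by gcongr
  calc modePhase n v ^ 2 * maxwellianBeta β v ≤ L ^ 2 * (c⁻¹ * collisionFrequency β v) * ‖v‖ * maxwellianBeta β v :=
        mul_le_mul_of_nonneg_right h3 hM
    _ = L ^ 2 * c⁻¹ * (‖v‖ * maxwellianBeta β v) * collisionFrequency β v := by ring

include hd hβ in
/-- `ω_n² χ_k² / a_β M_β` is integrable (`ω_n² / a_β ≤ C a_β`, `χ_k` of finite energy). [folklore] -/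
theorem integrable_modePhase_sq_mul_inner_sq_div [DecidableEq d] {b : EuclideanSpace ℝ d → EuclideanSpace ℝ d}
    (hb : IsDiffusionCorrector β b) (k : EuclideanSpace ℝ d) :
    Integrable fun v : 𝔼 => (modePhase n v * ⟪k, b v⟫_ℝ) ^ 2 / collisionFrequency β v * maxwellianBeta β v := by
  obtain ⟨a₀, ha₀, c, hc, hlow⟩ := exists_collisionFrequency_lowerBound (d := d) hd hβ
  have ha : ∀ v : 𝔼, 0 < collisionFrequency β v := fun v => ha₀.trans_le (hlow v).1
  have hχ := hb.finiteEnergy_inner hβ k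
  set L : ℝ := 2 * Real.pi * ‖Literature.Analysis.FunctionSpaces.Torus.latticeVec n‖ with hL
  refine ((hχ.integrable.const_mul (L ^ 2 * c⁻¹ ^ 2))).mono'
    ((((((continuous_modePhase n).measurable.mul (measurable_const.inner hb.1)).pow_const 2).div
      (continuous_collisionFrequency hβ).measurable).mul (KineticTheory.measurable_maxwellianBeta β)).aestronglyMeasurable)
    (Eventually.of_forall fun v => ?_)
  have hM := (maxwellianBeta_pos hβ v).le
  have hω := abs_modePhase_le n v
  have hav := ha v
  have hv : ‖v‖ ≤ c⁻¹ * collisionFrequency β v := by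
    rw [← div_eq_inv_mul, le_div_iff₀' hc]; exact (hlow v).2
  have hω' : |modePhase n v| ≤ L * c⁻¹ * collisionFrequency β v := by
    calc |modePhase n v| ≤ L * ‖v‖ := by rw [hL]; exact hω
      _ ≤ L * (c⁻¹ * collisionFrequency β v) := by gcongr
      _ = L * c⁻¹ * collisionFrequency β v := by ring
  have hω2 : modePhase n v ^ 2 ≤ (L * c⁻¹ * collisionFrequency β v) ^ 2 := by
    rw [← sq_abs]; exact pow_le_pow_left₀ (abs_nonneg _) hω' 2
  rw [Real.norm_of_nonneg (mul_nonneg (div_nonneg (sq_nonneg _) hav.le) hM)]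
  calc (modePhase n v * ⟪k, b v⟫_ℝ) ^ 2 / collisionFrequency β v * maxwellianBeta β v
      = modePhase n v ^ 2 * (⟪k, b v⟫_ℝ ^ 2 / collisionFrequency β v * maxwellianBeta β v) := by ring
    _ ≤ (L * c⁻¹ * collisionFrequency β v) ^ 2 * (⟪k, b v⟫_ℝ ^ 2 / collisionFrequency β v * maxwellianBeta β v) :=
        mul_le_mul_of_nonneg_right hω2 (mul_nonneg (div_nonneg (sq_nonneg _) hav.le) hM)
    _ = L ^ 2 * c⁻¹ ^ 2 * (⟪k, b v⟫_ℝ ^ 2 * collisionFrequency β v * maxwellianBeta β v) := by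
        field_simp

end Variance

/-! ## A barrier lemma and the uniform bound on the orthogonal part -/

section Barrier

/-- **Barrier lemma.** If `y` is continuous on `[0, T]`, differentiable on `(0, T)`, `y 0 ≤ θ`, and
`y' ≤ 0` wherever `y > θ`, then `y ≤ θ` on `[0, T]` (mean value theorem on the last excursion
above `θ`). [folklore] -/
theorem le_of_deriv_nonpos_above {y y' : ℝ → ℝ} {θ T : ℝ} (hy : ContinuousOn y (Icc 0 T))
    (hder : ∀ t ∈ Ioo 0 T, HasDerivAt y (y' t) t) (h0 : y 0 ≤ θ)
    (hneg : ∀ t ∈ Ioo 0 T, θ < y t → y' t ≤ 0) : ∀ t ∈ Icc 0 T, y t ≤ θ := by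
  intro t₁ ht₁
  by_contra hgt'
  have hgt : θ < y t₁ := lt_of_not_ge hgt'
  -- the last time before `t₁` at which `y ≤ θ`
  set S : Set ℝ := Icc 0 t₁ ∩ y ⁻¹' Iic θ with hS
  have hy1 : ContinuousOn y (Icc 0 t₁) := hy.mono (Icc_subset_Icc_right ht₁.2)
  have hSc : IsClosed S := hy1.preimage_isClosed_of_isClosed isClosed_Icc isClosed_Iic
  have h0S : (0 : ℝ) ∈ S := ⟨⟨le_rfl, ht₁.1⟩, h0⟩
  have hSne : S.Nonempty := ⟨0, h0S⟩
  have hSbdd : BddAbove S := ⟨t₁, fun s hs => hs.1.2⟩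
  set t₀ := sSup S with ht₀
  have ht₀S : t₀ ∈ S := hSc.csSup_mem hSne hSbdd
  have ht₀0 : 0 ≤ t₀ := ht₀S.1.1
  have ht₀1 : t₀ ≤ t₁ := ht₀S.1.2
  have hyt₀ : y t₀ ≤ θ := ht₀S.2
  have hlt : t₀ < t₁ := lt_of_le_of_ne ht₀1 fun h => by rw [h] at hyt₀; linarith
  -- above `θ` on `(t₀, t₁]`
  have habove : ∀ s ∈ Ioc t₀ t₁, θ < y s := by
    intro s hs
    by_contra hle'
    have hle : y s ≤ θ := le_of_not_gt hle'
    have hsS : s ∈ S := ⟨⟨ht₀0.trans hs.1.le, hs.2⟩, hle⟩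
    have := le_csSup hSbdd hsS
    linarith [hs.1]
  -- mean value theorem on `[t₀, t₁]`
  have hcont : ContinuousOn y (Icc t₀ t₁) := hy.mono (Icc_subset_Icc ht₀0 ht₁.2)
  have hdiff : ∀ s ∈ Ioo t₀ t₁, HasDerivAt y (y' s) s := fun s hs =>
    hder s ⟨ht₀0.trans_lt hs.1, hs.2.trans_le ht₁.2⟩
  obtain ⟨ξ, hξ, hξeq⟩ := exists_hasDerivAt_eq_slope y y' hlt hcont hdiff
  have hξneg : y' ξ ≤ 0 := hneg ξ ⟨ht₀0.trans_lt hξ.1, hξ.2.trans_le ht₁.2⟩ (habove ξ ⟨hξ.1, hξ.2.le⟩)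
  have hpos : 0 < (y t₁ - y t₀) / (t₁ - t₀) := div_pos (by linarith) (by linarith)
  linarith

/-- **AM–GM for the cross term**: `z² ≤ K² X`, `X ≥ 0`, `P > 0` give `2|z| ≤ P X + K²/P`. [folklore] -/
theorem two_abs_le_of_sq_le {z K X P : ℝ} (hz : z ^ 2 ≤ K ^ 2 * X) (hX : 0 ≤ X) (hP : 0 < P) :
    2 * |z| ≤ P * X + K ^ 2 / P := by
  have hR : 0 ≤ P * X + K ^ 2 / P := by positivity
  have h1 : (2 * z) ^ 2 ≤ (P * X + K ^ 2 / P) ^ 2 := by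
    have h2 : (P * X + K ^ 2 / P) ^ 2 - 4 * (K ^ 2 * X) = (P * X - K ^ 2 / P) ^ 2 := by
      field_simp
      ring
    nlinarith [sq_nonneg (P * X - K ^ 2 / P)]
  have h3 := abs_le_of_sq_le_sq' h1 hR
  rcases abs_cases z with ⟨h, _⟩ | ⟨h, _⟩ <;> linarith [h3.1, h3.2]

end Barrier

section OrthogonalBound

open TaggedSphereDiffusion (collisionFrequency)

variable (hd : 2 ≤ Fintype.card d) {β : ℝ} (hβ : 0 < β) (n : d → ℤ)

include hβ in
/-- `|m₁| ≤ 1`: the mean of the real part is bounded by one. [folklore] -/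
theorem abs_meanRe_le_one {α : ℝ} (hα : 0 ≤ α) (t : ℝ) :
    |profileMoment n β α Complex.reCLM (fun _ => 1) t| ≤ 1 := by
  have hb1 := abs_re_modeProfile_le hβ hα n t
  rw [profileMoment_reCLM_one]
  calc |∫ v, (modeProfile n β α t v).re * maxwellianBeta β v| ≤ ∫ v, |(modeProfile n β α t v).re * maxwellianBeta β v| :=
        abs_integral_le_integral_abs
    _ ≤ ∫ v, maxwellianBeta β v := by
        refine integral_mono_of_nonneg (Eventually.of_forall fun v => abs_nonneg _)
          (KineticTheory.integrable_maxwellianBeta hβ) (Eventually.of_forall fun v => ?_)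
        have hM := (maxwellianBeta_pos hβ v).le
        show |(modeProfile n β α t v).re * maxwellianBeta β v| ≤ maxwellianBeta β v
        rw [abs_mul, abs_of_nonneg hM]
        nlinarith [hb1 v]
    _ = 1 := KineticTheory.integral_maxwellianBeta hβ

include hβ in
/-- `|m₂| ≤ 1`: the mean of the imaginary part is bounded by one. [folklore] -/
theorem abs_meanIm_le_one {α : ℝ} (hα : 0 ≤ α) (t : ℝ) :
    |profileMoment n β α Complex.imCLM (fun _ => 1) t| ≤ 1 := by
  have hb2 := abs_im_modeProfile_le hβ hα n t
  rw [profileMoment_imCLM_one]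
  calc |∫ v, (modeProfile n β α t v).im * maxwellianBeta β v| ≤ ∫ v, |(modeProfile n β α t v).im * maxwellianBeta β v| :=
        abs_integral_le_integral_abs
    _ ≤ ∫ v, maxwellianBeta β v := by
        refine integral_mono_of_nonneg (Eventually.of_forall fun v => abs_nonneg _)
          (KineticTheory.integrable_maxwellianBeta hβ) (Eventually.of_forall fun v => ?_)
        have hM := (maxwellianBeta_pos hβ v).le
        show |(modeProfile n β α t v).im * maxwellianBeta β v| ≤ maxwellianBeta β v
        rw [abs_mul, abs_of_nonneg hM]
        nlinarith [hb2 v]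
    _ = 1 := KineticTheory.integral_maxwellianBeta hβ

include hβ in
/-- The phase moments only see the orthogonal part: `∫ ω_n g M_β = ∫ ω_n (g - c) M_β`. [folklore] -/
theorem integral_modePhase_mul_eq_centred [DecidableEq d] {g : 𝔼 → ℝ} (hgm : Measurable g) {C : ℝ} (hC : ∀ v, |g v| ≤ C)
    (c : ℝ) :
    ∫ v, modePhase n v * g v * maxwellianBeta β v = ∫ v, modePhase n v * (g v - c) * maxwellianBeta β v := by
  have i1 := integrable_modePhase_mul hβ n hgm hC
  have i2 : Integrable fun v : 𝔼 => modePhase n v * c * maxwellianBeta β v :=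
    integrable_modePhase_mul hβ n measurable_const (C := |c|) (fun _ => le_rfl)
  have e : (fun v => modePhase n v * (g v - c) * maxwellianBeta β v) =
      fun v => modePhase n v * g v * maxwellianBeta β v - modePhase n v * c * maxwellianBeta β v := by
    funext v; ring
  rw [e, integral_sub i1 i2, integral_modePhase_mul_const_mul hβ n, sub_zero]

include hd hβ in
/-- **The differential inequality for the variance.** With `c` a centred gap constant, `a₀` a
lower bound of `a_β` and `K_ω = ∫ ω_n²/a_β M_β`, for every `α > 0` and every `t`,
`E'(t) - 2 m₁ m₁' - 2 m₂ m₂' ≤ -α c a₀ y(t) + 2 K_ω / (α c)`, `y = E - m₁² - m₂²` the variance, `a₀ ≤ a_β`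
(spectral gap + Cauchy–Schwarz + AM–GM on the cross terms `2|∫ ω_n w_k M_β|`). [folklore] -/
theorem variance_dissipation_ineq [DecidableEq d] {c a₀ : ℝ} (hc : 0 < c)
    (hgap : ∀ h : 𝔼 → ℝ, FiniteEnergy β h →
      c * ∫ v, (h v - ∫ w, h w * maxwellianBeta β w) ^ 2 * (collisionFrequency β v * maxwellianBeta β v) ≤ dirichletForm β h h)
    (hlow : ∀ v : 𝔼, a₀ ≤ collisionFrequency β v) {α : ℝ} (hα : 0 < α) (t : ℝ) :
    (∫ v, 2 * ((modeProfile n β α t v).re * (modeDeriv n β α t v).re +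
        (modeProfile n β α t v).im * (modeDeriv n β α t v).im) * maxwellianBeta β v) -
      2 * profileMoment n β α Complex.reCLM (fun _ => 1) t *
        (∫ v, modePhase n v * (modeProfile n β α t v).im * maxwellianBeta β v) +
      2 * profileMoment n β α Complex.imCLM (fun _ => 1) t *
        (∫ v, modePhase n v * (modeProfile n β α t v).re * maxwellianBeta β v) ≤
      -(α * c * a₀) * (profileEnergy n β α t - profileMoment n β α Complex.reCLM (fun _ => 1) t ^ 2 -
        profileMoment n β α Complex.imCLM (fun _ => 1) t ^ 2) +
      2 * (∫ v : 𝔼, modePhase n v ^ 2 / collisionFrequency β v * maxwellianBeta β v) / (α * c) := by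
  set Kω : ℝ := ∫ v : 𝔼, modePhase n v ^ 2 / collisionFrequency β v * maxwellianBeta β v with hKω
  have hKω0 : 0 ≤ Kω := integral_nonneg fun v => mul_nonneg (div_nonneg (sq_nonneg _)
    (TaggedLinearBoltzmannSeries.collisionFrequency_nonneg hβ v)) (maxwellianBeta_pos hβ v).le
  set m₁ := profileMoment n β α Complex.reCLM (fun _ => 1) t with hm₁
  set m₂ := profileMoment n β α Complex.imCLM (fun _ => 1) t with hm₂
  set z₁ : ℝ := ∫ v, modePhase n v * (modeProfile n β α t v).re * maxwellianBeta β v with hz₁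
  set z₂ : ℝ := ∫ v, modePhase n v * (modeProfile n β α t v).im * maxwellianBeta β v with hz₂
  have hm1m := measurable_re_modeProfile hβ hα.le n t
  have hm2m := measurable_im_modeProfile hβ hα.le n t
  have hb1 := abs_re_modeProfile_le hβ hα.le n t
  have hb2 := abs_im_modeProfile_le hβ hα.le n t
  have hfe1 : FiniteEnergy β (fun v => (modeProfile n β α t v).re) := finiteEnergy_of_bounded hβ hm1m hb1
  have hfe2 : FiniteEnergy β (fun v => (modeProfile n β α t v).im) := finiteEnergy_of_bounded hβ hm2m hb2
  have hmean1 : m₁ = ∫ v, (modeProfile n β α t v).re * maxwellianBeta β v := profileMoment_reCLM_one n t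
  have hmean2 : m₂ = ∫ v, (modeProfile n β α t v).im * maxwellianBeta β v := profileMoment_imCLM_one n t
  have habs1 : |m₁| ≤ 1 := abs_meanRe_le_one hβ n hα.le t
  have habs2 : |m₂| ≤ 1 := abs_meanIm_le_one hβ n hα.le t
  -- the orthogonal parts and their energies
  set X₁ : ℝ := ∫ v, ((modeProfile n β α t v).re - m₁) ^ 2 * (collisionFrequency β v * maxwellianBeta β v) with hX₁
  set X₂ : ℝ := ∫ v, ((modeProfile n β α t v).im - m₂) ^ 2 * (collisionFrequency β v * maxwellianBeta β v) with hX₂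
  have hX₁0 : 0 ≤ X₁ := integral_nonneg fun v => mul_nonneg (sq_nonneg _)
    (mul_nonneg (TaggedLinearBoltzmannSeries.collisionFrequency_nonneg hβ v) (maxwellianBeta_pos hβ v).le)
  have hX₂0 : 0 ≤ X₂ := integral_nonneg fun v => mul_nonneg (sq_nonneg _)
    (mul_nonneg (TaggedLinearBoltzmannSeries.collisionFrequency_nonneg hβ v) (maxwellianBeta_pos hβ v).le)
  -- gap
  have hE := integral_energyDeriv_eq hd hβ hα.le n t
  have hB1 : c * X₁ ≤ dirichletForm β (fun v => (modeProfile n β α t v).re) (fun v => (modeProfile n β α t v).re) := by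
    have h := hgap _ hfe1
    rw [← hmean1] at h
    exact h
  have hB2 : c * X₂ ≤ dirichletForm β (fun v => (modeProfile n β α t v).im) (fun v => (modeProfile n β α t v).im) := by
    have h := hgap _ hfe2
    rw [← hmean2] at h
    exact h
  -- cross terms
  have hsub1 : ∀ v, |(modeProfile n β α t v).re - m₁| ≤ 2 := fun v => by
    have := abs_sub ((modeProfile n β α t v).re) m₁; linarith [hb1 v]
  have hsub2 : ∀ v, |(modeProfile n β α t v).im - m₂| ≤ 2 := fun v => by
    have := abs_sub ((modeProfile n β α t v).im) m₂; linarith [hb2 v]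
  have hz₁eq : z₁ = ∫ v, modePhase n v * ((modeProfile n β α t v).re - m₁) * maxwellianBeta β v :=
    integral_modePhase_mul_eq_centred hβ n hm1m hb1 m₁
  have hz₂eq : z₂ = ∫ v, modePhase n v * ((modeProfile n β α t v).im - m₂) * maxwellianBeta β v :=
    integral_modePhase_mul_eq_centred hβ n hm2m hb2 m₂
  have hcs1 : z₁ ^ 2 ≤ Kω * X₁ := by
    rw [hz₁eq]
    exact sq_integral_mul_le_energy hd hβ (continuous_modePhase n).measurable (integrable_modePhase_sq_div hd hβ n)
      (h := fun v => (modeProfile n β α t v).re - m₁) (hm1m.sub measurable_const) hsub1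
  have hcs2 : z₂ ^ 2 ≤ Kω * X₂ := by
    rw [hz₂eq]
    exact sq_integral_mul_le_energy hd hβ (continuous_modePhase n).measurable (integrable_modePhase_sq_div hd hβ n)
      (h := fun v => (modeProfile n β α t v).im - m₂) (hm2m.sub measurable_const) hsub2
  have hP : 0 < α * c := mul_pos hα hc
  have hK : Real.sqrt Kω ^ 2 = Kω := Real.sq_sqrt hKω0
  have hcs1' : z₁ ^ 2 ≤ Real.sqrt Kω ^ 2 * X₁ := by rw [hK]; exact hcs1
  have hcs2' : z₂ ^ 2 ≤ Real.sqrt Kω ^ 2 * X₂ := by rw [hK]; exact hcs2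
  have ham1 : 2 * |z₁| ≤ α * c * X₁ + Real.sqrt Kω ^ 2 / (α * c) := two_abs_le_of_sq_le hcs1' hX₁0 hP
  have ham2 : 2 * |z₂| ≤ α * c * X₂ + Real.sqrt Kω ^ 2 / (α * c) := two_abs_le_of_sq_le hcs2' hX₂0 hP
  rw [hK] at ham1 ham2
  -- `X₁ + X₂ ≥ a₀ y`
  have hyeq := profileEnergy_sub_sq_eq hβ hα.le n t
  rw [← hm₁, ← hm₂] at hyeq
  have hXy : a₀ * (profileEnergy n β α t - m₁ ^ 2 - m₂ ^ 2) ≤ X₁ + X₂ := by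
    have hM := KineticTheory.integrable_maxwellianBeta (d := d) hβ
    have j1 : Integrable fun v => ((modeProfile n β α t v).re - m₁) ^ 2 * maxwellianBeta β v := by
      have := integrable_bdd_mul_mul_maxwellianBeta hβ (f := fun v => (modeProfile n β α t v).re - m₁)
        (h := fun v => (modeProfile n β α t v).re - m₁) (hm1m.sub measurable_const) (hm1m.sub measurable_const)
        (W := fun _ : 𝔼 => (2 : ℝ)) (hM.const_mul _) hsub1 hsub1
      exact this.congr (Eventually.of_forall fun v => by simp only; ring)
    have j2 : Integrable fun v => ((modeProfile n β α t v).im - m₂) ^ 2 * maxwellianBeta β v := by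
      have := integrable_bdd_mul_mul_maxwellianBeta hβ (f := fun v => (modeProfile n β α t v).im - m₂)
        (h := fun v => (modeProfile n β α t v).im - m₂) (hm2m.sub measurable_const) (hm2m.sub measurable_const)
        (W := fun _ : 𝔼 => (2 : ℝ)) (hM.const_mul _) hsub2 hsub2
      exact this.congr (Eventually.of_forall fun v => by simp only; ring)
    have k1 : Integrable fun v => ((modeProfile n β α t v).re - m₁) ^ 2 * (collisionFrequency β v * maxwellianBeta β v) :=
      (finiteEnergy_of_bounded hβ (g := fun v => (modeProfile n β α t v).re - m₁) (hm1m.sub measurable_const) hsub1).integrable.congr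
        (Eventually.of_forall fun v => by ring)
    have k2 : Integrable fun v => ((modeProfile n β α t v).im - m₂) ^ 2 * (collisionFrequency β v * maxwellianBeta β v) :=
      (finiteEnergy_of_bounded hβ (g := fun v => (modeProfile n β α t v).im - m₂) (hm2m.sub measurable_const) hsub2).integrable.congr
        (Eventually.of_forall fun v => by ring)
    have j12 : Integrable fun v => (((modeProfile n β α t v).re - m₁) ^ 2 + ((modeProfile n β α t v).im - m₂) ^ 2) *
        maxwellianBeta β v :=
      (j1.add j2).congr (Eventually.of_forall fun v => by
        show ((modeProfile n β α t v).re - m₁) ^ 2 * maxwellianBeta β v +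
            ((modeProfile n β α t v).im - m₂) ^ 2 * maxwellianBeta β v = _
        ring)
    have k12 : Integrable fun v => ((modeProfile n β α t v).re - m₁) ^ 2 * (collisionFrequency β v * maxwellianBeta β v) +
        ((modeProfile n β α t v).im - m₂) ^ 2 * (collisionFrequency β v * maxwellianBeta β v) := k1.add k2
    rw [hyeq, hX₁, hX₂, ← integral_add k1 k2, ← integral_const_mul]
    refine integral_mono (j12.const_mul a₀) k12 fun v => ?_
    have hMv := (maxwellianBeta_pos hβ v).le
    have ha := hlow v
    have hsq : 0 ≤ (((modeProfile n β α t v).re - m₁) ^ 2 + ((modeProfile n β α t v).im - m₂) ^ 2) * maxwellianBeta β v :=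
      mul_nonneg (add_nonneg (sq_nonneg _) (sq_nonneg _)) hMv
    show a₀ * ((((modeProfile n β α t v).re - m₁) ^ 2 + ((modeProfile n β α t v).im - m₂) ^ 2) * maxwellianBeta β v) ≤
      ((modeProfile n β α t v).re - m₁) ^ 2 * (collisionFrequency β v * maxwellianBeta β v) +
        ((modeProfile n β α t v).im - m₂) ^ 2 * (collisionFrequency β v * maxwellianBeta β v)
    calc a₀ * ((((modeProfile n β α t v).re - m₁) ^ 2 + ((modeProfile n β α t v).im - m₂) ^ 2) * maxwellianBeta β v)
        ≤ collisionFrequency β v * ((((modeProfile n β α t v).re - m₁) ^ 2 +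
            ((modeProfile n β α t v).im - m₂) ^ 2) * maxwellianBeta β v) := mul_le_mul_of_nonneg_right ha hsq
      _ = _ := by ring
  -- assembly (linear arithmetic in the atoms)
  have hm1z : -(2 * m₁ * z₂) ≤ 2 * |z₂| := by
    have h2 : |m₁ * z₂| ≤ |z₂| := by rw [abs_mul]; exact mul_le_of_le_one_left (abs_nonneg _) habs1
    linarith [neg_abs_le (m₁ * z₂)]
  have hm2z : 2 * m₂ * z₁ ≤ 2 * |z₁| := by
    have h2 : |m₂ * z₁| ≤ |z₁| := by rw [abs_mul]; exact mul_le_of_le_one_left (abs_nonneg _) habs2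
    linarith [le_abs_self (m₂ * z₁)]
  have h1 : 2 * α * (c * X₁) ≤ 2 * α * dirichletForm β (fun v => (modeProfile n β α t v).re) (fun v => (modeProfile n β α t v).re) :=
    mul_le_mul_of_nonneg_left hB1 (by positivity)
  have h2 : 2 * α * (c * X₂) ≤ 2 * α * dirichletForm β (fun v => (modeProfile n β α t v).im) (fun v => (modeProfile n β α t v).im) :=
    mul_le_mul_of_nonneg_left hB2 (by positivity)
  have h3 : α * c * (a₀ * (profileEnergy n β α t - m₁ ^ 2 - m₂ ^ 2)) ≤ α * c * (X₁ + X₂) :=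
    mul_le_mul_of_nonneg_left hXy hP.le
  rw [hE]
  set B₁ := dirichletForm β (fun v => (modeProfile n β α t v).re) (fun v => (modeProfile n β α t v).re) with hB₁
  set B₂ := dirichletForm β (fun v => (modeProfile n β α t v).im) (fun v => (modeProfile n β α t v).im) with hB₂
  set E := profileEnergy n β α t with hEdef
  set Q : ℝ := Kω / (α * c) with hQ
  have hQ2 : 2 * Kω / (α * c) = 2 * Q := by rw [hQ]; ring
  rw [hQ2]
  have hsum : -(2 * α) * (B₁ + B₂) - 2 * m₁ * z₂ + 2 * m₂ * z₁ ≤ -(α * c) * (X₁ + X₂) + 2 * Q := by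
    linarith [h1, h2, ham1, ham2, hm1z, hm2z]
  have hfin : -(α * c) * (X₁ + X₂) ≤ -(α * c * a₀) * (E - m₁ ^ 2 - m₂ ^ 2) := by linarith [h3]
  linarith [hsum, hfin]

include hd hβ in
/-- **Uniform smallness of the orthogonal part** (Step E of the module docstring): there is
`Θ ≥ 0` (depending on `d, β, n` only) such that for every `α > 0` and `t ≥ 0`,
`E(t) - m₁(t)² - m₂(t)² = ∫ |ĝ_n(t) - m(t)|² M_β ≤ Θ / α²`: the variance starts at `0` and
cannot cross the level `Θ/α²`, its derivative being nonpositive there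
(`variance_dissipation_ineq` and the barrier lemma). [cite: BodineauGallagherSaintRaymondInvent2016, §6.1.3] -/
theorem exists_variance_bound [DecidableEq d] :
    ∃ Θ : ℝ, 0 ≤ Θ ∧ ∀ α : ℝ, 0 < α → ∀ t : ℝ, 0 ≤ t →
      profileEnergy n β α t - profileMoment n β α Complex.reCLM (fun _ => 1) t ^ 2 -
        profileMoment n β α Complex.imCLM (fun _ => 1) t ^ 2 ≤ Θ / α ^ 2 := by
  obtain ⟨c, hc, hgap⟩ := exists_spectralGap_centred (d := d) hd hβ
  obtain ⟨a₀, ha₀, c', _hc', hlow⟩ := exists_collisionFrequency_lowerBound (d := d) hd hβ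
  set Kω : ℝ := ∫ v : 𝔼, modePhase n v ^ 2 / collisionFrequency β v * maxwellianBeta β v with hKω
  have hKω0 : 0 ≤ Kω := integral_nonneg fun v => mul_nonneg (div_nonneg (sq_nonneg _)
    (TaggedLinearBoltzmannSeries.collisionFrequency_nonneg hβ v)) (maxwellianBeta_pos hβ v).le
  refine ⟨2 * Kω / (c ^ 2 * a₀), by positivity, fun α hα => ?_⟩
  set θ : ℝ := 2 * Kω / (c ^ 2 * a₀) / α ^ 2 with hθ
  set m₁ := profileMoment n β α Complex.reCLM (fun _ => 1) with hm₁
  set m₂ := profileMoment n β α Complex.imCLM (fun _ => 1) with hm₂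
  set y : ℝ → ℝ := fun t => profileEnergy n β α t - m₁ t ^ 2 - m₂ t ^ 2 with hy
  set E' : ℝ → ℝ := fun t => ∫ v, 2 * ((modeProfile n β α t v).re * (modeDeriv n β α t v).re +
    (modeProfile n β α t v).im * (modeDeriv n β α t v).im) * maxwellianBeta β v with hE'
  set z₁ : ℝ → ℝ := fun t => ∫ v, modePhase n v * (modeProfile n β α t v).re * maxwellianBeta β v with hz₁
  set z₂ : ℝ → ℝ := fun t => ∫ v, modePhase n v * (modeProfile n β α t v).im * maxwellianBeta β v with hz₂
  have hyc : Continuous y := by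
    have h1 := continuous_profileEnergy hβ hα.le n
    have hψ : Integrable fun v : 𝔼 => |(1 : ℝ)| * maxwellianBeta β v :=
      (KineticTheory.integrable_maxwellianBeta hβ).congr (Eventually.of_forall fun v => by simp)
    have h2 := continuous_profileMoment hβ hα.le n Complex.reCLM abs_reCLM_le measurable_const hψ
    have h3 := continuous_profileMoment hβ hα.le n Complex.imCLM abs_imCLM_le measurable_const hψ
    exact (h1.sub (h2.pow 2)).sub (h3.pow 2)
  have hyd : ∀ t, 0 < t → HasDerivAt y (E' t - 2 * m₁ t * z₂ t + 2 * m₂ t * z₁ t) t := by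
    intro t ht
    have h1 := hasDerivAt_profileEnergy hβ hα.le n ht
    have h2 := hasDerivAt_meanRe hd hβ hα.le n ht
    have h3 := hasDerivAt_meanIm hd hβ hα.le n ht
    have h := (h1.sub (h2.pow 2)).sub (h3.pow 2)
    refine h.congr_deriv ?_
    simp only [hE', hz₁, hz₂, Nat.cast_ofNat, Nat.add_one_sub_one, pow_one]
    ring
  have hy0 : y 0 ≤ θ := by
    have : y 0 = 0 := by
      simp only [hy, hm₁, hm₂, profileEnergy_zero hβ n, profileMoment_reCLM_one_zero hβ n, profileMoment_imCLM_one_zero n]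
      norm_num
    rw [this]; positivity
  have hneg : ∀ t, 0 < t → θ < y t → E' t - 2 * m₁ t * z₂ t + 2 * m₂ t * z₁ t ≤ 0 := by
    intro t _ hθy
    have h := variance_dissipation_ineq hd hβ n hc hgap (fun v => (hlow v).1) hα t
    have hθy' : 2 * Kω / (α * c) < α * c * a₀ * y t := by
      have : α * c * a₀ * θ = 2 * Kω / (α * c) := by
        rw [hθ]; field_simp
      rw [← this]
      exact mul_lt_mul_of_pos_left hθy (by positivity)
    have e1 : (2 : ℝ) * Kω / (α * c) = 2 * Kω * (α * c)⁻¹ := by ring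
    simp only [hE', hz₁, hz₂, hy] at h hθy' ⊢
    linarith
  -- the barrier lemma on every `[0, T]`
  intro t ht
  exact le_of_deriv_nonpos_above (T := t) hyc.continuousOn (fun s hs => hyd s hs.1) hy0
    (fun s hs hθs => hneg s hs.1 hθs) t ⟨ht, le_rfl⟩

end OrthogonalBound

/-! ## The dissipation integral and the corrector moments in time -/

section Dissipation

open TaggedSphereDiffusion (collisionFrequency)

variable (hd : 2 ≤ Fintype.card d) {β : ℝ} (hβ : 0 < β) {α : ℝ} (hα : 0 ≤ α) (n : d → ℤ)

include hβ hα in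
/-- **Continuity of the energy derivative in time** (dominated convergence). [folklore] -/
theorem continuous_energyDeriv [DecidableEq d] :
    Continuous fun t => ∫ v, 2 * ((modeProfile n β α t v).re * (modeDeriv n β α t v).re +
      (modeProfile n β α t v).im * (modeDeriv n β α t v).im) * maxwellianBeta β v := by
  set C := max (4 * Real.pi * ‖Literature.Analysis.FunctionSpaces.Torus.latticeVec n‖) (6 * α) with hC
  have hC0 : 0 ≤ C := le_trans (by positivity) (le_max_right _ _)
  have hW := integrable_one_add_norm_add_collisionFrequency_mul (d := d) hβ
  have hgm : ∀ x, Measurable fun v => modeProfile n β α x v := fun x => measurable_modeProfile_right hβ hα n x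
  have hΓm : ∀ x, Measurable fun v => modeDeriv n β α x v := fun x =>
    ((continuous_modeDeriv hβ hα n).comp (Continuous.prodMk_right x)).measurable
  refine continuous_of_dominated (bound := fun v => 4 * C * ((1 + ‖v‖ + collisionFrequency β v) * maxwellianBeta β v))
    (fun x => ?_) (fun x => Eventually.of_forall fun v => ?_) (hW.const_mul (4 * C)) (Eventually.of_forall fun v => ?_)
  · exact ((measurable_const.mul (((Complex.measurable_re.comp (hgm x)).mul (Complex.measurable_re.comp (hΓm x))).add
      ((Complex.measurable_im.comp (hgm x)).mul (Complex.measurable_im.comp (hΓm x))))).mul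
      (KineticTheory.measurable_maxwellianBeta β)).aestronglyMeasurable
  · have hMv := (maxwellianBeta_pos hβ v).le
    have h1 := abs_re_modeProfile_le hβ hα n x v
    have h2 := abs_im_modeProfile_le hβ hα n x v
    have hΓ := norm_modeDeriv_le_weight hβ hα n x v
    have h3 : |(modeDeriv n β α x v).re| ≤ C * (1 + ‖v‖ + collisionFrequency β v) := (Complex.abs_re_le_norm _).trans hΓ
    have h4 : |(modeDeriv n β α x v).im| ≤ C * (1 + ‖v‖ + collisionFrequency β v) := (Complex.abs_im_le_norm _).trans hΓ
    rw [Real.norm_eq_abs, abs_mul, abs_mul, abs_of_nonneg hMv, abs_two]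
    have h5 : |(modeProfile n β α x v).re * (modeDeriv n β α x v).re +
        (modeProfile n β α x v).im * (modeDeriv n β α x v).im| ≤ 2 * (C * (1 + ‖v‖ + collisionFrequency β v)) := by
      refine (abs_add_le _ _).trans ?_
      rw [abs_mul, abs_mul]
      have hCw : 0 ≤ C * (1 + ‖v‖ + collisionFrequency β v) := mul_nonneg hC0
        (by linarith [norm_nonneg v, TaggedLinearBoltzmannSeries.collisionFrequency_nonneg hβ v])
      nlinarith [abs_nonneg (modeProfile n β α x v).re, abs_nonneg (modeProfile n β α x v).im,
        abs_nonneg (modeDeriv n β α x v).re, abs_nonneg (modeDeriv n β α x v).im]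
    calc 2 * |(modeProfile n β α x v).re * (modeDeriv n β α x v).re +
          (modeProfile n β α x v).im * (modeDeriv n β α x v).im| * maxwellianBeta β v
        ≤ 2 * (2 * (C * (1 + ‖v‖ + collisionFrequency β v))) * maxwellianBeta β v :=
          mul_le_mul_of_nonneg_right (mul_le_mul_of_nonneg_left h5 zero_le_two) hMv
      _ = 4 * C * ((1 + ‖v‖ + collisionFrequency β v) * maxwellianBeta β v) := by ring
  · have hc := continuous_modeProfile_left hβ hα n v
    have hΓ := (continuous_modeDeriv hβ hα n).comp (Continuous.prodMk_left v)
    exact (continuous_const.mul (((Complex.continuous_re.comp hc).mul (Complex.continuous_re.comp hΓ)).add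
      ((Complex.continuous_im.comp hc).mul (Complex.continuous_im.comp hΓ)))).mul continuous_const

include hβ in
/-- The energy is nonnegative. [folklore] -/
theorem profileEnergy_nonneg (t : ℝ) : 0 ≤ profileEnergy n β α t :=
  integral_nonneg fun v => mul_nonneg (add_nonneg (sq_nonneg _) (sq_nonneg _)) (maxwellianBeta_pos hβ v).le

include hd hβ in
/-- **The dissipation integral** (integrated energy identity): for `α > 0` and `t ≥ 0`,
`∫₀ᵗ (B(g₁, g₁) + B(g₂, g₂)) ds = (1 - E(t)) / (2α) ≤ 1 / (2α)`.
[cite: BodineauGallagherSaintRaymondInvent2016, §6.1.2] -/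
theorem integral_dissipation_eq [DecidableEq d] {α : ℝ} (hα : 0 < α) {t : ℝ} (ht : 0 ≤ t) :
    ∫ s in (0 : ℝ)..t, (dirichletForm β (fun v => (modeProfile n β α s v).re) (fun v => (modeProfile n β α s v).re) +
        dirichletForm β (fun v => (modeProfile n β α s v).im) (fun v => (modeProfile n β α s v).im)) =
      (1 - profileEnergy n β α t) / (2 * α) := by
  have hE'c := continuous_energyDeriv hβ hα.le n
  have hftc := intervalIntegral.integral_eq_sub_of_hasDerivAt_of_le ht (continuous_profileEnergy hβ hα.le n).continuousOn
    (fun s hs => hasDerivAt_profileEnergy hβ hα.le n hs.1) (hE'c.intervalIntegrable 0 t)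
  rw [profileEnergy_zero hβ n] at hftc
  have e : ∀ s, dirichletForm β (fun v => (modeProfile n β α s v).re) (fun v => (modeProfile n β α s v).re) +
      dirichletForm β (fun v => (modeProfile n β α s v).im) (fun v => (modeProfile n β α s v).im) =
      (-(2 * α))⁻¹ * ∫ v, 2 * ((modeProfile n β α s v).re * (modeDeriv n β α s v).re +
        (modeProfile n β α s v).im * (modeDeriv n β α s v).im) * maxwellianBeta β v := by
    intro s
    rw [integral_energyDeriv_eq hd hβ hα.le n s]
    field_simp
  simp_rw [e]
  rw [intervalIntegral.integral_const_mul, hftc]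
  field_simp
  ring

include hd hβ in
/-- `∫₀ᵗ (B₁ + B₂) ≤ 1/(2α)`. [folklore] -/
theorem integral_dissipation_le [DecidableEq d] {α : ℝ} (hα : 0 < α) {t : ℝ} (ht : 0 ≤ t) :
    ∫ s in (0 : ℝ)..t, (dirichletForm β (fun v => (modeProfile n β α s v).re) (fun v => (modeProfile n β α s v).re) +
        dirichletForm β (fun v => (modeProfile n β α s v).im) (fun v => (modeProfile n β α s v).im)) ≤
      1 / (2 * α) := by
  rw [integral_dissipation_eq hd hβ n hα ht]
  have := profileEnergy_nonneg hβ n (α := α) t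
  exact div_le_div_of_nonneg_right (by linarith) (by positivity)

include hd hβ hα in
/-- **Continuity of the dissipation in time** (`B₁ + B₂ = -E'/(2α)` for `α > 0`; in general, each
term is an integral continuous by dominated convergence — here we use the former for `α > 0` and
state continuity of the explicit combination). [folklore] -/
theorem continuous_dissipation [DecidableEq d] (hα' : 0 < α) :
    Continuous fun s => dirichletForm β (fun v => (modeProfile n β α s v).re) (fun v => (modeProfile n β α s v).re) +
      dirichletForm β (fun v => (modeProfile n β α s v).im) (fun v => (modeProfile n β α s v).im) := by
  have hE'c := continuous_energyDeriv hβ hα n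
  have e : (fun s => dirichletForm β (fun v => (modeProfile n β α s v).re) (fun v => (modeProfile n β α s v).re) +
      dirichletForm β (fun v => (modeProfile n β α s v).im) (fun v => (modeProfile n β α s v).im)) =
      fun s => (-(2 * α))⁻¹ * ∫ v, 2 * ((modeProfile n β α s v).re * (modeDeriv n β α s v).re +
        (modeProfile n β α s v).im * (modeDeriv n β α s v).im) * maxwellianBeta β v := by
    funext s
    rw [integral_energyDeriv_eq hd hβ hα n s]
    field_simp
  rw [e]
  exact continuous_const.mul hE'c

include hd hβ hα in
/-- The dissipation is nonnegative. [folklore] -/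
theorem dissipation_nonneg (t : ℝ) :
    0 ≤ dirichletForm β (fun v => (modeProfile n β α t v).re) (fun v => (modeProfile n β α t v).re) +
      dirichletForm β (fun v => (modeProfile n β α t v).im) (fun v => (modeProfile n β α t v).im) :=
  add_nonneg (dirichletForm_self_nonneg hd hβ (finiteEnergy_of_bounded hβ (measurable_re_modeProfile hβ hα n t)
    (abs_re_modeProfile_le hβ hα n t)))
    (dirichletForm_self_nonneg hd hβ (finiteEnergy_of_bounded hβ (measurable_im_modeProfile hβ hα n t)
      (abs_im_modeProfile_le hβ hα n t)))

end Dissipation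

/-! ## The corrector moments in time and the cross terms -/

section TestMoments

open TaggedSphereDiffusion (collisionFrequency)

variable (hd : 2 ≤ Fintype.card d) {β : ℝ} (hβ : 0 < β) {α : ℝ} (hα : 0 ≤ α) (n : d → ℤ)
  {b : EuclideanSpace ℝ d → EuclideanSpace ℝ d} (hb : IsDiffusionCorrector β b)

/-- `∫ (ℓ·v) h M_β = (2π)⁻¹ ∫ ω_n h M_β` (`ω_n = 2π ℓ·v`, `ℓ = latticeVec n`). [folklore] -/
theorem integral_inner_latticeVec_mul [DecidableEq d] (h : 𝔼 → ℝ) :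
    ∫ v, ⟪Literature.Analysis.FunctionSpaces.Torus.latticeVec n, v⟫_ℝ * h v * maxwellianBeta β v =
      (2 * Real.pi)⁻¹ * ∫ v, modePhase n v * h v * maxwellianBeta β v := by
  rw [← integral_const_mul]
  refine integral_congr_ae (Eventually.of_forall fun v => ?_)
  have hπ : (2 * Real.pi) ≠ 0 := by positivity
  simp only [modePhase]
  field_simp

include hd hβ hα hb in
/-- **`d/dt ∫ Re ĝ χ_ℓ M_β`** (`t > 0`), `χ_ℓ = ℓ·b`:
`= ∫ ω_n Im ĝ χ_ℓ M_β - (α/2π) ∫ ω_n Re ĝ M_β`. [cite: BodineauGallagherSaintRaymondInvent2016, (6.5)] -/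
theorem hasDerivAt_testRe [DecidableEq d] {t : ℝ} (ht : 0 < t) :
    HasDerivAt (profileMoment n β α Complex.reCLM fun v => ⟪Literature.Analysis.FunctionSpaces.Torus.latticeVec n, b v⟫_ℝ)
      ((∫ v, modePhase n v * (modeProfile n β α t v).im *
          ⟪Literature.Analysis.FunctionSpaces.Torus.latticeVec n, b v⟫_ℝ * maxwellianBeta β v) -
        α * (2 * Real.pi)⁻¹ * ∫ v, modePhase n v * (modeProfile n β α t v).re * maxwellianBeta β v) t := by
  set ℓ := Literature.Analysis.FunctionSpaces.Torus.latticeVec n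
  have h := hasDerivAt_profileMoment hβ hα n Complex.reCLM abs_reCLM_le (measurable_const.inner hb.1)
    (hb.integrable_weight_abs_inner hd hβ ℓ) ht
  refine h.congr_deriv ?_
  simp only [Complex.reCLM_apply]
  rw [integral_re_modeDeriv_mul_inner hd hβ hα n hb ℓ t, integral_inner_latticeVec_mul n]
  ring

include hd hβ hα hb in
/-- **`d/dt ∫ Im ĝ χ_ℓ M_β`** (`t > 0`): `= -∫ ω_n Re ĝ χ_ℓ M_β - (α/2π) ∫ ω_n Im ĝ M_β`.
[cite: BodineauGallagherSaintRaymondInvent2016, (6.5)] -/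
theorem hasDerivAt_testIm [DecidableEq d] {t : ℝ} (ht : 0 < t) :
    HasDerivAt (profileMoment n β α Complex.imCLM fun v => ⟪Literature.Analysis.FunctionSpaces.Torus.latticeVec n, b v⟫_ℝ)
      (-(∫ v, modePhase n v * (modeProfile n β α t v).re *
          ⟪Literature.Analysis.FunctionSpaces.Torus.latticeVec n, b v⟫_ℝ * maxwellianBeta β v) -
        α * (2 * Real.pi)⁻¹ * ∫ v, modePhase n v * (modeProfile n β α t v).im * maxwellianBeta β v) t := by
  set ℓ := Literature.Analysis.FunctionSpaces.Torus.latticeVec n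
  have h := hasDerivAt_profileMoment hβ hα n Complex.imCLM abs_imCLM_le (measurable_const.inner hb.1)
    (hb.integrable_weight_abs_inner hd hβ ℓ) ht
  refine h.congr_deriv ?_
  simp only [Complex.imCLM_apply]
  rw [integral_im_modeDeriv_mul_inner hd hβ hα n hb ℓ t, integral_inner_latticeVec_mul n]
  ring

include hd hβ hα hb in
/-- **The corrector moments are bounded**: `|∫ p(ĝ) χ_k M_β| ≤ 2 ∫ |χ_k| M_β`. [folklore] -/
theorem abs_profileMoment_inner_le (p : ℂ →L[ℝ] ℝ) (hp : ∀ z, |p z| ≤ ‖z‖) (k : EuclideanSpace ℝ d) (t : ℝ) :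
    |profileMoment n β α p (fun v => ⟪k, b v⟫_ℝ) t| ≤ 2 * ∫ v, |⟪k, b v⟫_ℝ| * maxwellianBeta β v := by
  have hχ := hb.integrable_abs_inner hd hβ k
  rw [profileMoment, ← integral_const_mul]
  calc |∫ v, p (modeProfile n β α t v) * ⟪k, b v⟫_ℝ * maxwellianBeta β v|
      ≤ ∫ v, |p (modeProfile n β α t v) * ⟪k, b v⟫_ℝ * maxwellianBeta β v| := abs_integral_le_integral_abs
    _ ≤ ∫ v, 2 * (|⟪k, b v⟫_ℝ| * maxwellianBeta β v) := by
        refine integral_mono_of_nonneg (Eventually.of_forall fun v => abs_nonneg _) (hχ.const_mul 2)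
          (Eventually.of_forall fun v => ?_)
        have hM := (maxwellianBeta_pos hβ v).le
        have h1 : |p (modeProfile n β α t v)| ≤ 2 := (hp _).trans (norm_modeProfile_le hβ hα n t v)
        show |p (modeProfile n β α t v) * ⟪k, b v⟫_ℝ * maxwellianBeta β v| ≤ 2 * (|⟪k, b v⟫_ℝ| * maxwellianBeta β v)
        rw [abs_mul, abs_mul, abs_of_nonneg hM]
        nlinarith [mul_nonneg (abs_nonneg ⟪k, b v⟫_ℝ) hM, abs_nonneg (p (modeProfile n β α t v))]

include hd hβ hb in
/-- `ω_n h χ_k M_β` is integrable for bounded measurable `h`. [folklore] -/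
theorem IsDiffusionCorrector.integrable_modePhase_mul_mul_inner [DecidableEq d] (k : EuclideanSpace ℝ d)
    {h : 𝔼 → ℝ} (hhm : Measurable h) {C : ℝ} (hC : ∀ v, |h v| ≤ C) :
    Integrable fun v => modePhase n v * h v * ⟪k, b v⟫_ℝ * maxwellianBeta β v := by
  obtain ⟨a₀, _ha₀, c, hc, hlow⟩ := exists_collisionFrequency_lowerBound (d := d) hd hβ
  have haχ := hb.integrable_collisionFrequency_mul_abs_inner hβ k
  set L : ℝ := 2 * Real.pi * ‖Literature.Analysis.FunctionSpaces.Torus.latticeVec n‖ with hL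
  have h1 := integrable_bdd_mul_mul_maxwellianBeta hβ (f := fun v => modePhase n v * ⟪k, b v⟫_ℝ)
    (h := h) (W := fun v => L * c⁻¹ * (collisionFrequency β v * |⟪k, b v⟫_ℝ|))
    ((continuous_modePhase n).measurable.mul (measurable_const.inner hb.1)) hhm
    ((haχ.const_mul (L * c⁻¹)).congr (Eventually.of_forall fun v => by simp only; ring))
    (fun v => by
      have hω := abs_modePhase_le n v
      have hv : ‖v‖ ≤ c⁻¹ * collisionFrequency β v := by
        rw [← div_eq_inv_mul, le_div_iff₀' hc]; exact (hlow v).2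
      rw [abs_mul]
      calc |modePhase n v| * |⟪k, b v⟫_ℝ| ≤ L * ‖v‖ * |⟪k, b v⟫_ℝ| := by rw [hL]; gcongr
        _ ≤ L * (c⁻¹ * collisionFrequency β v) * |⟪k, b v⟫_ℝ| := by gcongr
        _ = L * c⁻¹ * (collisionFrequency β v * |⟪k, b v⟫_ℝ|) := by ring) hC
  exact h1.congr (Eventually.of_forall fun v => by ring)

include hd hβ hb in
/-- **The cross term is controlled by the dissipation** (AM–GM after Cauchy–Schwarz and the
spectral gap): for `h` measurable with `|h| ≤ 1`, `c` a centred gap constant and `α > 0`,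
`2 |∫ ω_n (h - ∫ h M_β) χ_k M_β| ≤ α B(h, h) + K_χ / (α c)`, `K_χ = ∫ (ω_n χ_k)² / a_β M_β`.
[folklore] -/
theorem two_abs_crossMoment_le [DecidableEq d] (k : EuclideanSpace ℝ d) {c : ℝ} (hc : 0 < c)
    (hgap : ∀ h : 𝔼 → ℝ, FiniteEnergy β h →
      c * ∫ v, (h v - ∫ w, h w * maxwellianBeta β w) ^ 2 * (collisionFrequency β v * maxwellianBeta β v) ≤ dirichletForm β h h)
    {α : ℝ} (hα : 0 < α) {h : 𝔼 → ℝ} (hhm : Measurable h) (hC : ∀ v, |h v| ≤ 1) :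
    2 * |(∫ v, modePhase n v * h v * ⟪k, b v⟫_ℝ * maxwellianBeta β v) -
        (∫ v, h v * maxwellianBeta β v) * ∫ v, modePhase n v * ⟪k, b v⟫_ℝ * maxwellianBeta β v| ≤
      α * dirichletForm β h h + (∫ v, (modePhase n v * ⟪k, b v⟫_ℝ) ^ 2 / collisionFrequency β v * maxwellianBeta β v) / (α * c) := by
  set μ : ℝ := ∫ v, h v * maxwellianBeta β v with hμ
  set Kχ : ℝ := ∫ v, (modePhase n v * ⟪k, b v⟫_ℝ) ^ 2 / collisionFrequency β v * maxwellianBeta β v with hKχ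
  set X : ℝ := ∫ v, (h v - μ) ^ 2 * (collisionFrequency β v * maxwellianBeta β v) with hX
  have hX0 : 0 ≤ X := integral_nonneg fun v => mul_nonneg (sq_nonneg _)
    (mul_nonneg (TaggedLinearBoltzmannSeries.collisionFrequency_nonneg hβ v) (maxwellianBeta_pos hβ v).le)
  have hKχ0 : 0 ≤ Kχ := integral_nonneg fun v => mul_nonneg (div_nonneg (sq_nonneg _)
    (TaggedLinearBoltzmannSeries.collisionFrequency_nonneg hβ v)) (maxwellianBeta_pos hβ v).le
  -- the cross term as a centred moment
  have hsub : ∀ v, |h v - μ| ≤ 2 := fun v => by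
    have hμ1 : |μ| ≤ 1 := by
      rw [hμ]
      calc |∫ v, h v * maxwellianBeta β v| ≤ ∫ v, |h v * maxwellianBeta β v| := abs_integral_le_integral_abs
        _ ≤ ∫ v, maxwellianBeta β v := by
            refine integral_mono_of_nonneg (Eventually.of_forall fun v => abs_nonneg _)
              (KineticTheory.integrable_maxwellianBeta hβ) (Eventually.of_forall fun v => ?_)
            have hM := (maxwellianBeta_pos hβ v).le
            show |h v * maxwellianBeta β v| ≤ maxwellianBeta β v
            rw [abs_mul, abs_of_nonneg hM]
            nlinarith [hC v]
        _ = 1 := KineticTheory.integral_maxwellianBeta hβ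
    have := abs_sub (h v) μ
    linarith [hC v]
  have i1 := hb.integrable_modePhase_mul_mul_inner hd hβ n k hhm hC
  have i2 := hb.integrable_modePhase_mul_mul_inner hd hβ n k (h := fun _ => μ) measurable_const (C := |μ|) (fun _ => le_rfl)
  have hI : (∫ v, modePhase n v * h v * ⟪k, b v⟫_ℝ * maxwellianBeta β v) -
      μ * ∫ v, modePhase n v * ⟪k, b v⟫_ℝ * maxwellianBeta β v =
      ∫ v, (modePhase n v * ⟪k, b v⟫_ℝ) * (h v - μ) * maxwellianBeta β v := by
    rw [← integral_const_mul, ← integral_sub i1 (i2.congr (Eventually.of_forall fun v => by simp only; ring))]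
    exact integral_congr_ae (Eventually.of_forall fun v => by ring)
  rw [hI]
  -- Cauchy–Schwarz and AM–GM
  have hcs : (∫ v, (modePhase n v * ⟪k, b v⟫_ℝ) * (h v - μ) * maxwellianBeta β v) ^ 2 ≤ Kχ * X :=
    sq_integral_mul_le_energy hd hβ ((continuous_modePhase n).measurable.mul (measurable_const.inner hb.1))
      (integrable_modePhase_sq_mul_inner_sq_div hd hβ n hb k) (h := fun v => h v - μ) (hhm.sub measurable_const) hsub
  have hP : 0 < α * c := mul_pos hα hc
  have hK : Real.sqrt Kχ ^ 2 = Kχ := Real.sq_sqrt hKχ0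
  have hcs' : (∫ v, (modePhase n v * ⟪k, b v⟫_ℝ) * (h v - μ) * maxwellianBeta β v) ^ 2 ≤ Real.sqrt Kχ ^ 2 * X := by
    rw [hK]; exact hcs
  have ham := two_abs_le_of_sq_le hcs' hX0 hP
  rw [hK] at ham
  have hfe := finiteEnergy_of_bounded hβ hhm hC
  have hB : c * X ≤ dirichletForm β h h := hgap h hfe
  have h3 : α * c * X ≤ α * dirichletForm β h h := by
    calc α * c * X = α * (c * X) := by ring
      _ ≤ α * dirichletForm β h h := mul_le_mul_of_nonneg_left hB hα.le
  linarith

/-- **A Duhamel/Grönwall-type bound.** If `Φ` is continuous on `[0, t]` and differentiable on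
`(0, t)` with `|Φ'(s)| ≤ A e^{λ s} (K₀ + K₁ D(s))` for a continuous `D ≥ 0` with `∫₀ᵗ D ≤ D_∞`
(`λ, A, K₀, K₁ ≥ 0`), then `|Φ(t) - Φ(0)| ≤ A e^{λ t} (K₀ t + K₁ D_∞)`. [folklore] -/
theorem abs_sub_le_of_deriv_bound {t lam A K₀ K₁ Dint : ℝ} (ht : 0 ≤ t) (hlam : 0 ≤ lam) (hA : 0 ≤ A)
    (hK₀ : 0 ≤ K₀) (hK₁ : 0 ≤ K₁) {Φ Φ' D : ℝ → ℝ} (hΦc : ContinuousOn Φ (Icc 0 t))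
    (hΦd : ∀ s ∈ Ioo 0 t, HasDerivAt Φ (Φ' s) s) (hΦ'i : IntervalIntegrable Φ' volume 0 t)
    (hDc : Continuous D) (hD0 : ∀ s, 0 ≤ D s) (hDint : ∫ s in (0 : ℝ)..t, D s ≤ Dint)
    (hbound : ∀ s ∈ Icc 0 t, |Φ' s| ≤ A * Real.exp (lam * s) * (K₀ + K₁ * D s)) :
    |Φ t - Φ 0| ≤ A * Real.exp (lam * t) * (K₀ * t + K₁ * Dint) := by
  have hftc := intervalIntegral.integral_eq_sub_of_hasDerivAt_of_le ht hΦc hΦd hΦ'i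
  rw [← hftc]
  have hexp : 0 ≤ A * Real.exp (lam * t) := mul_nonneg hA (Real.exp_nonneg _)
  set g : ℝ → ℝ := fun s => A * Real.exp (lam * t) * (K₀ + K₁ * D s) with hg
  have hgc : Continuous g := continuous_const.mul (continuous_const.add (continuous_const.mul hDc))
  calc |∫ s in (0 : ℝ)..t, Φ' s| ≤ ∫ s in (0 : ℝ)..t, |Φ' s| := intervalIntegral.abs_integral_le_integral_abs ht
    _ ≤ ∫ s in (0 : ℝ)..t, g s := by
        refine intervalIntegral.integral_mono_on ht hΦ'i.abs (hgc.intervalIntegrable _ _) fun s hs => ?_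
        refine (hbound s hs).trans ?_
        simp only [hg]
        have h1 : Real.exp (lam * s) ≤ Real.exp (lam * t) := Real.exp_le_exp.2 (mul_le_mul_of_nonneg_left hs.2 hlam)
        have h2 : 0 ≤ K₀ + K₁ * D s := add_nonneg hK₀ (mul_nonneg hK₁ (hD0 s))
        exact mul_le_mul_of_nonneg_right (mul_le_mul_of_nonneg_left h1 hA) h2
    _ = A * Real.exp (lam * t) * (K₀ * t + K₁ * ∫ s in (0 : ℝ)..t, D s) := by
        simp only [hg]
        rw [intervalIntegral.integral_const_mul, intervalIntegral.integral_add (intervalIntegrable_const)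
          ((hDc.intervalIntegrable _ _).const_mul K₁), intervalIntegral.integral_const_mul,
          intervalIntegral.integral_const, smul_eq_mul, sub_zero, mul_comm t K₀]
    _ ≤ A * Real.exp (lam * t) * (K₀ * t + K₁ * Dint) := by
        refine mul_le_mul_of_nonneg_left ?_ hexp
        have := mul_le_mul_of_nonneg_left hDint hK₁
        linarith

end TestMoments

/-! ## The mean relaxes like `e^{-λ' t}`, `λ' = 4π² κ_β |n|² / α` -/

section MeanBound

open TaggedSphereDiffusion (collisionFrequency)

variable (hd : 2 ≤ Fintype.card d) {β : ℝ} (hβ : 0 < β) (n : d → ℤ)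
  {b : EuclideanSpace ℝ d → EuclideanSpace ℝ d} (hb : IsDiffusionCorrector β b)

include hd hβ hb in
/-- `|ω_n χ_k| M_β` is integrable. [folklore] -/
theorem IsDiffusionCorrector.integrable_abs_modePhase_mul_inner [DecidableEq d] (k : EuclideanSpace ℝ d) :
    Integrable fun v => |modePhase n v * ⟪k, b v⟫_ℝ| * maxwellianBeta β v := by
  have h := hb.integrable_modePhase_mul_mul_inner hd hβ n k (h := fun _ => (1 : ℝ)) measurable_const (C := 1)
    (fun _ => by rw [abs_one])
  refine h.abs.congr (Eventually.of_forall fun v => ?_)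
  have hM := (maxwellianBeta_pos hβ v).le
  show |modePhase n v * 1 * ⟪k, b v⟫_ℝ * maxwellianBeta β v| = _
  rw [mul_one, abs_mul, abs_of_nonneg hM]

include hd hβ hb in
/-- **Relaxation of the mean, real part.** With `c` a centred gap constant, `ℓ = latticeVec n`,
`κ = κ_β`, `λ' = 4π² κ |ℓ|² / α`, `C_J = 2 ∫ |χ_ℓ| M_β`, `K_χ = ∫ (ω_n χ_ℓ)²/a_β M_β`: for `α ≥ 1`
and `0 ≤ t ≤ αT`,
`|m₁(t) - e^{-λ' t}| ≤ (2π/α) (4π² κ |ℓ|² T C_J + K_χ T/(2c) + 1/4 + 2 C_J)`.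
Proof: `Φ(s) = e^{λ' s}(m₁ + (2π/α) J₂)` has `Φ' = (2π/α) e^{λ' s}(λ' J₂ - I₁)` with the cross term
`I₁ = ∫ ω_n (g₁ - m₁) χ_ℓ M_β` (isotropy `∫ ω_n χ_ℓ M_β = 2π κ |ℓ|²`), `2|I₁| ≤ α(B₁ + B₂) + K_χ/(αc)`,
and `∫₀ᵗ (B₁ + B₂) ≤ 1/(2α)`. [cite: BodineauGallagherSaintRaymondInvent2016, §6.1.2–6.1.3] -/
theorem abs_meanRe_sub_exp_le [DecidableEq d] {c : ℝ} (hc : 0 < c)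
    (hgap : ∀ h : 𝔼 → ℝ, FiniteEnergy β h →
      c * ∫ v, (h v - ∫ w, h w * maxwellianBeta β w) ^ 2 * (collisionFrequency β v * maxwellianBeta β v) ≤ dirichletForm β h h)
    {α : ℝ} (hα : 1 ≤ α) {T : ℝ} {t : ℝ} (ht0 : 0 ≤ t) (htT : t ≤ α * T) :
    |profileMoment n β α Complex.reCLM (fun _ => 1) t -
        Real.exp (-(4 * Real.pi ^ 2 * bgsrDiffusionCoeff β b *
          ‖Literature.Analysis.FunctionSpaces.Torus.latticeVec n‖ ^ 2 / α * t))| ≤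
      2 * Real.pi / α * (4 * Real.pi ^ 2 * bgsrDiffusionCoeff β b *
          ‖Literature.Analysis.FunctionSpaces.Torus.latticeVec n‖ ^ 2 * T *
          (2 * ∫ v, |⟪Literature.Analysis.FunctionSpaces.Torus.latticeVec n, b v⟫_ℝ| * maxwellianBeta β v) +
        (∫ v, (modePhase n v * ⟪Literature.Analysis.FunctionSpaces.Torus.latticeVec n, b v⟫_ℝ) ^ 2 /
          collisionFrequency β v * maxwellianBeta β v) * T / (2 * c) + 1 / 4 +
        2 * (2 * ∫ v, |⟪Literature.Analysis.FunctionSpaces.Torus.latticeVec n, b v⟫_ℝ| * maxwellianBeta β v)) := by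
  have hα0 : 0 < α := by linarith
  have hπ : 0 < Real.pi := Real.pi_pos
  set ℓ := Literature.Analysis.FunctionSpaces.Torus.latticeVec n with hℓ
  set κ := bgsrDiffusionCoeff β b with hκ
  have hκ0 : 0 < κ := bgsr_diffusionCoeff_pos_holds hd hβ b hb
  set ρ : ℝ := 2 * Real.pi * (κ * ‖ℓ‖ ^ 2) with hρ
  have hρ0 : 0 ≤ ρ := by positivity
  set A : ℝ := 2 * Real.pi / α with hA
  have hA0 : 0 ≤ A := by positivity
  set lam : ℝ := A * ρ with hlam
  have hlam0 : 0 ≤ lam := mul_nonneg hA0 hρ0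
  have hlam_eq : ∀ s, -(4 * Real.pi ^ 2 * κ * ‖ℓ‖ ^ 2 / α * s) = -(lam * s) := fun s => by
    rw [hlam, hA, hρ]; field_simp; ring
  set CJ : ℝ := 2 * ∫ v, |⟪ℓ, b v⟫_ℝ| * maxwellianBeta β v with hCJ
  have hCJ0 : 0 ≤ CJ := mul_nonneg zero_le_two (integral_nonneg fun v => mul_nonneg (abs_nonneg _) (maxwellianBeta_pos hβ v).le)
  set Kχ : ℝ := ∫ v, (modePhase n v * ⟪ℓ, b v⟫_ℝ) ^ 2 / collisionFrequency β v * maxwellianBeta β v with hKχ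
  have hKχ0 : 0 ≤ Kχ := integral_nonneg fun v => mul_nonneg (div_nonneg (sq_nonneg _)
    (TaggedLinearBoltzmannSeries.collisionFrequency_nonneg hβ v)) (maxwellianBeta_pos hβ v).le
  -- the players
  set m₁ := profileMoment n β α Complex.reCLM (fun _ => 1) with hm₁
  set J₂ := profileMoment n β α Complex.imCLM (fun v => ⟪ℓ, b v⟫_ℝ) with hJ₂
  set z₂ : ℝ → ℝ := fun s => ∫ v, modePhase n v * (modeProfile n β α s v).im * maxwellianBeta β v with hz₂
  set P₁ : ℝ → ℝ := fun s => ∫ v, modePhase n v * (modeProfile n β α s v).re * ⟪ℓ, b v⟫_ℝ * maxwellianBeta β v with hP₁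
  set I₁ : ℝ → ℝ := fun s => P₁ s - m₁ s * ρ with hI₁
  set D : ℝ → ℝ := fun s => dirichletForm β (fun v => (modeProfile n β α s v).re) (fun v => (modeProfile n β α s v).re) +
    dirichletForm β (fun v => (modeProfile n β α s v).im) (fun v => (modeProfile n β α s v).im) with hD
  set Φ : ℝ → ℝ := fun s => Real.exp (lam * s) * (m₁ s + A * J₂ s) with hΦ
  set Φ' : ℝ → ℝ := fun s => A * Real.exp (lam * s) * (lam * J₂ s - I₁ s) with hΦ'
  -- isotropy `ρ = ∫ ω χ M`
  have hρint : ∫ v, modePhase n v * ⟪ℓ, b v⟫_ℝ * maxwellianBeta β v = ρ := by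
    rw [hρ, hℓ]; exact integral_modePhase_mul_inner hd hβ n hb
  -- continuity
  have hψ1 : Integrable fun v : 𝔼 => |(1 : ℝ)| * maxwellianBeta β v :=
    (KineticTheory.integrable_maxwellianBeta hβ).congr (Eventually.of_forall fun v => by simp)
  have hm₁c : Continuous m₁ := continuous_profileMoment hβ hα0.le n Complex.reCLM abs_reCLM_le measurable_const hψ1
  have hJ₂c : Continuous J₂ := continuous_profileMoment hβ hα0.le n Complex.imCLM abs_imCLM_le
    (measurable_const.inner hb.1) (hb.integrable_abs_inner hd hβ ℓ)
  have hP₁c : Continuous P₁ := by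
    have h := continuous_profileMoment hβ hα0.le n Complex.reCLM abs_reCLM_le
      ((continuous_modePhase n).measurable.mul (measurable_const.inner hb.1)) (hb.integrable_abs_modePhase_mul_inner hd hβ n ℓ)
    have e : P₁ = profileMoment n β α Complex.reCLM (fun v => modePhase n v * ⟪ℓ, b v⟫_ℝ) := by
      funext s
      simp only [hP₁, profileMoment, Complex.reCLM_apply]
      exact integral_congr_ae (Eventually.of_forall fun v => by ring)
    rw [e]; exact h
  have hDc : Continuous D := continuous_dissipation hd hβ hα0.le n hα0
  have hΦc : Continuous Φ := (Real.continuous_exp.comp (continuous_const.mul continuous_id)).mul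
    (hm₁c.add (continuous_const.mul hJ₂c))
  have hΦ'c : Continuous Φ' := (continuous_const.mul (Real.continuous_exp.comp (continuous_const.mul continuous_id))).mul
    ((continuous_const.mul hJ₂c).sub (hP₁c.sub (hm₁c.mul continuous_const)))
  -- the derivative
  have hΦd : ∀ s, 0 < s → HasDerivAt Φ (Φ' s) s := by
    intro s hs
    have he : HasDerivAt (fun s => Real.exp (lam * s)) (Real.exp (lam * s) * (lam * 1)) s :=
      ((hasDerivAt_id s).const_mul lam).exp
    have hm := hasDerivAt_meanRe hd hβ hα0.le n hs
    have hJ := hasDerivAt_testIm hd hβ hα0.le n hb hs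
    have h := he.mul (hm.add (hJ.const_mul A))
    refine h.congr_deriv ?_
    simp only [hΦ', hI₁, hP₁, hlam, hA, hm₁, hJ₂, hℓ, Pi.add_apply]
    field_simp
    ring
  -- the bound on `Φ'`
  have hbound : ∀ s ∈ Icc 0 t, |Φ' s| ≤ A * Real.exp (lam * s) * ((lam * CJ + Kχ / (2 * (α * c))) + α / 2 * D s) := by
    intro s _
    have hJb : |J₂ s| ≤ CJ := abs_profileMoment_inner_le hd hβ hα0.le n hb Complex.imCLM abs_imCLM_le ℓ s
    have hIb : 2 * |I₁ s| ≤ α * D s + Kχ / (α * c) := by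
      have h := two_abs_crossMoment_le hd hβ n hb ℓ hc hgap hα0 (measurable_re_modeProfile hβ hα0.le n s)
        (abs_re_modeProfile_le hβ hα0.le n s)
      have hm1s : m₁ s = ∫ v, (modeProfile n β α s v).re * maxwellianBeta β v := profileMoment_reCLM_one n s
      have eI : I₁ s = (∫ v, modePhase n v * (modeProfile n β α s v).re * ⟪ℓ, b v⟫_ℝ * maxwellianBeta β v) -
          (∫ v, (modeProfile n β α s v).re * maxwellianBeta β v) * ∫ v, modePhase n v * ⟪ℓ, b v⟫_ℝ * maxwellianBeta β v := by
        simp only [hI₁, hP₁]; rw [hρint, hm1s]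
      rw [eI]
      have hB2 : 0 ≤ dirichletForm β (fun v => (modeProfile n β α s v).im) (fun v => (modeProfile n β α s v).im) :=
        dirichletForm_self_nonneg hd hβ (finiteEnergy_of_bounded hβ (measurable_im_modeProfile hβ hα0.le n s)
          (abs_im_modeProfile_le hβ hα0.le n s))
      have : α * dirichletForm β (fun v => (modeProfile n β α s v).re) (fun v => (modeProfile n β α s v).re) ≤ α * D s := by
        simp only [hD]; nlinarith
      linarith
    have hexp : 0 ≤ A * Real.exp (lam * s) := mul_nonneg hA0 (Real.exp_nonneg _)
    simp only [hΦ']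
    rw [abs_mul, abs_of_nonneg hexp]
    refine mul_le_mul_of_nonneg_left ?_ hexp
    calc |lam * J₂ s - I₁ s| ≤ |lam * J₂ s| + |I₁ s| := abs_sub _ _
      _ ≤ lam * CJ + (α * D s + Kχ / (α * c)) / 2 := by
          rw [abs_mul, abs_of_nonneg hlam0]
          have := mul_le_mul_of_nonneg_left hJb hlam0
          linarith
      _ = lam * CJ + Kχ / (2 * (α * c)) + α / 2 * D s := by ring
  -- Duhamel bound
  have hK₀ : 0 ≤ lam * CJ + Kχ / (2 * (α * c)) := by positivity
  have hDu := abs_sub_le_of_deriv_bound ht0 hlam0 hA0 hK₀ (by positivity : (0 : ℝ) ≤ α / 2) hΦc.continuousOn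
    (fun s hs => hΦd s hs.1) (hΦ'c.intervalIntegrable 0 t) hDc (fun s => dissipation_nonneg hd hβ hα0.le n s)
    (integral_dissipation_le hd hβ n hα0 ht0) hbound
  -- back to `m₁`
  have hm10 : m₁ 0 = 1 := profileMoment_reCLM_one_zero hβ n
  have hΦ0 : Φ 0 = 1 + A * J₂ 0 := by simp only [hΦ, mul_zero, Real.exp_zero, one_mul, hm10]
  have hexp_pos : 0 < Real.exp (lam * t) := Real.exp_pos _
  have hkey : m₁ t - Real.exp (-(lam * t)) = Real.exp (-(lam * t)) * (Φ t - Φ 0) +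
      A * (Real.exp (-(lam * t)) * J₂ 0 - J₂ t) := by
    rw [hΦ0]; simp only [hΦ]
    rw [Real.exp_neg]
    field_simp
    ring
  rw [hlam_eq t, hkey]
  have hJ0 : |J₂ 0| ≤ CJ := abs_profileMoment_inner_le hd hβ hα0.le n hb Complex.imCLM abs_imCLM_le ℓ 0
  have hJt : |J₂ t| ≤ CJ := abs_profileMoment_inner_le hd hβ hα0.le n hb Complex.imCLM abs_imCLM_le ℓ t
  have he1 : Real.exp (-(lam * t)) ≤ 1 := by rw [Real.exp_le_one_iff]; nlinarith
  have he0 : 0 ≤ Real.exp (-(lam * t)) := Real.exp_nonneg _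
  have h1 : |Real.exp (-(lam * t)) * (Φ t - Φ 0)| ≤ A * ((lam * CJ + Kχ / (2 * (α * c))) * t + α / 2 * (1 / (2 * α))) := by
    rw [abs_mul, abs_of_nonneg he0]
    calc Real.exp (-(lam * t)) * |Φ t - Φ 0|
        ≤ Real.exp (-(lam * t)) * (A * Real.exp (lam * t) * ((lam * CJ + Kχ / (2 * (α * c))) * t + α / 2 * (1 / (2 * α)))) :=
          mul_le_mul_of_nonneg_left hDu he0
      _ = A * ((lam * CJ + Kχ / (2 * (α * c))) * t + α / 2 * (1 / (2 * α))) := by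
          rw [Real.exp_neg]; field_simp
  have h2 : |A * (Real.exp (-(lam * t)) * J₂ 0 - J₂ t)| ≤ A * (2 * CJ) := by
    rw [abs_mul, abs_of_nonneg hA0]
    refine mul_le_mul_of_nonneg_left ?_ hA0
    calc |Real.exp (-(lam * t)) * J₂ 0 - J₂ t| ≤ |Real.exp (-(lam * t)) * J₂ 0| + |J₂ t| := abs_sub _ _
      _ ≤ CJ + CJ := by
          rw [abs_mul, abs_of_nonneg he0]
          have : Real.exp (-(lam * t)) * |J₂ 0| ≤ 1 * CJ := mul_le_mul he1 hJ0 (abs_nonneg _) zero_le_one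
          linarith
      _ = 2 * CJ := by ring
  have h3 : (lam * CJ + Kχ / (2 * (α * c))) * t ≤ 4 * Real.pi ^ 2 * κ * ‖ℓ‖ ^ 2 * T * CJ + Kχ * T / (2 * c) := by
    have hlam' : lam * (α * T) = 4 * Real.pi ^ 2 * κ * ‖ℓ‖ ^ 2 * T := by
      rw [hlam, hA, hρ]; field_simp; ring
    have hK' : Kχ / (2 * (α * c)) * (α * T) = Kχ * T / (2 * c) := by field_simp
    calc (lam * CJ + Kχ / (2 * (α * c))) * t ≤ (lam * CJ + Kχ / (2 * (α * c))) * (α * T) :=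
          mul_le_mul_of_nonneg_left htT hK₀
      _ = lam * (α * T) * CJ + Kχ / (2 * (α * c)) * (α * T) := by ring
      _ = _ := by rw [hlam', hK']
  calc |Real.exp (-(lam * t)) * (Φ t - Φ 0) + A * (Real.exp (-(lam * t)) * J₂ 0 - J₂ t)|
      ≤ |Real.exp (-(lam * t)) * (Φ t - Φ 0)| + |A * (Real.exp (-(lam * t)) * J₂ 0 - J₂ t)| := abs_add_le _ _
    _ ≤ A * ((lam * CJ + Kχ / (2 * (α * c))) * t + α / 2 * (1 / (2 * α))) + A * (2 * CJ) := add_le_add h1 h2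
    _ = A * ((lam * CJ + Kχ / (2 * (α * c))) * t + 1 / 4 + 2 * CJ) := by field_simp; ring
    _ ≤ A * (4 * Real.pi ^ 2 * κ * ‖ℓ‖ ^ 2 * T * CJ + Kχ * T / (2 * c) + 1 / 4 + 2 * CJ) := by
        refine mul_le_mul_of_nonneg_left ?_ hA0
        linarith

include hd hβ hb in
/-- **Relaxation of the mean, imaginary part**: under the hypotheses of `abs_meanRe_sub_exp_le`,
`|m₂(t)| ≤ (2π/α) (4π² κ |ℓ|² T C_J + K_χ T/(2c) + 1/4 + 2 C_J)` (`m₂(0) = 0`; the function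
`Φ₂(s) = e^{λ' s}(m₂ - (2π/α) J₁)` has `Φ₂' = -(2π/α) e^{λ' s}(I₂ + λ' J₁)`).
[cite: BodineauGallagherSaintRaymondInvent2016, §6.1.2–6.1.3] -/
theorem abs_meanIm_le [DecidableEq d] {c : ℝ} (hc : 0 < c)
    (hgap : ∀ h : 𝔼 → ℝ, FiniteEnergy β h →
      c * ∫ v, (h v - ∫ w, h w * maxwellianBeta β w) ^ 2 * (collisionFrequency β v * maxwellianBeta β v) ≤ dirichletForm β h h)
    {α : ℝ} (hα : 1 ≤ α) {T : ℝ} {t : ℝ} (ht0 : 0 ≤ t) (htT : t ≤ α * T) :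
    |profileMoment n β α Complex.imCLM (fun _ => 1) t| ≤
      2 * Real.pi / α * (4 * Real.pi ^ 2 * bgsrDiffusionCoeff β b *
          ‖Literature.Analysis.FunctionSpaces.Torus.latticeVec n‖ ^ 2 * T *
          (2 * ∫ v, |⟪Literature.Analysis.FunctionSpaces.Torus.latticeVec n, b v⟫_ℝ| * maxwellianBeta β v) +
        (∫ v, (modePhase n v * ⟪Literature.Analysis.FunctionSpaces.Torus.latticeVec n, b v⟫_ℝ) ^ 2 /
          collisionFrequency β v * maxwellianBeta β v) * T / (2 * c) + 1 / 4 +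
        2 * (2 * ∫ v, |⟪Literature.Analysis.FunctionSpaces.Torus.latticeVec n, b v⟫_ℝ| * maxwellianBeta β v)) := by
  have hα0 : 0 < α := by linarith
  have hπ : 0 < Real.pi := Real.pi_pos
  set ℓ := Literature.Analysis.FunctionSpaces.Torus.latticeVec n with hℓ
  set κ := bgsrDiffusionCoeff β b with hκ
  have hκ0 : 0 < κ := bgsr_diffusionCoeff_pos_holds hd hβ b hb
  set ρ : ℝ := 2 * Real.pi * (κ * ‖ℓ‖ ^ 2) with hρ
  have hρ0 : 0 ≤ ρ := by positivity
  set A : ℝ := 2 * Real.pi / α with hA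
  have hA0 : 0 ≤ A := by positivity
  set lam : ℝ := A * ρ with hlam
  have hlam0 : 0 ≤ lam := mul_nonneg hA0 hρ0
  set CJ : ℝ := 2 * ∫ v, |⟪ℓ, b v⟫_ℝ| * maxwellianBeta β v with hCJ
  have hCJ0 : 0 ≤ CJ := mul_nonneg zero_le_two (integral_nonneg fun v => mul_nonneg (abs_nonneg _) (maxwellianBeta_pos hβ v).le)
  set Kχ : ℝ := ∫ v, (modePhase n v * ⟪ℓ, b v⟫_ℝ) ^ 2 / collisionFrequency β v * maxwellianBeta β v with hKχ
  have hKχ0 : 0 ≤ Kχ := integral_nonneg fun v => mul_nonneg (div_nonneg (sq_nonneg _)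
    (TaggedLinearBoltzmannSeries.collisionFrequency_nonneg hβ v)) (maxwellianBeta_pos hβ v).le
  set m₂ := profileMoment n β α Complex.imCLM (fun _ => 1) with hm₂
  set J₁ := profileMoment n β α Complex.reCLM (fun v => ⟪ℓ, b v⟫_ℝ) with hJ₁
  set P₂ : ℝ → ℝ := fun s => ∫ v, modePhase n v * (modeProfile n β α s v).im * ⟪ℓ, b v⟫_ℝ * maxwellianBeta β v with hP₂
  set I₂ : ℝ → ℝ := fun s => P₂ s - m₂ s * ρ with hI₂
  set D : ℝ → ℝ := fun s => dirichletForm β (fun v => (modeProfile n β α s v).re) (fun v => (modeProfile n β α s v).re) +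
    dirichletForm β (fun v => (modeProfile n β α s v).im) (fun v => (modeProfile n β α s v).im) with hD
  set Φ : ℝ → ℝ := fun s => Real.exp (lam * s) * (m₂ s - A * J₁ s) with hΦ
  set Φ' : ℝ → ℝ := fun s => -(A * Real.exp (lam * s) * (I₂ s + lam * J₁ s)) with hΦ'
  have hρint : ∫ v, modePhase n v * ⟪ℓ, b v⟫_ℝ * maxwellianBeta β v = ρ := by
    rw [hρ, hℓ]; exact integral_modePhase_mul_inner hd hβ n hb
  have hψ1 : Integrable fun v : 𝔼 => |(1 : ℝ)| * maxwellianBeta β v :=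
    (KineticTheory.integrable_maxwellianBeta hβ).congr (Eventually.of_forall fun v => by simp)
  have hm₂c : Continuous m₂ := continuous_profileMoment hβ hα0.le n Complex.imCLM abs_imCLM_le measurable_const hψ1
  have hJ₁c : Continuous J₁ := continuous_profileMoment hβ hα0.le n Complex.reCLM abs_reCLM_le
    (measurable_const.inner hb.1) (hb.integrable_abs_inner hd hβ ℓ)
  have hP₂c : Continuous P₂ := by
    have h := continuous_profileMoment hβ hα0.le n Complex.imCLM abs_imCLM_le
      ((continuous_modePhase n).measurable.mul (measurable_const.inner hb.1)) (hb.integrable_abs_modePhase_mul_inner hd hβ n ℓ)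
    have e : P₂ = profileMoment n β α Complex.imCLM (fun v => modePhase n v * ⟪ℓ, b v⟫_ℝ) := by
      funext s
      simp only [hP₂, profileMoment, Complex.imCLM_apply]
      exact integral_congr_ae (Eventually.of_forall fun v => by ring)
    rw [e]; exact h
  have hDc : Continuous D := continuous_dissipation hd hβ hα0.le n hα0
  have hΦc : Continuous Φ := (Real.continuous_exp.comp (continuous_const.mul continuous_id)).mul
    (hm₂c.sub (continuous_const.mul hJ₁c))
  have hΦ'c : Continuous Φ' := ((continuous_const.mul (Real.continuous_exp.comp (continuous_const.mul continuous_id))).mul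
    ((hP₂c.sub (hm₂c.mul continuous_const)).add (continuous_const.mul hJ₁c))).neg
  have hΦd : ∀ s, 0 < s → HasDerivAt Φ (Φ' s) s := by
    intro s hs
    have he : HasDerivAt (fun s => Real.exp (lam * s)) (Real.exp (lam * s) * (lam * 1)) s :=
      ((hasDerivAt_id s).const_mul lam).exp
    have hm := hasDerivAt_meanIm hd hβ hα0.le n hs
    have hJ := hasDerivAt_testRe hd hβ hα0.le n hb hs
    have h := he.mul (hm.sub (hJ.const_mul A))
    refine h.congr_deriv ?_
    simp only [hΦ', hI₂, hP₂, hlam, hA, hm₂, hJ₁, hℓ, Pi.sub_apply]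
    field_simp
    ring
  have hbound : ∀ s ∈ Icc 0 t, |Φ' s| ≤ A * Real.exp (lam * s) * ((lam * CJ + Kχ / (2 * (α * c))) + α / 2 * D s) := by
    intro s _
    have hJb : |J₁ s| ≤ CJ := abs_profileMoment_inner_le hd hβ hα0.le n hb Complex.reCLM abs_reCLM_le ℓ s
    have hIb : 2 * |I₂ s| ≤ α * D s + Kχ / (α * c) := by
      have h := two_abs_crossMoment_le hd hβ n hb ℓ hc hgap hα0 (measurable_im_modeProfile hβ hα0.le n s)
        (abs_im_modeProfile_le hβ hα0.le n s)
      have hm2s : m₂ s = ∫ v, (modeProfile n β α s v).im * maxwellianBeta β v := profileMoment_imCLM_one n s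
      have eI : I₂ s = (∫ v, modePhase n v * (modeProfile n β α s v).im * ⟪ℓ, b v⟫_ℝ * maxwellianBeta β v) -
          (∫ v, (modeProfile n β α s v).im * maxwellianBeta β v) * ∫ v, modePhase n v * ⟪ℓ, b v⟫_ℝ * maxwellianBeta β v := by
        simp only [hI₂, hP₂]; rw [hρint, hm2s]
      rw [eI]
      have hB1 : 0 ≤ dirichletForm β (fun v => (modeProfile n β α s v).re) (fun v => (modeProfile n β α s v).re) :=
        dirichletForm_self_nonneg hd hβ (finiteEnergy_of_bounded hβ (measurable_re_modeProfile hβ hα0.le n s)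
          (abs_re_modeProfile_le hβ hα0.le n s))
      have : α * dirichletForm β (fun v => (modeProfile n β α s v).im) (fun v => (modeProfile n β α s v).im) ≤ α * D s := by
        simp only [hD]; nlinarith
      linarith
    have hexp : 0 ≤ A * Real.exp (lam * s) := mul_nonneg hA0 (Real.exp_nonneg _)
    simp only [hΦ']
    rw [abs_neg, abs_mul, abs_of_nonneg hexp]
    refine mul_le_mul_of_nonneg_left ?_ hexp
    calc |I₂ s + lam * J₁ s| ≤ |I₂ s| + |lam * J₁ s| := abs_add_le _ _
      _ ≤ (α * D s + Kχ / (α * c)) / 2 + lam * CJ := by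
          rw [abs_mul, abs_of_nonneg hlam0]
          have := mul_le_mul_of_nonneg_left hJb hlam0
          linarith
      _ = lam * CJ + Kχ / (2 * (α * c)) + α / 2 * D s := by ring
  have hK₀ : 0 ≤ lam * CJ + Kχ / (2 * (α * c)) := by positivity
  have hDu := abs_sub_le_of_deriv_bound ht0 hlam0 hA0 hK₀ (by positivity : (0 : ℝ) ≤ α / 2) hΦc.continuousOn
    (fun s hs => hΦd s hs.1) (hΦ'c.intervalIntegrable 0 t) hDc (fun s => dissipation_nonneg hd hβ hα0.le n s)
    (integral_dissipation_le hd hβ n hα0 ht0) hbound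
  have hm20 : m₂ 0 = 0 := profileMoment_imCLM_one_zero n
  have hΦ0 : Φ 0 = -(A * J₁ 0) := by simp only [hΦ, mul_zero, Real.exp_zero, one_mul, hm20, zero_sub]
  have hkey : m₂ t = Real.exp (-(lam * t)) * (Φ t - Φ 0) + A * (J₁ t - Real.exp (-(lam * t)) * J₁ 0) := by
    rw [hΦ0]; simp only [hΦ]
    rw [Real.exp_neg]
    field_simp
    ring
  rw [hkey]
  have hJ0 : |J₁ 0| ≤ CJ := abs_profileMoment_inner_le hd hβ hα0.le n hb Complex.reCLM abs_reCLM_le ℓ 0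
  have hJt : |J₁ t| ≤ CJ := abs_profileMoment_inner_le hd hβ hα0.le n hb Complex.reCLM abs_reCLM_le ℓ t
  have he1 : Real.exp (-(lam * t)) ≤ 1 := by rw [Real.exp_le_one_iff]; nlinarith
  have he0 : 0 ≤ Real.exp (-(lam * t)) := Real.exp_nonneg _
  have h1 : |Real.exp (-(lam * t)) * (Φ t - Φ 0)| ≤ A * ((lam * CJ + Kχ / (2 * (α * c))) * t + α / 2 * (1 / (2 * α))) := by
    rw [abs_mul, abs_of_nonneg he0]
    calc Real.exp (-(lam * t)) * |Φ t - Φ 0|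
        ≤ Real.exp (-(lam * t)) * (A * Real.exp (lam * t) * ((lam * CJ + Kχ / (2 * (α * c))) * t + α / 2 * (1 / (2 * α)))) :=
          mul_le_mul_of_nonneg_left hDu he0
      _ = A * ((lam * CJ + Kχ / (2 * (α * c))) * t + α / 2 * (1 / (2 * α))) := by
          rw [Real.exp_neg]; field_simp
  have h2 : |A * (J₁ t - Real.exp (-(lam * t)) * J₁ 0)| ≤ A * (2 * CJ) := by
    rw [abs_mul, abs_of_nonneg hA0]
    refine mul_le_mul_of_nonneg_left ?_ hA0
    calc |J₁ t - Real.exp (-(lam * t)) * J₁ 0| ≤ |J₁ t| + |Real.exp (-(lam * t)) * J₁ 0| := abs_sub _ _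
      _ ≤ CJ + CJ := by
          rw [abs_mul, abs_of_nonneg he0]
          have : Real.exp (-(lam * t)) * |J₁ 0| ≤ 1 * CJ := mul_le_mul he1 hJ0 (abs_nonneg _) zero_le_one
          linarith
      _ = 2 * CJ := by ring
  have h3 : (lam * CJ + Kχ / (2 * (α * c))) * t ≤ 4 * Real.pi ^ 2 * κ * ‖ℓ‖ ^ 2 * T * CJ + Kχ * T / (2 * c) := by
    have hlam' : lam * (α * T) = 4 * Real.pi ^ 2 * κ * ‖ℓ‖ ^ 2 * T := by
      rw [hlam, hA, hρ]; field_simp; ring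
    have hK' : Kχ / (2 * (α * c)) * (α * T) = Kχ * T / (2 * c) := by field_simp
    calc (lam * CJ + Kχ / (2 * (α * c))) * t ≤ (lam * CJ + Kχ / (2 * (α * c))) * (α * T) :=
          mul_le_mul_of_nonneg_left htT hK₀
      _ = lam * (α * T) * CJ + Kχ / (2 * (α * c)) * (α * T) := by ring
      _ = _ := by rw [hlam', hK']
  calc |Real.exp (-(lam * t)) * (Φ t - Φ 0) + A * (J₁ t - Real.exp (-(lam * t)) * J₁ 0)|
      ≤ |Real.exp (-(lam * t)) * (Φ t - Φ 0)| + |A * (J₁ t - Real.exp (-(lam * t)) * J₁ 0)| := abs_add_le _ _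
    _ ≤ A * ((lam * CJ + Kχ / (2 * (α * c))) * t + α / 2 * (1 / (2 * α))) + A * (2 * CJ) := add_le_add h1 h2
    _ = A * ((lam * CJ + Kχ / (2 * (α * c))) * t + 1 / 4 + 2 * CJ) := by field_simp; ring
    _ ≤ A * (4 * Real.pi ^ 2 * κ * ‖ℓ‖ ^ 2 * T * CJ + Kχ * T / (2 * c) + 1 / 4 + 2 * CJ) := by
        refine mul_le_mul_of_nonneg_left ?_ hA0
        linarith

end MeanBound

/-! ## The `L²(M_β)` relaxation of the profile -/

section Relaxation

open TaggedSphereDiffusion (collisionFrequency)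

variable (hd : 2 ≤ Fintype.card d) {β : ℝ} (hβ : 0 < β) (n : d → ℤ)
  {b : EuclideanSpace ℝ d → EuclideanSpace ℝ d} (hb : IsDiffusionCorrector β b)

include hβ in
/-- **Bias–variance decomposition**: for real `E`,
`∫ |ĝ - E|² M_β = (Energy - m₁² - m₂²) + (m₁ - E)² + m₂²`. [folklore] -/
theorem integral_normSq_sub_const_eq {α : ℝ} (hα : 0 ≤ α) (t E : ℝ) :
    ∫ v, ‖modeProfile n β α t v - (E : ℂ)‖ ^ 2 * maxwellianBeta β v =
      (profileEnergy n β α t - profileMoment n β α Complex.reCLM (fun _ => 1) t ^ 2 -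
        profileMoment n β α Complex.imCLM (fun _ => 1) t ^ 2) +
      (profileMoment n β α Complex.reCLM (fun _ => 1) t - E) ^ 2 + profileMoment n β α Complex.imCLM (fun _ => 1) t ^ 2 := by
  rw [profileEnergy_sub_sq_eq hβ hα n t]
  set m₁ := profileMoment n β α Complex.reCLM (fun _ => 1) t with hm₁
  set m₂ := profileMoment n β α Complex.imCLM (fun _ => 1) t with hm₂
  have hmean1 : ∫ v, (modeProfile n β α t v).re * maxwellianBeta β v = m₁ := (profileMoment_reCLM_one n t).symm
  have hmean2 : ∫ v, (modeProfile n β α t v).im * maxwellianBeta β v = m₂ := (profileMoment_imCLM_one n t).symm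
  have hm1m := measurable_re_modeProfile hβ hα n t
  have hm2m := measurable_im_modeProfile hβ hα n t
  have hb1 := abs_re_modeProfile_le hβ hα n t
  have hb2 := abs_im_modeProfile_le hβ hα n t
  have hM := KineticTheory.integrable_maxwellianBeta (d := d) hβ
  have hM1 := KineticTheory.integral_maxwellianBeta (d := d) hβ
  have hsub1 : ∀ v, |(modeProfile n β α t v).re - m₁| ≤ 1 + |m₁| := fun v => by
    have := abs_sub ((modeProfile n β α t v).re) m₁; linarith [hb1 v]
  have hsub2 : ∀ v, |(modeProfile n β α t v).im - m₂| ≤ 1 + |m₂| := fun v => by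
    have := abs_sub ((modeProfile n β α t v).im) m₂; linarith [hb2 v]
  -- pointwise expansion
  have e : ∀ v, ‖modeProfile n β α t v - (E : ℂ)‖ ^ 2 * maxwellianBeta β v =
      (((modeProfile n β α t v).re - m₁) ^ 2 + ((modeProfile n β α t v).im - m₂) ^ 2) * maxwellianBeta β v +
        (2 * (m₁ - E) * (((modeProfile n β α t v).re - m₁) * maxwellianBeta β v) +
          2 * m₂ * (((modeProfile n β α t v).im - m₂) * maxwellianBeta β v)) +
        ((m₁ - E) ^ 2 + m₂ ^ 2) * maxwellianBeta β v := by
    intro v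
    rw [Complex.sq_norm, Complex.normSq_apply, Complex.sub_re, Complex.sub_im, Complex.ofReal_re, Complex.ofReal_im]
    ring
  -- integrability
  have j12 : Integrable fun v => (((modeProfile n β α t v).re - m₁) ^ 2 + ((modeProfile n β α t v).im - m₂) ^ 2) *
      maxwellianBeta β v := by
    have j1 := integrable_bdd_mul_mul_maxwellianBeta hβ (f := fun v => (modeProfile n β α t v).re - m₁)
      (h := fun v => (modeProfile n β α t v).re - m₁) (hm1m.sub measurable_const) (hm1m.sub measurable_const)
      (W := fun _ : 𝔼 => 1 + |m₁|) (hM.const_mul _) hsub1 hsub1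
    have j2 := integrable_bdd_mul_mul_maxwellianBeta hβ (f := fun v => (modeProfile n β α t v).im - m₂)
      (h := fun v => (modeProfile n β α t v).im - m₂) (hm2m.sub measurable_const) (hm2m.sub measurable_const)
      (W := fun _ : 𝔼 => 1 + |m₂|) (hM.const_mul _) hsub2 hsub2
    exact (j1.add j2).congr (Eventually.of_forall fun v => by
      show ((modeProfile n β α t v).re - m₁) * ((modeProfile n β α t v).re - m₁) * maxwellianBeta β v +
        ((modeProfile n β α t v).im - m₂) * ((modeProfile n β α t v).im - m₂) * maxwellianBeta β v = _
      ring)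
  have k1 : Integrable fun v => ((modeProfile n β α t v).re - m₁) * maxwellianBeta β v := by
    have := integrable_bdd_mul_mul_maxwellianBeta hβ (f := fun _ : 𝔼 => (1 : ℝ)) (h := fun v => (modeProfile n β α t v).re - m₁)
      measurable_const (hm1m.sub measurable_const) (W := fun _ : 𝔼 => (1 : ℝ)) (hM.congr (Eventually.of_forall fun v => by simp))
      (fun _ => by simp) hsub1
    simpa using this
  have k2 : Integrable fun v => ((modeProfile n β α t v).im - m₂) * maxwellianBeta β v := by
    have := integrable_bdd_mul_mul_maxwellianBeta hβ (f := fun _ : 𝔼 => (1 : ℝ)) (h := fun v => (modeProfile n β α t v).im - m₂)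
      measurable_const (hm2m.sub measurable_const) (W := fun _ : 𝔼 => (1 : ℝ)) (hM.congr (Eventually.of_forall fun v => by simp))
      (fun _ => by simp) hsub2
    simpa using this
  have hk1 : ∫ v, ((modeProfile n β α t v).re - m₁) * maxwellianBeta β v = 0 := by
    have i0 : Integrable fun v => (modeProfile n β α t v).re * maxwellianBeta β v := by
      have := integrable_bdd_mul_mul_maxwellianBeta hβ (f := fun _ : 𝔼 => (1 : ℝ)) (h := fun v => (modeProfile n β α t v).re)
        measurable_const hm1m (W := fun _ : 𝔼 => (1 : ℝ)) (hM.congr (Eventually.of_forall fun v => by simp)) (fun _ => by simp) hb1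
      simpa using this
    have ee : (fun v => ((modeProfile n β α t v).re - m₁) * maxwellianBeta β v) =
        fun v => (modeProfile n β α t v).re * maxwellianBeta β v - m₁ * maxwellianBeta β v := by funext v; ring
    rw [ee, integral_sub i0 (hM.const_mul _), integral_const_mul, hmean1, hM1]; ring
  have hk2 : ∫ v, ((modeProfile n β α t v).im - m₂) * maxwellianBeta β v = 0 := by
    have i0 : Integrable fun v => (modeProfile n β α t v).im * maxwellianBeta β v := by
      have := integrable_bdd_mul_mul_maxwellianBeta hβ (f := fun _ : 𝔼 => (1 : ℝ)) (h := fun v => (modeProfile n β α t v).im)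
        measurable_const hm2m (W := fun _ : 𝔼 => (1 : ℝ)) (hM.congr (Eventually.of_forall fun v => by simp)) (fun _ => by simp) hb2
      simpa using this
    have ee : (fun v => ((modeProfile n β α t v).im - m₂) * maxwellianBeta β v) =
        fun v => (modeProfile n β α t v).im * maxwellianBeta β v - m₂ * maxwellianBeta β v := by funext v; ring
    rw [ee, integral_sub i0 (hM.const_mul _), integral_const_mul, hmean2, hM1]; ring
  have l1 : Integrable fun v => 2 * (m₁ - E) * (((modeProfile n β α t v).re - m₁) * maxwellianBeta β v) := k1.const_mul _
  have l2 : Integrable fun v => 2 * m₂ * (((modeProfile n β α t v).im - m₂) * maxwellianBeta β v) := k2.const_mul _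
  have l12 : Integrable fun v => 2 * (m₁ - E) * (((modeProfile n β α t v).re - m₁) * maxwellianBeta β v) +
      2 * m₂ * (((modeProfile n β α t v).im - m₂) * maxwellianBeta β v) := l1.add l2
  have l3 : Integrable fun v : 𝔼 => ((m₁ - E) ^ 2 + m₂ ^ 2) * maxwellianBeta β v := hM.const_mul _
  have l123 : Integrable fun v => (((modeProfile n β α t v).re - m₁) ^ 2 + ((modeProfile n β α t v).im - m₂) ^ 2) *
      maxwellianBeta β v + (2 * (m₁ - E) * (((modeProfile n β α t v).re - m₁) * maxwellianBeta β v) +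
        2 * m₂ * (((modeProfile n β α t v).im - m₂) * maxwellianBeta β v)) := j12.add l12
  simp_rw [e]
  rw [integral_add l123 l3, integral_add j12 l12, integral_add l1 l2, integral_const_mul, integral_const_mul,
    integral_const_mul, hk1, hk2, hM1]
  ring

include hd hβ hb in
/-- **`L²(M_β)` relaxation of the velocity profile of a Fourier mode** (the quantitative heart
of BGSR (6.3) for single-mode data): for every `T ≥ 0` there is `C ≥ 0` (depending on
`d, β, b, n, T`) such that for every `α ≥ 1` and `0 ≤ t ≤ αT`,
`∫ |ĝ_n(t, v) - e^{-(4π² κ_β |n|² / α) t}|² M_β(v) dv ≤ C / α²`, `|n| = ‖latticeVec n‖`.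
Bias–variance: the variance is `≤ Θ/α²` (`exists_variance_bound`) and the mean is within
`C_m/α` of `(e^{-λ' t}, 0)` (`abs_meanRe_sub_exp_le`, `abs_meanIm_le`).
[cite: BodineauGallagherSaintRaymondInvent2016, (6.3) and §6.1.2–6.1.3] -/
theorem modeProfile_sq_relaxation [DecidableEq d] {T : ℝ} (hT : 0 ≤ T) :
    ∃ C : ℝ, 0 ≤ C ∧ ∀ α : ℝ, 1 ≤ α → ∀ t : ℝ, 0 ≤ t → t ≤ α * T →
      ∫ v, ‖modeProfile n β α t v - (Real.exp (-(4 * Real.pi ^ 2 * bgsrDiffusionCoeff β b *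
          ‖Literature.Analysis.FunctionSpaces.Torus.latticeVec n‖ ^ 2 / α * t)) : ℂ)‖ ^ 2 * maxwellianBeta β v ≤
        C / α ^ 2 := by
  obtain ⟨Θ, hΘ, hvar⟩ := exists_variance_bound hd hβ n
  obtain ⟨c, hc, hgap⟩ := exists_spectralGap_centred (d := d) hd hβ
  set ℓ := Literature.Analysis.FunctionSpaces.Torus.latticeVec n with hℓ
  set κ := bgsrDiffusionCoeff β b with hκ
  have hκ0 : 0 < κ := bgsr_diffusionCoeff_pos_holds hd hβ b hb
  set CJ : ℝ := 2 * ∫ v, |⟪ℓ, b v⟫_ℝ| * maxwellianBeta β v with hCJ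
  have hCJ0 : 0 ≤ CJ := mul_nonneg zero_le_two (integral_nonneg fun v => mul_nonneg (abs_nonneg _) (maxwellianBeta_pos hβ v).le)
  set Kχ : ℝ := ∫ v, (modePhase n v * ⟪ℓ, b v⟫_ℝ) ^ 2 / collisionFrequency β v * maxwellianBeta β v with hKχ
  have hKχ0 : 0 ≤ Kχ := integral_nonneg fun v => mul_nonneg (div_nonneg (sq_nonneg _)
    (TaggedLinearBoltzmannSeries.collisionFrequency_nonneg hβ v)) (maxwellianBeta_pos hβ v).le
  set Cm : ℝ := 2 * Real.pi * (4 * Real.pi ^ 2 * κ * ‖ℓ‖ ^ 2 * T * CJ + Kχ * T / (2 * c) + 1 / 4 + 2 * CJ) with hCm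
  have hCm0 : 0 ≤ Cm := by positivity
  refine ⟨Θ + 2 * Cm ^ 2, by positivity, fun α hα t ht0 htT => ?_⟩
  have hα0 : 0 < α := by linarith
  set E : ℝ := Real.exp (-(4 * Real.pi ^ 2 * κ * ‖ℓ‖ ^ 2 / α * t)) with hE
  set m₁ := profileMoment n β α Complex.reCLM (fun _ => 1) t with hm₁
  set m₂ := profileMoment n β α Complex.imCLM (fun _ => 1) t with hm₂
  have h1 := hvar α hα0 t ht0
  have h2 : |m₁ - E| ≤ Cm / α := by
    have h := abs_meanRe_sub_exp_le hd hβ n hb hc hgap hα (T := T) ht0 htT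
    rw [hCm]
    calc |m₁ - E| ≤ _ := h
      _ = _ := by rw [hℓ, hκ]; ring
  have h3 : |m₂| ≤ Cm / α := by
    have h := abs_meanIm_le hd hβ n hb hc hgap hα (T := T) ht0 htT
    rw [hCm]
    calc |m₂| ≤ _ := h
      _ = _ := by rw [hℓ]; ring
  rw [integral_normSq_sub_const_eq hβ n hα0.le t E]
  have h2' : (m₁ - E) ^ 2 ≤ (Cm / α) ^ 2 := by
    rw [← sq_abs]; exact pow_le_pow_left₀ (abs_nonneg _) h2 2
  have h3' : m₂ ^ 2 ≤ (Cm / α) ^ 2 := by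
    rw [← sq_abs]; exact pow_le_pow_left₀ (abs_nonneg _) h3 2
  have e : (Θ + 2 * Cm ^ 2) / α ^ 2 = Θ / α ^ 2 + (Cm / α) ^ 2 + (Cm / α) ^ 2 := by
    field_simp; ring
  rw [e]
  linarith [h1, h2', h3']

end Relaxation

end

end Literature.MathematicalPhysics.KineticTheory
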